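import Summits.ResolutionOfSingularities.ResolutionOfSingularities.Theorems.WeightedInvariantIota3FlagBridge
import Summits.ResolutionOfSingularities.ResolutionOfSingularities.Theorems.WeightedInvariantHypersurfaceLocalGameEFTDimTwoNewton
import HarnessLib

/-!
# Sketch-R9 [OURS · L1 w43 · idea-2 gen 9] — «σ₁ is Hironaka's δ»: one-flag collapse, monotonicity in `q`,
the tangent-cone dichotomy, the δ-certificate (typed candidate), and the arithmetic core of the (o56)(b′) successor bound

Evidence for `stmt-ResolutionOfSingularities-0571` (crux `WeightedConstruction`), bearing on the door item
`stmt-ResolutionOfSingularities-19897` (`HypersurfaceCentreConstruction`, skeleton v3.10 rev 3) branch **(o56)(b′)**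
(«ν, ε, τ tie and the σ-RATIO drops at the t-homogeneous successor prime»).  Nothing here is a Literature fact; every
`def … : Prop` marked CANDIDATE is OURS and unproved.  AI-written, not expert-reviewed.

* §1 `flagContactFiltration` is MONOTONE in `q` (`flagContactFiltration_mono_q`, proved) — so the sup defining `sigmaRatioNat`
  is attained at the largest admissible `q`, namely `q = r₂`.
* §2 ONE-FLAG COLLAPSE (proved): at `q = r₂` the second flag member is absorbed by the `𝔪`-power,
  `flagContactFiltration g₁ g₂ r₂ r₁ r₂ n = ratContactFiltration g₁ r₁ r₂ n := ⨆ α, (g₁^α)·𝔪^⌈(n − r₁α)/r₂⌉` for `g₂ ∈ 𝔪`;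
  hence `FlagReaches f ν q r₁ r₂ → OneFlagReaches f ν r₁ r₂` for admissible triples: **σ₁/ν! = sup over ONE regular parameter g
  of the rational contact exponent of f along the hypersurface germ g** (= Hironaka's `δ(f; u; g)` maximised over `g`, i.e. the
  `δ` of the characteristic polyhedron — R9-B of IDEAS.md §ROUND 9).
* §3 TANGENT-CONE DICHOTOMY (proved): `ratContactFiltration g a b (aν) ≤ (g^ν) ⊔ 𝔪^(ν+1)` when `b < a`; so a ratio `> 1`
  along `g` forces `f ≡ c·g^ν (mod 𝔪^(ν+1))` — at most ONE tangent direction can carry ratio `> 1`.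
* §4 the δ-CERTIFICATE (CANDIDATE, typed): non-solvability of the δ-face initial form in ONE frame bounds `σ₁` from above; its
  lower-bound half `certificate_lowerBound` is PROVED from the tree's bridge `flagReaches_of_mem_weightedMonomialIdeal`.
* §5 the ARITHMETIC CORE of (b′) (proved): the τ = 0 witness point lands strictly below `1 + frac(r/q)` at the successor, a
  would-be canceller of a minimal low point is itself a lower witness («low points are translation-rigid»), and the `sSup` bookkeeping
  `sigmaRatioNat_mul_lt_of_slope_lt` + `sigma_ratio_drop_of_bounds` turning the slope bound into the STRICT drop of the letter.
* §6 (G5) FRAME-INDEPENDENCE in u of the certificate ideal (proved): `weightedMonomialIdeal_eq_ratContactFiltration`, `weightedMonomialIdeal_frame_independent`.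
* §7 (G4) the DIMENSION-2 BRIDGE at η (proved): `flagReaches_of_mem_weightedMonomialIdeal₂`, `ratioScale_mul_le_sigmaRatioNat_mul`.
* §8 (G1) the MONOMIAL READING (proved from the tree's unit-expansion calculus `Theorems.LocalGameEFTNewton.*`): `mem_weightedMonomialIdeal_iff_forall_le_weight`, `weight_ge_iff_point_ge`.
* §9 (G2-entrance) TANGENT RIGIDITY (proved): `tangent_rigidity` — `c·g^ν ≡ c₀·Y^ν (mod 𝔪^{ν+1})`, `c, c₀` units ⇒ `g ≡ γY (mod 𝔪²)`, `γ` a unit;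
  `competitor_tangent` — at a point with tangent cone `c₀Y^ν`, EVERY two-flag reaching a ratio `> 1` has first member `≡ γY (mod 𝔪²)`.
* §10 (G2′) REDUCTION MOD THE COMPETITOR (proved; the ROW-0 constraint only — rows j ≥ 1 still need (G2) or its mod-𝔪^N approximation):
  `ratContactFiltration_le_comap_mk` (`f ∈ RC(g;a,b;n) ⇒ f̄ ∈ 𝔪̄^{⌈n/b⌉}` in `S/(g)`), `mk_mem_map_sq_of_tangent` (`Ȳ ∈ 𝔪̄²`).
* §11 (G2″) 𝔪^N-STABILITY OF RATIONAL CONTACT (proved): `ratContactFiltration_congr_mod_pow` — `g ≡ g″ (mod 𝔪^N)`, `a ≤ bN` ⇒ `RC(g;a,b;n) = RC(g″;a,b;n)`;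
  so a competitor may be replaced by ANY 𝔪^N-approximation (e.g. `v_N·(Y − φ_N(t,z))` from an approximate IFT mod 𝔪^N) — the completion is never needed.
* §12 (G2) ELIMINATED and the RING SIDE OF (b′) ASSEMBLED (proved): with `N = 2` (§11 needs only `a ≤ 2b`) and the slope budget `K < 2`,
  contact below ratio 2 is RIGID MOD 𝔪²; `ratContactFiltration_mono_ratio` folds ratios `> 2` onto `2`; `layer_identity` + `competitor_coefficients` /
  `frame_of_layer`: a competitor of ratio `> 1` is `αt + βz + γY` with `γ` a UNIT and `β ∈ 𝔪` (from the degree-ν layer of `f₁` alone: unit at `Y^ν`,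
  every other layer monomial divisible by `t`); `successorRatioBound_of_frames` = the abstract reduction of `SuccessorRatioBound` to weighted
  NON-membership along such forms with `(q+ρ)b ≤ aq`, `a ≤ 2b`; `nonmem_of_representatives`: only the TRANSLATES `Y − c·t`, `c` running over
  any set `Λ` of residue representatives (constants at a `k`-rational point), matter; `successorRatioBound_of_lowWitnesses` (+ `_rational`) = **the ring side of (o56)(b′) in one theorem**: `SuccessorRatioBound T f ν q ρ`
  follows from the layer data and, for each representative `c ∈ Λ` and ratio `A/B ∈ [K,2]`, a unit expansion of `f` in the frame `(t, z, Y − c·t)` with ONE monomial of `(t,z)`-value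
  `< K` — which the door gets from τ(η) = 0 by the tree's jets lemma (`weightedMonomialIdeal_eq_of_forall_sub_mem`, [Wlodarczyk2022, 2.1.12]) applied to
  the `S`-frame change `y ↦ y − c·x^{b+1}`, the §8 reading and `witness_lands_low` (§5).  NO implicit function, NO completion, NO Weierstrass, and
  `no_canceller` is no longer load-bearing (pure-`z` translations of order ≥ 2 are invisible below ratio 2).  Axioms of the assembled theorem:
  propext, Classical.choice, Quot.sound.
* §13 DOOR HELPERS (proved): `weightedMonomialIdeal_update_add_mul_pow_eq` / `tauFrame_translate_eq` (weight-`≥` translation `uᵢ ↦ uᵢ + c·uⱼ^e`,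
  `wᵢ ≤ wⱼe`, keeps every `W(·;n)` — the rigid `τ = 0` test transports under `y ↦ y + c·x^{b+1}`, `r + 1 ≤ q(b+1)`),
  `add_pow_sub_pow_mem_weightedMonomialIdeal` / `layer_transport` (STRICT `wᵢ + 1 ≤ wⱼe`: a weight-`n` layer keeps its exponent set AND
  coefficients mod `W_{n+1}` — the `δ_η`-face, `Δ(face)`, the ν-tie data and preparedness are literally the same in the translated frame),
  `order_drops_over_eta_arith` (R9.12 (C): over the generic point `η` of `C` the order always drops, `q ≥ 2` arithmetic).
* §14 CHART PULL-BACK (proved, model-independent): for ANY ring map `φ : S → T` into a regular local ring with `φ x = t`, `φ y = t^b·Y`,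
  `φ(𝔪_S) ⊆ 𝔪_T`, `t ∉ 𝔪_T²`, a unit expansion of `f` mod `𝔪_S^M` with the cylinder condition `bν ≤ α₀ + bα₁` on its exponents pulls back
  to a unit expansion of `f₁ = φ(f)/t^{bν}` mod `𝔪_T^{M−bν}` (`chart_pullback_expansion`; cancellation of `t^{bν}` by the order valuation,
  `Literature…mul_not_mem_pow_of_not_mem_pow`), and an S-side `τ = 0` witness becomes the LOW exponent of `hWit` (`lowWitness_of_chart`,
  via `witness_lands_low`); §14b the «cylinder-OR-deep» form (`le_or_le_of_scaled`, `weightedMonomialIdeal_mono_weights`,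
  `chart_pullback_expansion_of_deep`, `lowWitness_of_chart_of_deep`): reading `f ∈ W((x,y,z);(1,b,0);bν)` with SCALED positive weights
  `(L, Lb, 1)` (the tree reading needs positive weights) gives «cylinder or `z`-degree `≥ L`» per exponent, and the deep terms are absorbed by
  the remainder; §14c `layerData_of_chart` = the layer data (D2) (`{Y^ν} ∪ t·(…)`, unit at `Y^ν`) from the same pull-back when `ν`
  persists; §14d `successorRatioBound_of_chart` = (b′)'s ring side from a chart model + an S-side EXPANSION ORACLE; §14e
  `successorRatioBound_of_frameFacts` = **the ring side of (o56)(b′) in final form**: from `S` regular of dimension 3 with frame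
  `(x,y,z)`, the frame facts (F0) `f ∈ 𝔪_S^ν ∖ 𝔪_S^{ν+1}`, (F1) `f ∈ W((x,y,z);(1,b,0);bν)` (cylinder), (F2) `f ∈ W((x,y,z);(q,r,0);rν)`
  (`δ_η`-prepared), (F3) `f ∉ W((x,y,z);(q,r+1,1);(r+1)ν)` (`τ = 0`), ANY ring map `φ : S → T` (`T` regular of dimension 3, frame
  `(t, φ z, Y)`) with `φ x = t`, `φ y = t^b·Y`, `φ(𝔪_S) ⊆ 𝔪_T`, `t ∉ 𝔪_T²`, `φ f = t^{bν}·f₁`, residue representatives `Λ ⊆ S`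
  (`∀ w, ∃ c ∈ Λ, w − φ c ∈ 𝔪_T`) and persistence `f₁ ∈ 𝔪_T^ν` ⟹ `SuccessorRatioBound T f₁ ν q ρ` (`0 < b`, `0 < ν`, `0 < ρ < q`,
  `r = qb + ρ`).  The oracle is discharged by ONE `exists_unitExpansion` per `(c, M)` in the translated frame and four positive-weight
  readings (`frame_translate_eq`, `weightedMonomialIdeal_mono_weights`, `le_or_le_of_scaled`).  What is left for the door (D1) is to
  EXHIBIT `φ` (the local ring of the `x`-chart of the weighted blow-up at the successor point) and the frame facts from the cell's
  definitions of CURVE°, `δ_η`, `τ`.  §15 (R9.15) TORUS TRANSFER: every theorem of the chain is first proved in ONE-FLAG form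
  (`OneFlagRatioBound`: `∀ g ∈ 𝔪, ∀ a ≥ b > 0, f₁ ∈ RC(g;a,b;aν) → a·q < (q+ρ)·b`; `oneFlagRatioBound_of_frames|lowWitnesses|chart|frameFacts`,
  the two-flag forms kept as corollaries under their names of record), and the one-flag bound DESCENDS along any ring map `π : T' → T`
  with `π(𝔪_{T'}) ⊆ 𝔪_T` (`ratContactFiltration_map_le`, `OneFlagRatioBound.of_map`, `successorRatioBound_of_map`; `IsLocalHom` and
  surjective forms of the hypothesis): the door's successor germs are the local rings `B_𝔫` of the cobordant algebra (dimension `4` at a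
  closed orbit point, a localization of `T₃[X]`), and the bound is pulled back to `B_𝔫` from the dimension-3 quotient `B_𝔫 ⧸ (v)` where
  `oneFlagRatioBound_of_frameFacts` applies — the torus direction costs nothing.  Axioms: propext, Classical.choice, Quot.sound.
-/

noncomputable section

open IsLocalRing Literature.AlgebraicGeometry.Resolution

set_option linter.dupNamespace false

namespace Summit.ResolutionOfSingularities.ResolutionOfSingularities.Cruxes.HypersurfaceCentreConstruction.LocalEngine

namespace Iota3

namespace R9

universe u

variable {S : Type u} [CommRing S] [IsLocalRing S]

/-! ## §1 Monotonicity in `q` -/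

/-- Ceilings decrease as the denominator grows: `⌈N/q'⌉ ≤ ⌈N/q⌉` for `0 < q ≤ q'` (in `ℕ`-arithmetic). [folklore] -/
theorem ceilDiv_anti {N q q' : ℕ} (hq : 0 < q) (hqq' : q ≤ q') : (N + q' - 1) / q' ≤ (N + q - 1) / q := by
  have hq' : 0 < q' := lt_of_lt_of_le hq hqq'
  obtain ⟨k, hk⟩ : ∃ k, k = (N + q - 1) / q := ⟨_, rfl⟩
  rw [← hk]
  have h1 : N ≤ k * q := by
    have := Nat.lt_div_mul_add (a := N + q - 1) hq
    rw [← hk] at this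
    omega
  have h2 : k * q ≤ k * q' := Nat.mul_le_mul_left k hqq'
  apply Nat.le_of_lt_succ
  rw [Nat.div_lt_iff_lt_mul hq']
  have h3 : (k + 1) * q' = k * q' + q' := by ring
  rw [Nat.succ_eq_add_one, h3]
  omega

/-- [OURS · R9-B1] `flagContactFiltration` is monotone in `q`: a larger `q` means smaller weights `r₁/q, r₂/q` on the flag,
hence smaller `𝔪`-exponents `⌈(n − r₁α − r₂β)/q⌉`, hence a LARGER ideal. [folklore] -/
theorem flagContactFiltration_mono_q (g₁ g₂ : S) {q q' : ℕ} (hq : 0 < q) (hqq' : q ≤ q') (r₁ r₂ n : ℕ) :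
    flagContactFiltration g₁ g₂ q r₁ r₂ n ≤ flagContactFiltration g₁ g₂ q' r₁ r₂ n := by
  rw [flagContactFiltration_def, flagContactFiltration_def]
  refine iSup_le fun α => iSup_le fun β => le_iSup_of_le α (le_iSup_of_le β ?_)
  exact Ideal.mul_mono_right (Ideal.pow_le_pow_right (ceilDiv_anti hq hqq'))

/-- [OURS · R9-B1] Reaching is monotone in `q`. [folklore] -/
theorem FlagReaches.mono_q {f : S} {ν q q' r₁ r₂ : ℕ} (hq : 0 < q) (hqq' : q ≤ q') (h : FlagReaches f ν q r₁ r₂) :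
    FlagReaches f ν q' r₁ r₂ := by
  obtain ⟨g₁, g₂, hfl, hf⟩ := h
  exact ⟨g₁, g₂, hfl, flagContactFiltration_mono_q g₁ g₂ hq hqq' r₁ r₂ _ hf⟩

/-! ## §2 The one-flag collapse at `q = r₂` -/

/-- [OURS · R9-B1] The **rational one-flag contact filtration** of weight `a/b` along `g`:
degree `n` is `⨆_α (g^α) · 𝔪^⌈(n − aα)/b⌉` — the monomials `u^γ g^α` with `|γ| + (a/b)α ≥ n/b`.
For `b = 1` it is 092's `contactFiltration g a`.  A predicate of the line, not a cited statement. -/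
def ratContactFiltration (g : S) (a b n : ℕ) : Ideal S :=
  ⨆ α : ℕ, Ideal.span {g ^ α} * maximalIdeal S ^ ((n - a * α + b - 1) / b)

/-- The `rfl` unfolding. [folklore] -/
theorem ratContactFiltration_def (g : S) (a b n : ℕ) :
    ratContactFiltration g a b n = ⨆ α : ℕ, Ideal.span {g ^ α} * maximalIdeal S ^ ((n - a * α + b - 1) / b) := rfl

/-- The ceiling bookkeeping of the collapse: with `q ≤ r₂` and `e = ⌈(N − r₂β)/q⌉` one has `⌈N/r₂⌉ ≤ β + e`. [folklore] -/
theorem ceil_collapse {N q r₂ β : ℕ} (hq : 0 < q) (hqr : q ≤ r₂) :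
    (N + r₂ - 1) / r₂ ≤ β + (N - r₂ * β + q - 1) / q := by
  have hr : 0 < r₂ := lt_of_lt_of_le hq hqr
  obtain ⟨e, he⟩ : ∃ e, e = (N - r₂ * β + q - 1) / q := ⟨_, rfl⟩
  rw [← he]
  have h1 : N - r₂ * β ≤ e * q := by
    have := Nat.lt_div_mul_add (a := N - r₂ * β + q - 1) hq
    rw [← he] at this
    omega
  have h2 : e * q ≤ e * r₂ := Nat.mul_le_mul_left e hqr
  apply Nat.le_of_lt_succ
  rw [Nat.div_lt_iff_lt_mul hr]
  have h3 : (β + e + 1) * r₂ = r₂ * β + e * r₂ + r₂ := by ring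
  rw [Nat.succ_eq_add_one, h3]
  omega

/-- [OURS · R9-B1] **One-flag collapse, `≤`**: for `g₂ ∈ 𝔪` and `0 < q ≤ r₂` the two-flag filtration lies in the rational
one-flag filtration of `g₁` — the factor `g₂^β` is worth at least `𝔪^β`, and `β + ⌈(N − r₂β)/q⌉ ≥ ⌈N/r₂⌉`. [folklore] -/
theorem flagContactFiltration_le_ratContactFiltration {g₁ g₂ : S} (hg₂ : g₂ ∈ maximalIdeal S) {q r₁ r₂ : ℕ}
    (hq : 0 < q) (hqr : q ≤ r₂) (n : ℕ) :
    flagContactFiltration g₁ g₂ q r₁ r₂ n ≤ ratContactFiltration g₁ r₁ r₂ n := by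
  rw [flagContactFiltration_def, ratContactFiltration_def]
  refine iSup_le fun α => iSup_le fun β => le_iSup_of_le α ?_
  have hpow : g₂ ^ β ∈ maximalIdeal S ^ β := Ideal.pow_mem_pow hg₂ β
  calc Ideal.span {g₁ ^ α * g₂ ^ β} * maximalIdeal S ^ ((n - r₁ * α - r₂ * β + q - 1) / q)
      = Ideal.span {g₁ ^ α} * (Ideal.span {g₂ ^ β} * maximalIdeal S ^ ((n - r₁ * α - r₂ * β + q - 1) / q)) := by
        rw [← Ideal.span_singleton_mul_span_singleton, mul_assoc]
    _ ≤ Ideal.span {g₁ ^ α} * (maximalIdeal S ^ β * maximalIdeal S ^ ((n - r₁ * α - r₂ * β + q - 1) / q)) :=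
        Ideal.mul_mono_right (Ideal.mul_mono_left ((Ideal.span_singleton_le_iff_mem _).mpr hpow))
    _ ≤ Ideal.span {g₁ ^ α} * maximalIdeal S ^ ((n - r₁ * α + r₂ - 1) / r₂) := by
        refine Ideal.mul_mono_right ?_
        rw [← pow_add]
        exact Ideal.pow_le_pow_right (ceil_collapse (N := n - r₁ * α) hq hqr)

/-- [OURS · R9-B1] **One-flag collapse, `≥`**: the rational one-flag filtration is the `β = 0` part of the two-flag filtration
at `q = r₂`. [folklore] -/
theorem ratContactFiltration_le_flagContactFiltration (g₁ g₂ : S) (r₁ r₂ n : ℕ) :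
    ratContactFiltration g₁ r₁ r₂ n ≤ flagContactFiltration g₁ g₂ r₂ r₁ r₂ n := by
  rw [flagContactFiltration_def, ratContactFiltration_def]
  refine iSup_le fun α => le_iSup_of_le α (le_iSup_of_le 0 ?_)
  rw [pow_zero, mul_one, Nat.mul_zero, Nat.sub_zero]

/-- [OURS · R9-B1] **One-flag collapse, `=`** at `q = r₂` (for `g₂ ∈ 𝔪`, `0 < r₂`). [folklore] -/
theorem flagContactFiltration_eq_ratContactFiltration {g₁ g₂ : S} (hg₂ : g₂ ∈ maximalIdeal S) {r₁ r₂ : ℕ}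
    (hr : 0 < r₂) (n : ℕ) : flagContactFiltration g₁ g₂ r₂ r₁ r₂ n = ratContactFiltration g₁ r₁ r₂ n :=
  le_antisymm (flagContactFiltration_le_ratContactFiltration hg₂ hr le_rfl n)
    (ratContactFiltration_le_flagContactFiltration g₁ g₂ r₁ r₂ n)

/-- [OURS · R9-B1] `f` (of order `ν`) reaches the rational weight `a/b` along ONE regular parameter `g`. A predicate of the
line, not a cited statement. -/
def OneFlagReaches (f : S) (ν a b : ℕ) : Prop :=
  ∃ g : S, g ∈ maximalIdeal S ∧ g ∉ maximalIdeal S ^ 2 ∧ f ∈ ratContactFiltration g a b (a * ν)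

/-- [OURS · R9-B1] **The sup over two-flags is a sup over one regular parameter**: an admissible triple reached by a two-flag
is reached (same `r₁, r₂`) by its first member alone. [folklore] -/
theorem FlagReaches.oneFlagReaches {f : S} {ν q r₁ r₂ : ℕ} (hadm : AdmissibleTriple q r₁ r₂)
    (h : FlagReaches f ν q r₁ r₂) : OneFlagReaches f ν r₁ r₂ := by
  obtain ⟨g₁, g₂, hfl, hf⟩ := h
  exact ⟨g₁, hfl.1, hfl.left_not_mem_sq, flagContactFiltration_le_ratContactFiltration hfl.2.1 hadm.1 hadm.2.1 _ hf⟩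

/-- [OURS · R9-B1] Conversely a one-flag reach along `g` with ANY two-flag partner `g₂` is a two-flag reach at `q = b`.
[folklore] -/
theorem flagReaches_of_mem_ratContactFiltration {f g g₂ : S} {ν a b : ℕ} (hfl : IsTwoFlag g g₂)
    (h : f ∈ ratContactFiltration g a b (a * ν)) : FlagReaches f ν b a b :=
  ⟨g, g₂, hfl, ratContactFiltration_le_flagContactFiltration g g₂ a b _ h⟩

/-! ## §3 The tangent-cone dichotomy -/

/-- The exponent bookkeeping: for `b < a`, `α < ν`: `ν + 1 ≤ α + ⌈a(ν − α)/b⌉`. [folklore] -/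
theorem succ_le_add_ceil {a b ν α : ℕ} (hb : 0 < b) (hab : b < a) (hα : α < ν) :
    ν + 1 ≤ α + (a * ν - a * α + b - 1) / b := by
  obtain ⟨e, he⟩ : ∃ e, e = (a * ν - a * α + b - 1) / b := ⟨_, rfl⟩
  rw [← he]
  have hX1 : a * ν - a * α = a * (ν - α) := (mul_tsub a ν α).symm
  have hX : (b + 1) * (ν - α) ≤ a * (ν - α) := Nat.mul_le_mul_right _ hab
  have hceil : a * ν - a * α + b - 1 < e * b + b := by
    have := Nat.lt_div_mul_add (a := a * ν - a * α + b - 1) hb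
    rwa [← he] at this
  by_contra hlt
  have hlt' : α + e < ν + 1 := Nat.lt_of_not_le hlt
  have h4 : e * b ≤ (ν - α) * b := Nat.mul_le_mul_right _ (by omega)
  have h5 : (b + 1) * (ν - α) = (ν - α) * b + (ν - α) := by ring
  omega

/-- [OURS · R9-B1′] **Tangent-cone dichotomy**: for `g ∈ 𝔪` and `b < a`,
`ratContactFiltration g a b (aν) ≤ (g^ν) ⊔ 𝔪^(ν+1)`: pieces with `α ≥ ν` are multiples of `g^ν`, pieces with `α < ν` lie in
`𝔪^(α + ⌈a(ν−α)/b⌉) ⊆ 𝔪^(ν+1)`.  Consequence: a contact ratio `> 1` along `g` forces `in_𝔪(f) = c · ḡ^ν`, so at most ONE tangent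
hyperplane direction carries ratio `> 1` (the others have ratio exactly `1`). [folklore] -/
theorem ratContactFiltration_le_span_pow_sup {g : S} (hg : g ∈ maximalIdeal S) {a b : ℕ} (hb : 0 < b) (hab : b < a)
    (ν : ℕ) : ratContactFiltration g a b (a * ν) ≤ Ideal.span {g ^ ν} ⊔ maximalIdeal S ^ (ν + 1) := by
  rw [ratContactFiltration_def]
  refine iSup_le fun α => ?_
  by_cases hα : ν ≤ α
  · refine le_sup_of_le_left ?_
    calc Ideal.span {g ^ α} * maximalIdeal S ^ ((a * ν - a * α + b - 1) / b) ≤ Ideal.span {g ^ α} := Ideal.mul_le_right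
      _ ≤ Ideal.span {g ^ ν} := Ideal.span_singleton_le_span_singleton.mpr (pow_dvd_pow g hα)
  · have hα : α < ν := Nat.lt_of_not_le hα
    refine le_sup_of_le_right ?_
    calc Ideal.span {g ^ α} * maximalIdeal S ^ ((a * ν - a * α + b - 1) / b)
        ≤ maximalIdeal S ^ α * maximalIdeal S ^ ((a * ν - a * α + b - 1) / b) :=
          Ideal.mul_mono_left ((Ideal.span_singleton_le_iff_mem _).mpr (Ideal.pow_mem_pow hg α))
      _ = maximalIdeal S ^ (α + (a * ν - a * α + b - 1) / b) := (pow_add _ _ _).symm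
      _ ≤ maximalIdeal S ^ (ν + 1) := Ideal.pow_le_pow_right (succ_le_add_ceil hb hab hα)

/-- [OURS · R9-B1′] The dichotomy as an initial-form statement: `f ∈ ratContactFiltration g a b (aν)` with `b < a` gives
`f − c·g^ν ∈ 𝔪^(ν+1)` for some `c`. [folklore] -/
theorem exists_sub_mul_pow_mem_of_mem_ratContactFiltration {f g : S} (hg : g ∈ maximalIdeal S) {a b ν : ℕ}
    (hb : 0 < b) (hab : b < a) (h : f ∈ ratContactFiltration g a b (a * ν)) :
    ∃ c : S, f - c * g ^ ν ∈ maximalIdeal S ^ (ν + 1) := by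
  have h' := ratContactFiltration_le_span_pow_sup hg hb hab ν h
  rw [Submodule.mem_sup] at h'
  obtain ⟨y, hy, z, hz, hyz⟩ := h'
  obtain ⟨c, rfl⟩ := Ideal.mem_span_singleton'.mp hy
  exact ⟨c, by rwa [show f - c * g ^ ν = z by rw [← hyz]; ring]⟩

/-- [OURS · R9-B1′] Contrapositive, the form used at a successor point: if NO `c` makes `f − c·g^ν ∈ 𝔪^(ν+1)` (the tangent cone
of `f` is not the `ν`-fold hyperplane `ḡ = 0`), then `g` reaches no weight `a/b > 1`. [folklore] -/
theorem not_mem_ratContactFiltration_of_tangent {f g : S} (hg : g ∈ maximalIdeal S) {a b ν : ℕ} (hb : 0 < b)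
    (hab : b < a) (hne : ∀ c : S, f - c * g ^ ν ∉ maximalIdeal S ^ (ν + 1)) :
    f ∉ ratContactFiltration g a b (a * ν) := fun h => by
  obtain ⟨c, hc⟩ := exists_sub_mul_pow_mem_of_mem_ratContactFiltration hg hb hab h
  exact hne c hc

/-! ## §4 The δ-certificate (CANDIDATE statements — the typing of R9-B2)

Frame: a regular system of parameters `(g, u₂, u₃)` of the regular local ring `S` (dimension 3), weights `a` on `g` and `b` on
`u₂, u₃` with `0 < b < a` (slope `δ = a/b > 1`), `W n := weightedMonomialIdeal ![g, u₂, u₃] ![a, b, b] n`.  HYPOTHESES: `f ∈ W (aν)`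
(every point of the Newton polyhedron `Δ(f; u; g)` has `|·| ≥ a/b`) and the **δ-face is not solvable**: no `c` and no `ψ` make
`f − c·(g − ψ)^ν ∈ W (aν + 1)`.  CONCLUSION: every admissible triple reached by `f` has `r₁/r₂ ≤ a/b`; with the flag `(g, u₂)`
itself reaching `a/b` this gives `sigmaRatioNat f = ν!·a/b` exactly.  Informal proof (IDEAS.md §R9-B2): one-flag collapse (§2) ⇒
only one `g'` at a time matters; dichotomy (§3) ⇒ `ḡ' ∝ ḡ`, so `g' = unit·(g − ψ)`, `ψ ∈ 𝔪²`; in the graded ring of `W` the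
`δ`-face form of `f` in the frame `g − ψ` is `In(f)(G + Ψ_δ)`, which is `c·G^ν` only if `In(f) = c(G − Ψ_δ)^ν` — excluded; so a
point of the `δ`-face survives and `δ(f; u; g − ψ) ≤ a/b`; `u`-independence of `δ(f;u;g')` (it is `sup {a'/b' : f ∈
ratContactFiltration g' a' b' (a'ν)}`) finishes.  This is the hypersurface, one-frame form of Hironaka's vertex theorem
[Hironaka 1967 (4.8) as recalled in Cossart–Jannsen–Saito, LNM 2270, Def. 8.15 / Thm. 8.16, p. 121 of the held copy] — cited as
MOTIVATION only; the statement below is OURS and must be proved in the tree. -/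

/-- [OURS · R9-B2 · CANDIDATE] The **δ-certificate hypotheses** in the r.s.p. frame `(u₃, u₂, g)` with weights `(b, b, a)` (the tree's
ordering of `flagContactFiltration_eq_weightedMonomialIdeal`: complementary parameter first, flag last). -/
def DeltaCertificate (f g u₂ u₃ : S) (ν a b : ℕ) : Prop :=
  Ideal.span {u₃, u₂, g} = maximalIdeal S ∧ 0 < b ∧ b < a ∧
    f ∈ weightedMonomialIdeal ![u₃, u₂, g] ![b, b, a] (a * ν) ∧
    ∀ c ψ : S, ψ ∈ maximalIdeal S ^ 2 → f - c * (g - ψ) ^ ν ∉ weightedMonomialIdeal ![u₃, u₂, g] ![b, b, a] (a * ν + 1)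

/-- [OURS · R9-B2 · CANDIDATE] The **ratio bound** concluded by the certificate: no admissible triple reached by `f` has slope
`r₁/r₂` above `a/b`. -/
def RatioBoundedBy (f : S) (ν a b : ℕ) : Prop :=
  ∀ q r₁ r₂ : ℕ, AdmissibleTriple q r₁ r₂ → FlagReaches f ν q r₁ r₂ → r₁ * b ≤ a * r₂

/-- [OURS · R9-B2 · CANDIDATE] **The δ-certificate lemma** (to be proved by a door typer; regular local rings of dimension 3 — the
informal proof uses a coefficient field, i.e. the door's equicharacteristic case; mixed characteristic expected but unverified;
`ν = ord f`).  The upper-bound half of «`sigmaRatioNat f = ν!·a/b`». -/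
def DeltaCertificateLemma : Prop :=
  ∀ (T : Type) [CommRing T] [IsRegularLocalRing T], ringKrullDim T = 3 →
    ∀ (f g u₂ u₃ : T) (ν a b : ℕ), f ∈ maximalIdeal T ^ ν → f ∉ maximalIdeal T ^ (ν + 1) →
      DeltaCertificate f g u₂ u₃ ν a b → RatioBoundedBy f ν a b

/-- [OURS · R9-B2] The trivial direction of the certificate frame, PROVED from the tree's bridge
`flagReaches_of_mem_weightedMonomialIdeal` (res-type-060/047): `f ∈ W(aν)` in an r.s.p. frame `(u₃, u₂, g)` of a 3-dimensional regular
local ring gives the LOWER bound — the flag `(g, u₂)` reaches the admissible triple `(q; r₁, r₂) = (b; a, b)`, i.e. slope `a/b`.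
[folklore] -/
theorem certificate_lowerBound {T : Type u} [CommRing T] [IsRegularLocalRing T] (hdim : ringKrullDim T = 3)
    {f g u₂ u₃ : T} {ν a b : ℕ} (h𝔪 : Ideal.span {u₃, u₂, g} = maximalIdeal T) (hb : 0 < b) (hba : b ≤ a)
    (hf : f ∈ weightedMonomialIdeal ![u₃, u₂, g] ![b, b, a] (a * ν)) : FlagReaches f ν b a b :=
  flagReaches_of_mem_weightedMonomialIdeal hdim h𝔪 hb le_rfl hba hf

/-- [OURS · R9-B2] … so under the certificate hypotheses the slope `a/b` IS reached (`AdmissibleTriple b a b` holds), and the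
certificate lemma would pin `σ₁/ν!` to exactly `a/b`. [folklore] -/
theorem DeltaCertificate.flagReaches {T : Type u} [CommRing T] [IsRegularLocalRing T] (hdim : ringKrullDim T = 3)
    {f g u₂ u₃ : T} {ν a b : ℕ} (h : DeltaCertificate f g u₂ u₃ ν a b) :
    AdmissibleTriple b a b ∧ FlagReaches f ν b a b :=
  ⟨⟨h.2.1, le_rfl, h.2.2.1.le⟩, certificate_lowerBound hdim h.1 h.2.1 h.2.2.1.le h.2.2.2.1⟩

/-! ## §5 The arithmetic core of (o56)(b′)

Setting of (b′) at the generic point `η` of the curve `C = V(x, y)`: frame `(x, y, z)`, `f = c₀y^ν + Σ c·y^j x^i z^k`, `δ_η = r/q`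
with `q ≥ 2`, `q ∤ r`, `b = ⌊r/q⌋`, `ρ = r − qb ∈ [1, q−1]`; the frame is `δ_η`-prepared: every monomial has `q·i ≥ r·(ν − j)`.
`τ = 0` supplies a WITNESS monomial with `q·i + k < (r+1)(ν−j)`.  The t-homogeneous successor prime with a `(ν, ε)`-tie is the
origin `𝔫₀` of the `x`-chart `x = t, y = t^b Y, z = z`, where the monomial becomes `Y^j t^(i − b(ν−j)) z^k`, a point
`((i − b(ν−j))/(ν−j), k/(ν−j))` of `Δ(f₁; t, z; Y)`.  The lemmas: (i) the witness lands at `|·| < 1 + ρ/q` (`< 2`, and `≤ r/q` as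
`b ≥ 1`); (ii) a monomial that could cancel a `|·|`-minimal witness of maximal `j` under a translation `Y ↦ Y − ψ`, `ψ ∈ (t, z)²`,
is itself a witness with larger `j` — so the witness survives every frame change tangent to `Y`, and with §2–§3 the successor's
`σ₁/ν!` is `< 1 + ρ/q ≤ r/q = σ₁(η)/ν!`: **(b′) holds with the explicit margin**. -/

/-- [OURS · R9-B3 · (i)] **The witness lands low**: from `q i ≥ r m` (prepared), `q i + k < (r+1) m` (τ-witness), `q b ≤ r`
(`b = ⌊r/q⌋`) one gets `q·((i − b m) + k) < (r + q − q b)·m`, i.e. the successor point has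
`|·| = ((i − bm) + k)/m < 1 + ρ/q`.  (`m = ν − j ≥ 1`.) [folklore] -/
theorem witness_lands_low {q r b i k m : ℕ} (hq : 0 < q) (hqb : q * b ≤ r) (hprep : r * m ≤ q * i)
    (hwit : q * i + k < (r + 1) * m) (hbm : b * m ≤ i) : q * ((i - b * m) + k) < (r + q - q * b) * m := by
  obtain ⟨i', rfl⟩ : ∃ i', i = b * m + i' := ⟨i - b * m, by omega⟩
  obtain ⟨ρ, rfl⟩ : ∃ ρ, r = q * b + ρ := ⟨r - q * b, by omega⟩
  have e1 : b * m + i' - b * m = i' := by omega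
  have e2 : q * b + ρ + q - q * b = ρ + q := by omega
  rw [e1, e2]
  have H1 : (q * b + ρ) * m = q * (b * m) + ρ * m := by ring
  have H2 : q * (b * m + i') = q * (b * m) + q * i' := by ring
  have H3 : (q * b + ρ + 1) * m = q * (b * m) + ρ * m + m := by ring
  have H4 : q * (i' + k) = q * i' + q * k := by ring
  have H5 : (ρ + q) * m = ρ * m + q * m := by ring
  rw [H1, H2] at hprep
  rw [H2, H3] at hwit
  rw [H4, H5]
  have hk : k + (q * i' - ρ * m) + 1 ≤ m := by omega
  have hmul := Nat.mul_le_mul_left q hk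
  have H6 : q * (k + (q * i' - ρ * m) + 1) = q * k + q * (q * i' - ρ * m) + q := by ring
  rw [H6] at hmul
  have H7 : q * i' - ρ * m ≤ q * (q * i' - ρ * m) := Nat.le_mul_of_pos_left _ hq
  omega

/-- [OURS · R9-B3 · (i⁺) MARGIN LAW] The sharper form found by the R9 census (2376/2376 ties, 752 equalities) and then proved:
the witness point lands at value `≤ 1 + ρ/q − 1/m` (`m = ν − j⋆ ≤ ν`), i.e. `q·((i − b m) + k) + q ≤ (r + q − q b)·m` — so the successor's
ratio is `≤ 1 + frac(r/q) − 1/ν`, with equality iff `j⋆ = 0` and `q ∣ ρν` (family `y^ν + x^{rν/q} z^{ν−1}`).  Key: `k < m` is automatic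
(`q i ≥ r m` and `q i + k < (r+1) m`). [folklore] -/
theorem witness_margin {q r b i k m : ℕ} (hq : 0 < q) (hqb : q * b ≤ r) (hprep : r * m ≤ q * i)
    (hwit : q * i + k < (r + 1) * m) (hbm : b * m ≤ i) : q * ((i - b * m) + k) + q ≤ (r + q - q * b) * m := by
  obtain ⟨i', rfl⟩ : ∃ i', i = b * m + i' := ⟨i - b * m, by omega⟩
  obtain ⟨ρ, rfl⟩ : ∃ ρ, r = q * b + ρ := ⟨r - q * b, by omega⟩
  have e1 : b * m + i' - b * m = i' := by omega
  have e2 : q * b + ρ + q - q * b = ρ + q := by omega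
  rw [e1, e2]
  have H1 : (q * b + ρ) * m = q * (b * m) + ρ * m := by ring
  have H2 : q * (b * m + i') = q * (b * m) + q * i' := by ring
  have H3 : (q * b + ρ + 1) * m = q * (b * m) + ρ * m + m := by ring
  have H4 : q * (i' + k) = q * i' + q * k := by ring
  have H5 : (ρ + q) * m = ρ * m + q * m := by ring
  rw [H1, H2] at hprep
  rw [H2, H3] at hwit
  rw [H4, H5]
  have hk : k + (q * i' - ρ * m) + 1 ≤ m := by omega
  have hmul := Nat.mul_le_mul_left q hk
  have H6 : q * (k + (q * i' - ρ * m) + 1) = q * k + q * (q * i' - ρ * m) + q := by ring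
  rw [H6] at hmul
  have H7 : q * i' - ρ * m ≤ q * (q * i' - ρ * m) := Nat.le_mul_of_pos_left _ hq
  omega

/-- [OURS · R9-B3 · (i′)] … and `1 + ρ/q ≤ r/q` as soon as `b ≥ 1` (`r > q`): `r + q − q b ≤ r`. [folklore] -/
theorem low_bound_le_ratio {q r b : ℕ} (hb : 1 ≤ b) (hqb : q * b ≤ r) : r + q - q * b ≤ r := by
  have : q ≤ q * b := Nat.le_mul_of_pos_right q hb
  omega

/-- [OURS · R9-B3 · (ii)] **Low points are translation-rigid** (the cancellation count).  Points are `(j, a, c)` =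
`Y^j t^a z^c` with `j < ν`, value `|·| = (a + c)/(ν − j)`; «low» means `q(a + c) < (q + ρ)(ν − j)` (i.e. `|·| < 1 + ρ/q`), and
`ρ < q`.  If `(j⋆, a⋆, c⋆)` is low and `|·|`-minimal among the points (`(a⋆ + c⋆)(ν − j) ≤ (a + c)(ν − j⋆)` for every point), then
any point `(j, a, c)` with `j⋆ < j < ν`, `a ≤ a⋆`, `c ≤ c⋆` and `(a⋆ − a) + (c⋆ − c) ≥ 2(j − j⋆)` — the only ones whose product
with a monomial of `ψ^(j − j⋆)`, `ψ ∈ (t,z)²`, can hit `Y^{j⋆} t^{a⋆} z^{c⋆}` — does not exist.  Pure arithmetic. [folklore] -/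
theorem no_canceller {q ρ ν j₀ a₀ c₀ j a c : ℕ} (hρ : ρ < q) (hj₀ : j₀ < j) (hj : j < ν)
    (hlow : q * (a₀ + c₀) < (q + ρ) * (ν - j₀))
    (hmin : (a₀ + c₀) * (ν - j) ≤ (a + c) * (ν - j₀))
    (ha : a ≤ a₀) (hc : c ≤ c₀) (hdeg : 2 * (j - j₀) ≤ (a₀ - a) + (c₀ - c)) : False := by
  -- Write s₀ = a₀ + c₀, s = a + c, m₀ = ν − j₀, m = ν − j, d = j − j₀ = m₀ − m > 0.
  -- hdeg: s ≤ s₀ − 2d;  hmin: s₀ m ≤ s m₀;  hlow: q s₀ < (q+ρ) m₀ < 2q m₀, i.e. s₀ < 2 m₀.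
  -- Then s₀ m ≤ s m₀ ≤ (s₀ − 2d) m₀ = s₀ m₀ − 2 d m₀, so 2 d m₀ ≤ s₀ (m₀ − m) = s₀ d, so 2 m₀ ≤ s₀: contradiction.
  obtain ⟨d, hd⟩ : ∃ d, j = j₀ + d := ⟨j - j₀, by omega⟩
  subst hd
  have hdpos : 0 < d := by omega
  have hm : ν - j₀ = (ν - (j₀ + d)) + d := by omega
  set m := ν - (j₀ + d) with hm_def
  rw [hm] at hlow hmin
  have hs : a + c + 2 * d ≤ a₀ + c₀ := by omega
  have h2 : (q + ρ) * (m + d) < 2 * q * (m + d) := by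
    have : 0 < m + d := by omega
    nlinarith
  have h3 : q * (a₀ + c₀) < 2 * q * (m + d) := lt_trans hlow h2
  have h4 : a₀ + c₀ < 2 * (m + d) := by
    have hq : 0 < q := by omega
    nlinarith
  -- hmin : (a₀ + c₀) * m ≤ (a + c) * (m + d) ≤ (a₀ + c₀ − 2d)(m + d)
  have h5 : (a₀ + c₀) * m + 2 * d * (m + d) ≤ (a₀ + c₀) * (m + d) := by nlinarith
  have h6 : 2 * d * (m + d) ≤ (a₀ + c₀) * d := by nlinarith
  have h7 : 2 * (m + d) ≤ a₀ + c₀ := by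
    have := Nat.le_of_mul_le_mul_right (by nlinarith : 2 * (m + d) * d ≤ (a₀ + c₀) * d) hdpos
    exact this
  omega

/-- [OURS · R9-B3 · CANDIDATE] **The successor ratio bound of (b′)**, typed as a shape over the letters: at a local ring `S₁`
(the t-homogeneous successor germ) whose `f₁` has order `ν`, tangent cone `c₀·Ȳ^ν`-or-not, and whose frame `(Y, t, z)` carries a
low rigid witness, every admissible triple reached has `r₁·q < (q + ρ)·r₂`; hence `sigmaRatioNat f₁ < ν!·(q + ρ)/q ≤ ν!·r/q`.
The hypotheses are those §2–§3 reduce it to; the monomial bookkeeping (`Δ(f₁; t, z; Y − ψ)` keeps the witness, by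
`no_canceller`) is the part a door typer must supply over `MvPowerSeries`/the completion. -/
def SuccessorRatioBound (S₁ : Type u) [CommRing S₁] [IsLocalRing S₁] (f₁ : S₁) (ν q ρ : ℕ) : Prop :=
  ∀ q' r₁ r₂ : ℕ, AdmissibleTriple q' r₁ r₂ → FlagReaches f₁ ν q' r₁ r₂ → r₁ * q < (q + ρ) * r₂

/-- [OURS · R9 · §15] The **one-flag ratio bound**: every `g ∈ 𝔪` (regular or not) and every weight `a/b ≥ 1` with
`f₁ ∈ RC(g; a, b; aν)` has `a·q < (q+ρ)·b`.  It implies `SuccessorRatioBound` (one-flag collapse, §2) and — unlike the two-flag form —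
it DESCENDS along ring maps (`OneFlagRatioBound.of_map`, §15): the torus direction of the door's successor germs costs nothing.
A predicate of the line, not a cited statement. -/
def OneFlagRatioBound (S₁ : Type u) [CommRing S₁] [IsLocalRing S₁] (f₁ : S₁) (ν q ρ : ℕ) : Prop :=
  ∀ g ∈ maximalIdeal S₁, ∀ a b : ℕ, 0 < b → b ≤ a → f₁ ∈ ratContactFiltration g a b (a * ν) → a * q < (q + ρ) * b

/-- [OURS · R9 · §15] The one-flag bound implies the two-flag (`σ₁`) bound (one-flag collapse `FlagReaches.oneFlagReaches`). [folklore] -/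
theorem OneFlagRatioBound.successorRatioBound {S₁ : Type u} [CommRing S₁] [IsLocalRing S₁] {f₁ : S₁} {ν q ρ : ℕ}
    (h : OneFlagRatioBound S₁ f₁ ν q ρ) : SuccessorRatioBound S₁ f₁ ν q ρ := by
  intro q' r₁ r₂ hadm hfl
  obtain ⟨g, hg, -, hmem⟩ := FlagReaches.oneFlagReaches hadm hfl
  exact h g hg r₁ r₂ (lt_of_lt_of_le hadm.1 hadm.2.1) hadm.2.2 hmem

/-- [OURS · R9-B3] **From the successor slope bound to the letter** (PROVED, `sSup` bookkeeping): if every admissible triple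
reached by `f₁` (at its own order) has slope `r₁/r₂ < (q+ρ)/q`, then `σ₁(f₁)·q < ν!·(q+ρ)` — STRICT, also in the junk case (empty
set, `σ₁ = 0`).  With `q + ρ ≤ r` (`b ≥ 1`, `low_bound_le_ratio`) and `σ₁(η)·q ≥ ν!·r` (the curve's own flag) this is the strict
σ-RATIO drop of (b′). [folklore] -/
theorem sigmaRatioNat_mul_lt_of_slope_lt {S₁ : Type u} [CommRing S₁] [IsLocalRing S₁] (f₁ : S₁) {q ρ : ℕ} (hq : 0 < q)
    (h : SuccessorRatioBound S₁ f₁ (adicOrder f₁).toNat q ρ) :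
    sigmaRatioNat f₁ * q < ratioScale (adicOrder f₁).toNat * (q + ρ) := by
  set F := ratioScale (adicOrder f₁).toNat with hF
  have hFpos : 0 < F := Nat.factorial_pos _
  set A : Set ℕ := {m : ℕ | ∃ q' r₁ r₂ : ℕ, AdmissibleTriple q' r₁ r₂ ∧ FlagReaches f₁ (adicOrder f₁).toNat q' r₁ r₂ ∧
    m * r₂ ≤ ratioScale (adicOrder f₁).toNat * r₁} with hA
  have hσ : sigmaRatioNat f₁ = sSup A := rfl
  -- every member obeys the strict bound
  have hbound : ∀ m ∈ A, m * q < F * (q + ρ) := by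
    rintro m ⟨q', r₁, r₂, hadm, hfr, hm⟩
    have hr₂ : 0 < r₂ := lt_of_lt_of_le hadm.1 hadm.2.1
    have h1 : r₁ * q < (q + ρ) * r₂ := h q' r₁ r₂ hadm hfr
    have h2 : m * q * r₂ ≤ F * (r₁ * q) := by
      have := Nat.mul_le_mul_right q hm
      calc m * q * r₂ = m * r₂ * q := by ring
        _ ≤ F * r₁ * q := this
        _ = F * (r₁ * q) := by ring
    have h3 : F * (r₁ * q) < F * ((q + ρ) * r₂) := Nat.mul_lt_mul_of_pos_left h1 hFpos
    have h4 : m * q * r₂ < F * (q + ρ) * r₂ := by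
      calc m * q * r₂ < F * ((q + ρ) * r₂) := lt_of_le_of_lt h2 h3
        _ = F * (q + ρ) * r₂ := by ring
    exact Nat.lt_of_mul_lt_mul_right h4
  by_cases hne : A.Nonempty
  · have hbdd : BddAbove A := by
      refine ⟨F * (q + ρ), fun m hm => ?_⟩
      have := hbound m hm
      calc m ≤ m * q := Nat.le_mul_of_pos_right m hq
        _ ≤ F * (q + ρ) := this.le
    rw [hσ]
    exact hbound _ (Nat.sSup_mem hne hbdd)
  · rw [Set.not_nonempty_iff_eq_empty] at hne
    rw [hσ, hne, csSup_empty, Nat.bot_eq_zero, zero_mul]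
    exact Nat.mul_pos hFpos (by omega)

/-- [OURS · R9-B3] The (b′) comparison in scaled integers: successor letter `< ν!·(q+ρ)/q ≤ ν!·r/q ≤` the curve's letter. [folklore] -/
theorem sigma_ratio_drop_of_bounds {σ₀ σ₁ F q ρ r : ℕ} (hsucc : σ₁ * q < F * (q + ρ)) (hqr : q + ρ ≤ r)
    (hcurve : F * r ≤ σ₀ * q) : σ₁ < σ₀ := by
  have h1 : F * (q + ρ) ≤ F * r := Nat.mul_le_mul_left F hqr
  have h2 : σ₁ * q < σ₀ * q := lt_of_lt_of_le hsucc (h1.trans hcurve)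
  exact Nat.lt_of_mul_lt_mul_right h2

/-! ## §6 (G5) Frame-independence of the certificate ideal

For ANY completion `(u₂, u₃)` of `g` to a regular system, the weighted ideal `W((u₃,u₂,g);(b,b,a); n)` (`0 < b ≤ a`) equals
the `u`-free ideal `ratContactFiltration g a b n = Σ_α (g^α)·𝔪^{⌈(n − aα)/b⌉}` — tree bridge + one-flag collapse (§1).  Hence
the certificate hypothesis `f ∈ W(aν)` / `∉ W(aν+1)` of `DeltaCertificate` does not depend on the chosen `u`, and (G5) reduces to
the monomial reading (G1) `δ(Δ(f;u;g)) ≥ n/(bν) ↔ f ∈ W((u₃,u₂,g);(b,b,a); …)`. -/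

section FrameIndependence

variable {S : Type u} [CommRing S] [IsLocalRing S]

/-- [OURS · R9 · (G5)] `W((u₃,u₂,g);(b,b,a);n) = ratContactFiltration g a b n` for every regular-system completion `(u₂,u₃)` of `g`
(`0 < b ≤ a`). [folklore] -/
theorem weightedMonomialIdeal_eq_ratContactFiltration {g u₂ u₃ : S} {a b : ℕ}
    (h𝔪 : Ideal.span {u₃, u₂, g} = maximalIdeal S) (hb : 0 < b) (hba : b ≤ a) (n : ℕ) :
    weightedMonomialIdeal ![u₃, u₂, g] ![b, b, a] n = ratContactFiltration g a b n := by
  have hu₂ : u₂ ∈ maximalIdeal S := by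
    rw [← h𝔪]; exact Ideal.subset_span (by simp)
  rw [← flagContactFiltration_eq_weightedMonomialIdeal h𝔪 hb le_rfl hba n,
    flagContactFiltration_eq_ratContactFiltration hu₂ hb n]

/-- [OURS · R9 · (G5)] … so two completions give the SAME weighted ideal: the certificate is frame-independent in `u`. [folklore] -/
theorem weightedMonomialIdeal_frame_independent {g u₂ u₃ u₂' u₃' : S} {a b : ℕ}
    (h𝔪 : Ideal.span {u₃, u₂, g} = maximalIdeal S) (h𝔪' : Ideal.span {u₃', u₂', g} = maximalIdeal S)
    (hb : 0 < b) (hba : b ≤ a) (n : ℕ) :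
    weightedMonomialIdeal ![u₃, u₂, g] ![b, b, a] n = weightedMonomialIdeal ![u₃', u₂', g] ![b, b, a] n := by
  rw [weightedMonomialIdeal_eq_ratContactFiltration h𝔪 hb hba n,
    weightedMonomialIdeal_eq_ratContactFiltration h𝔪' hb hba n]

end FrameIndependence

/-! ## §7 (G4) The dimension-2 bridge at the generic point `η` of the curve

At `η` the local ring `S_P` is regular of dimension `2` with regular system `(x, y)`; the curve position's own flag `(y; x)`
reaches `(q; r, q)` as soon as `f ∈ W((x,y);(q,r); rν)·S_P` (all points of `Δ(f;x;y)` have abscissa `≥ r/q`, i.e. `δ_η ≥ r/q`).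
The tree's bridge `flagReaches_of_mem_weightedMonomialIdeal` is stated for dimension `3` and a 3-frame; here is the 2-frame
version, obtained from the SAME bridge by duplicating a generator (`𝔪 = (x, x, y)`). -/

/-- `W((x,y);(q,r);n) ⊆ W((x,x,y);(q,q,r);n)` (a monomial `xᵃyᶜ` is the monomial `xᵃ·x⁰·yᶜ`). [folklore] -/
theorem weightedMonomialIdeal_pair_le_triple {A : Type u} [CommRing A] (x y : A) (q r n : ℕ) :
    weightedMonomialIdeal ![x, y] ![q, r] n ≤ weightedMonomialIdeal ![x, x, y] ![q, q, r] n := by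
  apply Ideal.span_mono
  rintro m ⟨α, hα, rfl⟩
  refine ⟨![α 0, 0, α 1], ?_, ?_⟩
  · simpa [Fin.sum_univ_two, Fin.sum_univ_three] using hα
  · simp [Fin.prod_univ_two, Fin.prod_univ_three]

/-- `Set.range ![a, b] = {a, b}`. [folklore] -/
theorem range_vec₂ {R : Type u} (a b : R) : Set.range ![a, b] = {a, b} := by
  ext t
  simp only [Set.mem_range, Set.mem_insert_iff, Set.mem_singleton_iff]
  constructor
  · rintro ⟨i, hi⟩
    fin_cases i
    · exact Or.inl hi.symm
    · exact Or.inr hi.symm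
  · rintro (h | h)
    · exact ⟨0, h.symm⟩
    · exact ⟨1, h.symm⟩

section DimTwo

variable {T : Type u} [CommRing T] [IsRegularLocalRing T]

/-- In a regular local ring of dimension `2`, `emb dim = 2`. [folklore] -/
theorem spanFinrank_eq_two_of_ringKrullDim (hdim : ringKrullDim T = 2) : (maximalIdeal T).spanFinrank = 2 := by
  have h := IsRegularLocalRing.spanFinrank_maximalIdeal (R := T)
  rw [hdim] at h
  exact_mod_cast h

/-- The regular system `𝔪 = (a, b)` of a 2-dimensional regular local ring is a two-flag. [cite: Matsumura1987, Thm. 17.10] -/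
theorem isTwoFlag_of_span_pair_eq (hdim : ringKrullDim T = 2) {a b : T} (h : Ideal.span {a, b} = maximalIdeal T) :
    IsTwoFlag a b := by
  have hd := spanFinrank_eq_two_of_ringKrullDim hdim
  have hv : Ideal.span (Set.range ![a, b]) = maximalIdeal T := by rw [range_vec₂, h]
  exact isTwoFlag_of_rsp hd ![a, b] hv (i := 0) (j := 1) (by decide)

/-- [OURS · R9 · (G4)] **The dimension-2 bridge**: in a regular local ring of dimension `2` with regular system `(x, y)`,
`f ∈ W((x,y);(q,r); rν)` with `0 < q ≤ r` exhibits the flag `(y; x)` reaching `(q; r, q)` — so `σ₁(f)·q ≥ ν!·r` at `η`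
(the `hcurve` input of `sigma_ratio_drop_of_bounds`, once `ν = ord f`). [folklore] -/
theorem flagReaches_of_mem_weightedMonomialIdeal₂ (hdim : ringKrullDim T = 2) {x y f : T} {q r ν : ℕ}
    (h𝔪 : Ideal.span {x, y} = maximalIdeal T) (hq : 0 < q) (hqr : q ≤ r)
    (hf : f ∈ weightedMonomialIdeal ![x, y] ![q, r] (r * ν)) : FlagReaches f ν q r q := by
  have h𝔪' : Ideal.span ({x, x, y} : Set T) = maximalIdeal T := by
    rw [Set.insert_eq_of_mem (Set.mem_insert x ({y} : Set T)), h𝔪]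
  refine ⟨y, x, (isTwoFlag_of_span_pair_eq hdim h𝔪).symm, ?_⟩
  rw [← mem_weightedMonomialIdeal_iff_mem_flagContactFiltration h𝔪' hq le_rfl hqr]
  exact weightedMonomialIdeal_pair_le_triple x y q r _ hf

/-- [OURS · R9 · (G4)] … hence the curve's letter at `η` in scaled integers: `ν!·r ≤ σ₁(f)·q` (`ν = ord f`), from the member
`m := (ν!/q)·r` of the `sigmaRatioNat` set (divisible case `q ∣ ν!`, which is the (b′) situation: `q ≤ ν`).  `hbdd` (the set is
bounded — the non-junk branch of `sigmaRatioNat`, cf. tri-1 v9.10 (B.2)(b)) is kept as an explicit input; it is the `hcurve`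
premise of `sigma_ratio_drop_of_bounds`. [folklore] -/
theorem ratioScale_mul_le_sigmaRatioNat_mul (hdim : ringKrullDim T = 2) {x y f : T} {q r : ℕ}
    (h𝔪 : Ideal.span {x, y} = maximalIdeal T) (hq : 0 < q) (hqr : q ≤ r) (hqν : q ∣ ratioScale (adicOrder f).toNat)
    (hf : f ∈ weightedMonomialIdeal ![x, y] ![q, r] (r * (adicOrder f).toNat))
    (hbdd : BddAbove {m : ℕ | ∃ q' r₁ r₂ : ℕ, AdmissibleTriple q' r₁ r₂ ∧
      FlagReaches f (adicOrder f).toNat q' r₁ r₂ ∧ m * r₂ ≤ ratioScale (adicOrder f).toNat * r₁}) :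
    ratioScale (adicOrder f).toNat * r ≤ sigmaRatioNat f * q := by
  obtain ⟨c, hc⟩ := hqν
  have hmem : c * r ∈ {m : ℕ | ∃ q' r₁ r₂ : ℕ, AdmissibleTriple q' r₁ r₂ ∧
      FlagReaches f (adicOrder f).toNat q' r₁ r₂ ∧ m * r₂ ≤ ratioScale (adicOrder f).toNat * r₁} :=
    ⟨q, r, q, ⟨hq, le_rfl, hqr⟩, flagReaches_of_mem_weightedMonomialIdeal₂ hdim h𝔪 hq hqr hf, by rw [hc]; ring_nf; rfl⟩
  have hle : c * r ≤ sigmaRatioNat f := le_csSup hbdd hmem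
  calc ratioScale (adicOrder f).toNat * r = c * r * q := by rw [hc]; ring
    _ ≤ sigmaRatioNat f * q := Nat.mul_le_mul_right q hle

end DimTwo

/-! ## §8 (G1) The monomial reading of the certificate hypothesis

`δ(Δ(f;u;g)) ≥ a/b` is, on any UNIT MONOMIAL EXPANSION `f ≡ Σ_{α∈Δ} a_α u₃^{α₀} u₂^{α₁} g^{α₂} (mod 𝔪^N)` (tree:
`Theorems.LocalGameEFTNewton.exists_unitExpansion`), the condition `b(α₀+α₁) + a·α₂ ≥ aν` for every `α ∈ Δ` — i.e. every point
`(α₀+α₁)/(ν−α₂)` of the polyhedron lies at abscissa `≥ a/b`.  The tree's «unit monomials cannot hide»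
(`le_weight_of_mem_weightedMonomialIdeal`, regular frame) and its easy converse give the iff below; so (G1) is closed for the
door modulo producing the expansion, which `exists_unitExpansion` does. -/

section MonomialReading

variable {T : Type u} [CommRing T] [IsRegularLocalRing T]

/-- [OURS · R9 · (G1)] **Weighted-ideal membership = polyhedron condition on a unit expansion** (frame `(u₃,u₂,g)`, weights
`(b,b,a)`, regular local ring of dimension 3). [cite: Matsumura1987, Thm. 16.2] -/
theorem mem_weightedMonomialIdeal_iff_forall_le_weight (hdim : ringKrullDim T = (3 : ℕ)) {u₃ u₂ g f : T} {a b n N : ℕ}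
    (h𝔪 : Ideal.span (Set.range ![u₃, u₂, g]) = maximalIdeal T) (hb : 0 < b) (ha : 0 < a)
    {Δ : Finset (Fin 3 → ℕ)} {c : (Fin 3 → ℕ) → T} (hunit : ∀ α ∈ Δ, IsUnit (c α))
    (hr : f - ∑ α ∈ Δ, c α * ∏ i, ![u₃, u₂, g] i ^ α i ∈ maximalIdeal T ^ N) (hnN : n ≤ N) :
    f ∈ weightedMonomialIdeal ![u₃, u₂, g] ![b, b, a] n ↔ ∀ α ∈ Δ, n ≤ ∑ i, ![b, b, a] i * α i := by
  have hw : ∀ i, 0 < (![b, b, a] : Fin 3 → ℕ) i := by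
    intro i; fin_cases i <;> simp [hb, ha]
  constructor
  · intro hf
    exact Theorems.LocalGameEFTNewton.le_weight_of_mem_weightedMonomialIdeal ![u₃, u₂, g] h𝔪 hdim ![b, b, a] hw hunit hr hf hnN
  · intro hge
    exact Theorems.LocalGameEFTNewton.mem_weightedMonomialIdeal_of_forall_le_weight ![u₃, u₂, g] h𝔪 ![b, b, a] hw hr hge hnN

/-- [OURS · R9 · (G1)] The polyhedron form: with `n = aν`, the weight condition on an exponent `α` with `α₂ < ν` reads
`a(ν − α₂) ≤ b(α₀ + α₁)`, i.e. the point `(α₀+α₁)/(ν−α₂)` of `Δ(f;u;g)` has abscissa `≥ a/b`. [folklore] -/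
theorem weight_ge_iff_point_ge (a b ν : ℕ) (α : Fin 3 → ℕ) (hα : α 2 ≤ ν) :
    a * ν ≤ ∑ i, ![b, b, a] i * α i ↔ a * (ν - α 2) ≤ b * (α 0 + α 1) := by
  obtain ⟨k, hk⟩ := Nat.exists_eq_add_of_le hα
  simp only [Fin.sum_univ_three, Matrix.cons_val_zero, Matrix.cons_val_one, Matrix.cons_val_two, Matrix.tail_cons,
    Matrix.head_cons]
  rw [hk, Nat.add_sub_cancel_left]
  constructor <;> intro h <;> nlinarith

end MonomialReading

/-! ## §9 (G2-entrance) Tangent rigidity: a competitor with ratio `> 1` is `≡ γ·Y (mod 𝔪²)`, `γ` a unit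

By §3, a flag whose first member `g` reaches a ratio `> 1` forces `c·g^ν ≡ f (mod 𝔪^{ν+1})`; at the (b′) successor
`f₁ ≡ c₀·Y^ν (mod 𝔪^{ν+1})` (tangent cone `c₀Y^ν`).  Weighted quasi-regularity of the regular system `(t,z,Y)` (tree:
`Theorems.LocalGameEFTNewton.coeff_layer_sub_mem_maximalIdeal`) then gives `g ≡ γY (mod 𝔪²)` with `γ` a unit — the entrance to
the formal IFT (G2) `g = v·(Y − φ(t,z))`. -/

section TangentRigidity

variable {T : Type u} [CommRing T] [IsRegularLocalRing T]

open MvPolynomial in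
/-- [OURS · R9 · (G2)-entrance] **Tangent rigidity.** In a regular local ring of dimension `3` with regular system `(t, z, Y)`:
if `c·g^ν ≡ c₀·Y^ν (mod 𝔪^{ν+1})` with `c, c₀` units, `g ∈ 𝔪`, `0 < ν`, then `g ≡ γ·Y (mod 𝔪²)` for a unit `γ`.
[cite: Matsumura1987, Thm. 16.2] -/
theorem tangent_rigidity (hdim : ringKrullDim T = (3 : ℕ)) {t z Y g : T}
    (h𝔪 : Ideal.span (Set.range ![t, z, Y]) = maximalIdeal T) {ν : ℕ} (hν : 0 < ν) {c c₀ : T}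
    (hc : IsUnit c) (hc₀ : IsUnit c₀) (hg : g ∈ maximalIdeal T)
    (h : c * g ^ ν - c₀ * Y ^ ν ∈ maximalIdeal T ^ (ν + 1)) :
    ∃ γ : T, IsUnit γ ∧ g - γ * Y ∈ maximalIdeal T ^ 2 := by
  classical
  set u : Fin 3 → T := ![t, z, Y] with hu_def
  -- `g = Σ cf i · u i`
  have hg' : g ∈ Ideal.span (Set.range u) := by rw [h𝔪]; exact hg
  obtain ⟨cf, hcf⟩ := Ideal.mem_span_range_iff_exists_fun.mp hg'
  -- the linear form `L = Σ cf_i X_i` and `Q = c · L^ν`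
  set L : MvPolynomial (Fin 3) T := ∑ i, C (cf i) * X i with hL_def
  set Q : MvPolynomial (Fin 3) T := C c * L ^ ν with hQ_def
  have hLeval : eval u L = g := by
    simp only [hL_def, map_sum, map_mul, eval_C, eval_X]; exact hcf
  have hQeval : eval u Q = c * g ^ ν := by
    simp only [hQ_def, map_mul, map_pow, eval_C, hLeval]
  have hw : ∀ i : Fin 3, 0 < (fun _ : Fin 3 => (1 : ℕ)) i := fun _ => one_pos
  have hLhom : L.IsWeightedHomogeneous (fun _ : Fin 3 => (1 : ℕ)) 1 := by
    refine IsWeightedHomogeneous.sum Finset.univ (fun i => C (cf i) * X i) 1 (fun i _ => ?_)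
    simpa using (isWeightedHomogeneous_C (fun _ : Fin 3 => (1 : ℕ)) (cf i)).mul
      (isWeightedHomogeneous_X T (fun _ : Fin 3 => (1 : ℕ)) i)
  have hQhom : Q.IsWeightedHomogeneous (fun _ : Fin 3 => (1 : ℕ)) ν := by
    simpa using (isWeightedHomogeneous_C (fun _ : Fin 3 => (1 : ℕ)) c).mul (hLhom.pow ν)
  -- the one-monomial expansion of `c₀ Y^ν`
  set α₀ : Fin 3 → ℕ := ![0, 0, ν] with hα₀_def
  have hprod : ∏ i, u i ^ α₀ i = Y ^ ν := by
    simp [hu_def, hα₀_def, Fin.prod_univ_three]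
  have hr : c₀ * Y ^ ν - ∑ α ∈ ({α₀} : Finset (Fin 3 → ℕ)), (fun _ : (Fin 3 → ℕ) => c₀) α * ∏ i, u i ^ α i ∈
      maximalIdeal T ^ (ν + 1) := by
    simp [Finset.sum_singleton, hprod]
  have hge : ∀ α ∈ ({α₀} : Finset (Fin 3 → ℕ)), ν ≤ ∑ i, (fun _ : Fin 3 => (1 : ℕ)) i * α i := by
    intro α hα
    rw [Finset.mem_singleton] at hα
    subst hα
    simp [hα₀_def, Fin.sum_univ_three]
  have hfQ : c₀ * Y ^ ν - eval u Q ∈ weightedMonomialIdeal u (fun _ : Fin 3 => (1 : ℕ)) (ν + 1) := by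
    rw [Theorems.LocalGameEFTNewton.weightedMonomialIdeal_const_one_eq_pow u h𝔪 (ν + 1), hQeval]
    have : c₀ * Y ^ ν - c * g ^ ν = -(c * g ^ ν - c₀ * Y ^ ν) := by ring
    rw [this]
    exact Submodule.neg_mem _ h
  have key := Theorems.LocalGameEFTNewton.coeff_layer_sub_mem_maximalIdeal u h𝔪 hdim (fun _ : Fin 3 => (1 : ℕ)) hw
    hr hge (Nat.lt_succ_self ν) Q hQhom hfQ
  have hfilter : (({α₀} : Finset (Fin 3 → ℕ)).filter
      (fun α => ∑ i, (fun _ : Fin 3 => (1 : ℕ)) i * α i = ν)) = {α₀} := by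
    rw [Finset.filter_singleton, if_pos]
    simp [hα₀_def, Fin.sum_univ_three]
  rw [hfilter] at key
  simp only [Finset.sum_singleton] at key
  -- `key : ∀ β, (monomial (eqv α₀) c₀ - Q).coeff β ∈ 𝔪`; reduce modulo `𝔪`
  set r := IsLocalRing.residue T with hr_def
  have hPQ0 : MvPolynomial.map r (monomial (Finsupp.equivFunOnFinite.symm α₀) c₀ - Q) = 0 := by
    ext β
    rw [coeff_map, coeff_zero]
    exact (IsLocalRing.residue_eq_zero_iff _).mpr (key β)
  have hev : ∀ x : Fin 3 → IsLocalRing.ResidueField T,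
      r c₀ * ∏ i, x i ^ α₀ i = r c * (∑ i, r (cf i) * x i) ^ ν := by
    intro x
    have h0 := congrArg (MvPolynomial.eval x) hPQ0
    simp only [map_sub, map_monomial, map_zero, sub_eq_zero,
      Theorems.LocalGameEFTNewton.eval_monomial_equivFunOnFinite_symm] at h0
    rw [h0]
    simp only [hQ_def, hL_def, map_mul, map_pow, map_sum, map_C, map_X, eval_C, eval_X]
  have hrc : r c ≠ 0 := (hc.map r).ne_zero
  have hrc₀ : r c₀ ≠ 0 := (hc₀.map r).ne_zero
  -- evaluate at (1,0,0), (0,1,0): `cf 0, cf 1 ∈ 𝔪`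
  have hcf0 : cf 0 ∈ maximalIdeal T := by
    have h1 := hev ![1, 0, 0]
    simp [hα₀_def, Fin.prod_univ_three, Fin.sum_univ_three, hν.ne'] at h1
    -- h1 : r c = 0 ∨ r (cf 0) = 0  (or  0 = r c * r (cf 0) ^ ν)
    rcases h1 with h1 | h1
    · exact absurd h1 hrc
    · exact (IsLocalRing.residue_eq_zero_iff _).mp h1
  have hcf1 : cf 1 ∈ maximalIdeal T := by
    have h1 := hev ![0, 1, 0]
    simp [hα₀_def, Fin.prod_univ_three, Fin.sum_univ_three, hν.ne'] at h1
    rcases h1 with h1 | h1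
    · exact absurd h1 hrc
    · exact (IsLocalRing.residue_eq_zero_iff _).mp h1
  -- evaluate at (0,0,1): `cf 2` is a unit
  have hcf2 : IsUnit (cf 2) := by
    have h1 := hev ![0, 0, 1]
    simp [hα₀_def, Fin.prod_univ_three, Fin.sum_univ_three] at h1
    -- h1 : r c₀ = r c * r (cf 2) ^ ν
    rw [← IsLocalRing.residue_ne_zero_iff_isUnit]
    intro h2
    rw [h2, zero_pow hν.ne', mul_zero] at h1
    exact hrc₀ h1
  refine ⟨cf 2, hcf2, ?_⟩
  have ht : t ∈ maximalIdeal T := by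
    simpa [hu_def] using Theorems.LocalGameEFTNewton.mem_maximalIdeal_of_span_eq u h𝔪 0
  have hz : z ∈ maximalIdeal T := by
    simpa [hu_def] using Theorems.LocalGameEFTNewton.mem_maximalIdeal_of_span_eq u h𝔪 1
  have hsum : g - cf 2 * Y = cf 0 * t + cf 1 * z := by
    have := hcf
    simp only [hu_def, Fin.sum_univ_three, Matrix.cons_val_zero, Matrix.cons_val_one, Matrix.cons_val_two,
      Matrix.tail_cons, Matrix.head_cons] at this
    linear_combination (-1 : T) * this
  rw [hsum, pow_two]
  exact Ideal.add_mem _ (Ideal.mul_mem_mul hcf0 ht) (Ideal.mul_mem_mul hcf1 hz)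

/-- [OURS · R9] `Y^ν ∉ 𝔪^{ν+1}` for a member `Y` of a regular system of parameters (unit monomials cannot hide). [cite: Matsumura1987, Thm. 16.2] -/
theorem pow_not_mem_pow_succ (hdim : ringKrullDim T = (3 : ℕ)) {t z Y : T}
    (h𝔪 : Ideal.span (Set.range ![t, z, Y]) = maximalIdeal T) (ν : ℕ) : Y ^ ν ∉ maximalIdeal T ^ (ν + 1) := by
  classical
  intro hY
  set u : Fin 3 → T := ![t, z, Y] with hu_def
  set α₀ : Fin 3 → ℕ := ![0, 0, ν] with hα₀_def
  have hw : ∀ i : Fin 3, 0 < (fun _ : Fin 3 => (1 : ℕ)) i := fun _ => one_pos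
  have hprod : ∏ i, u i ^ α₀ i = Y ^ ν := by
    simp [hu_def, hα₀_def, Fin.prod_univ_three]
  have hr : Y ^ ν - ∑ α ∈ ({α₀} : Finset (Fin 3 → ℕ)), (fun _ : (Fin 3 → ℕ) => (1 : T)) α * ∏ i, u i ^ α i ∈
      maximalIdeal T ^ (ν + 1) := by
    simp [Finset.sum_singleton, hprod]
  have hY' : Y ^ ν ∈ weightedMonomialIdeal u (fun _ : Fin 3 => (1 : ℕ)) (ν + 1) := by
    rwa [Theorems.LocalGameEFTNewton.weightedMonomialIdeal_const_one_eq_pow u h𝔪 (ν + 1)]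
  have key := Theorems.LocalGameEFTNewton.le_weight_of_mem_weightedMonomialIdeal u h𝔪 hdim (fun _ : Fin 3 => (1 : ℕ)) hw
    (fun _ _ => isUnit_one) hr hY' le_rfl α₀ (Finset.mem_singleton_self α₀)
  simp [hα₀_def, Fin.sum_univ_three] at key

/-- [OURS · R9 · (G2)-entrance, assembled] **Every competitor is tangent to `Y`.**  At a point with tangent cone `c₀·Y^ν`
(`f ≡ c₀Y^ν (mod 𝔪^{ν+1})`, `c₀` a unit — the (b′) successor `𝔫₀`, where `f₁ ≡ c₀Y^ν (mod t)`), every two-flag reaching an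
admissible triple of RATIO `> 1` has first member `g ≡ γ·Y (mod 𝔪²)` with `γ` a unit (§2 one-flag collapse + §3 dichotomy +
`tangent_rigidity`).  So bounding `σ₁(f₁)` reduces to parameters `g = γY + (𝔪²)`, i.e. after the formal IFT (G2) to `g′ = Y − φ(t,z)`. [folklore] -/
theorem competitor_tangent (hdim : ringKrullDim T = (3 : ℕ)) {t z Y f : T}
    (h𝔪 : Ideal.span (Set.range ![t, z, Y]) = maximalIdeal T) {ν : ℕ} (hν : 0 < ν) {c₀ : T} (hc₀ : IsUnit c₀)
    (hf : f - c₀ * Y ^ ν ∈ maximalIdeal T ^ (ν + 1)) {q r₁ r₂ : ℕ} (hadm : AdmissibleTriple q r₁ r₂) (hlt : r₂ < r₁)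
    (h : FlagReaches f ν q r₁ r₂) :
    ∃ g γ : T, (g ∈ maximalIdeal T ∧ f ∈ ratContactFiltration g r₁ r₂ (r₁ * ν)) ∧ IsUnit γ ∧
      g - γ * Y ∈ maximalIdeal T ^ 2 := by
  obtain ⟨g, hg𝔪, -, hmem⟩ := FlagReaches.oneFlagReaches hadm h
  have hr₂ : 0 < r₂ := lt_of_lt_of_le hadm.1 hadm.2.1
  obtain ⟨c, hc⟩ := exists_sub_mul_pow_mem_of_mem_ratContactFiltration hg𝔪 hr₂ hlt hmem
  -- `c g^ν ≡ c₀ Y^ν`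
  have hcg : c * g ^ ν - c₀ * Y ^ ν ∈ maximalIdeal T ^ (ν + 1) := by
    have : c * g ^ ν - c₀ * Y ^ ν = (f - c₀ * Y ^ ν) - (f - c * g ^ ν) := by ring
    rw [this]
    exact Ideal.sub_mem _ hf hc
  -- `c` is a unit: otherwise `c₀ Y^ν ∈ 𝔪^{ν+1}`
  have hcunit : IsUnit c := by
    by_contra hcn
    have hcm : c ∈ maximalIdeal T := (IsLocalRing.mem_maximalIdeal c).mpr hcn
    have h1 : c * g ^ ν ∈ maximalIdeal T ^ (ν + 1) := by
      rw [pow_succ']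
      exact Ideal.mul_mem_mul hcm (Ideal.pow_mem_pow hg𝔪 ν)
    have h2 : c₀ * Y ^ ν ∈ maximalIdeal T ^ (ν + 1) := by
      have : c₀ * Y ^ ν = c * g ^ ν - (c * g ^ ν - c₀ * Y ^ ν) := by ring
      rw [this]
      exact Ideal.sub_mem _ h1 hcg
    have h3 : Y ^ ν ∈ maximalIdeal T ^ (ν + 1) := by
      obtain ⟨w, hw⟩ := hc₀
      rw [← hw] at h2
      exact (Ideal.unit_mul_mem_iff_mem _ w.isUnit).mp h2
    exact pow_not_mem_pow_succ hdim h𝔪 ν h3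
  obtain ⟨γ, hγ, hgY⟩ := tangent_rigidity hdim h𝔪 hν hcunit hc₀ hg𝔪 hcg
  exact ⟨g, γ, ⟨hg𝔪, hmem⟩, hγ, hgY⟩

end TangentRigidity

/-! ## §10 (G2′) Reduction modulo the competitor — the row-0 constraint without any IFT

For a competitor `g ≡ γY (mod 𝔪²)`: `S̄ := S/(g)` is regular of dimension `2` (regular system `(t̄, z̄)`), `Ȳ ∈ 𝔪̄²`, and the
`α = 0` piece of rational contact gives `f ∈ RC(g; a, b; n) ⇒ f̄ ∈ 𝔪̄^{⌈n/b⌉}`.  HONEST SCOPE: this is only the ROW-0 constraint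
of the polyhedron `Δ(f; t,z; g)`; the (b′) witness of R9-B3 (4) lives in row `j ≥ 1` in general (row 0 alone cannot bound the
ratio when `ord Ȳ` is large), so the rows `j ≥ 1` still need the `g`-adic structure: either the formal IFT (G2) in `Ŝ`, or —
staying inside `S` — an APPROXIMATE IFT mod `𝔪^N` (`g ≡ v_N·(Y − φ_N(t,z)) (mod 𝔪^N)`, unit expansions) together with the
`𝔪^N`-stability `RC(g) = RC(g″)` for `g ≡ g″ (mod 𝔪^N)`, `N ≥ ⌈a/b⌉ + 1` (both elementary; not typed here). -/

section ReductionModCompetitor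

variable {S : Type u} [CommRing S] [IsLocalRing S]

/-- [OURS · R9 · (G2′)] **Rational contact along `g` bounds the order of `f mod g`**: `RC(g;a,b;n) ≤ mk⁻¹(𝔪̄^{⌈n/b⌉})`,
`𝔪̄` the image of `𝔪` in `S/(g)` (the pieces with `α ≥ 1` die modulo `g`; the `α = 0` piece is `𝔪^{⌈n/b⌉}`). [folklore] -/
theorem ratContactFiltration_le_comap_mk (g : S) (a b n : ℕ) :
    ratContactFiltration g a b n ≤ Ideal.comap (Ideal.Quotient.mk (Ideal.span {g}))
      (Ideal.map (Ideal.Quotient.mk (Ideal.span {g})) (maximalIdeal S ^ ((n + b - 1) / b))) := by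
  rw [ratContactFiltration_def]
  refine iSup_le fun α => ?_
  rcases Nat.eq_zero_or_pos α with rfl | hα
  · simp only [pow_zero, Ideal.span_singleton_one, Ideal.top_mul, Nat.mul_zero, Nat.sub_zero]
    exact Ideal.le_comap_map
  · intro x hx
    have hxg : x ∈ Ideal.span {g} :=
      (Ideal.span_singleton_le_span_singleton.mpr (dvd_pow_self g hα.ne')) (Ideal.mul_le_right hx)
    rw [Ideal.mem_comap, Ideal.Quotient.eq_zero_iff_mem.mpr hxg]
    exact Ideal.zero_mem _

/-- [OURS · R9 · (G2′)] … and `Ȳ ∈ 𝔪̄²` for a competitor `g ≡ γ·Y (mod 𝔪²)`, `γ` a unit. [folklore] -/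
theorem mk_mem_map_sq_of_tangent {g Y γ : S} (hγ : IsUnit γ) (h : g - γ * Y ∈ maximalIdeal S ^ 2) :
    Ideal.Quotient.mk (Ideal.span {g}) Y ∈
      Ideal.map (Ideal.Quotient.mk (Ideal.span {g})) (maximalIdeal S ^ 2) := by
  obtain ⟨w, rfl⟩ := hγ
  -- `Y = w⁻¹ (g - (g - w Y))`, and `g ↦ 0`
  have hY : Y = ↑w⁻¹ * g - ↑w⁻¹ * (g - ↑w * Y) := by
    rw [mul_sub, ← mul_assoc, Units.inv_mul, one_mul]; ring
  rw [hY, map_sub, map_mul, map_mul, Ideal.Quotient.eq_zero_iff_mem.mpr (Ideal.mem_span_singleton_self g), mul_zero,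
    zero_sub]
  exact Submodule.neg_mem _ (Ideal.mul_mem_left _ _ (Ideal.mem_map_of_mem _ h))

end ReductionModCompetitor

/-! ## §11 𝔪^N-stability of rational contact (the second half of the in-`S` replacement of (G2))

`g ≡ g″ (mod 𝔪^N)` with `a ≤ bN` ⇒ `RC(g; a,b; n) = RC(g″; a,b; n)` for all `n`: a competitor may be replaced by any
`𝔪^N`-approximation — e.g. by `v_N·(Y − φ_N(t,z))` from an approximate IFT — without changing a single contact ideal. -/

section Stability

variable {S : Type u} [CommRing S] [IsLocalRing S]

/-- Ceiling subadditivity `⌈(X+Y)/b⌉ ≤ ⌈X/b⌉ + ⌈Y/b⌉`, in `ℕ`-division form. [folklore] -/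
theorem ceilDiv_add_le (X Y : ℕ) {b : ℕ} (hb : 0 < b) :
    (X + Y + b - 1) / b ≤ (X + b - 1) / b + (Y + b - 1) / b := by
  set A := (X + b - 1) / b with hA
  set B := (Y + b - 1) / b with hB
  have hX : X + b - 1 < A * b + b := Nat.lt_div_mul_add hb
  have hY : Y + b - 1 < B * b + b := Nat.lt_div_mul_add hb
  have h1 : X ≤ A * b := by omega
  have h2 : Y ≤ B * b := by omega
  have key : X + Y + b - 1 < (A + B + 1) * b := by
    have : (A + B + 1) * b = A * b + B * b + b := by ring
    omega
  exact Nat.lt_succ_iff.mp ((Nat.div_lt_iff_lt_mul hb).mpr key)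

/-- `⌈Y/b⌉ ≤ M` when `Y ≤ bM`. [folklore] -/
theorem ceilDiv_le_of_le_mul {Y b M : ℕ} (hb : 0 < b) (h : Y ≤ b * M) : (Y + b - 1) / b ≤ M := by
  have key : Y + b - 1 < (M + 1) * b := by
    have : (M + 1) * b = b * M + b := by ring
    omega
  exact Nat.lt_succ_iff.mp ((Nat.div_lt_iff_lt_mul hb).mpr key)

/-- The exponent bookkeeping: `e(i) ≤ e(α) + N(α − i)` for `i ≤ α`, `e(x) = ⌈(n − ax)/b⌉`, when `a ≤ bN`. [folklore] -/
theorem ceil_exponent_shift {a b N : ℕ} (hb : 0 < b) (hN : a ≤ b * N) (n : ℕ) {i α : ℕ} (hi : i ≤ α) :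
    (n - a * i + b - 1) / b ≤ (n - a * α + b - 1) / b + N * (α - i) := by
  have hsplit : a * α = a * i + a * (α - i) := by
    rw [← mul_add]; congr 1; omega
  have hP : n - a * i ≤ (n - a * α) + a * (α - i) := by omega
  calc (n - a * i + b - 1) / b ≤ ((n - a * α) + a * (α - i) + b - 1) / b :=
        Nat.div_le_div_right (by omega)
    _ ≤ ((n - a * α) + b - 1) / b + (a * (α - i) + b - 1) / b := ceilDiv_add_le _ _ hb
    _ ≤ (n - a * α + b - 1) / b + N * (α - i) := by
        have hle : a * (α - i) ≤ b * (N * (α - i)) := by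
          calc a * (α - i) ≤ (b * N) * (α - i) := Nat.mul_le_mul_right _ hN
            _ = b * (N * (α - i)) := by ring
        exact Nat.add_le_add_left (ceilDiv_le_of_le_mul hb hle) _

/-- [OURS · R9 · (G2″)] **`𝔪^N`-stability of rational contact, one inclusion**: `g″ − g ∈ 𝔪^N`, `a ≤ bN` ⇒ `RC(g″) ≤ RC(g)`. [folklore] -/
theorem ratContactFiltration_le_of_sub_mem_pow {g g'' : S} {a b N : ℕ} (hb : 0 < b) (hN : a ≤ b * N)
    (h : g'' - g ∈ maximalIdeal S ^ N) (n : ℕ) :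
    ratContactFiltration g'' a b n ≤ ratContactFiltration g a b n := by
  rw [ratContactFiltration_def g'']
  refine iSup_le fun α => ?_
  rw [Ideal.span_singleton_mul_le_iff]
  intro y hy
  set m := g'' - g with hm
  have hg'' : g'' = g + m := by rw [hm, add_sub_cancel]
  rw [hg'', add_pow, Finset.sum_mul]
  refine Ideal.sum_mem _ fun i hi => ?_
  have hiα : i ≤ α := Nat.lt_succ_iff.mp (Finset.mem_range.mp hi)
  have hmy : m ^ (α - i) * (↑(α.choose i) * y) ∈ maximalIdeal S ^ (N * (α - i) + (n - a * α + b - 1) / b) := by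
    rw [pow_add]
    refine Ideal.mul_mem_mul ?_ (Ideal.mul_mem_left _ _ hy)
    rw [pow_mul]
    exact Ideal.pow_mem_pow h _
  have hmono : maximalIdeal S ^ (N * (α - i) + (n - a * α + b - 1) / b) ≤ maximalIdeal S ^ ((n - a * i + b - 1) / b) :=
    Ideal.pow_le_pow_right (by have := ceil_exponent_shift hb hN n hiα; omega)
  have hterm : g ^ i * m ^ (α - i) * ↑(α.choose i) * y ∈
      Ideal.span {g ^ i} * maximalIdeal S ^ ((n - a * i + b - 1) / b) := by
    have : g ^ i * m ^ (α - i) * ↑(α.choose i) * y = g ^ i * (m ^ (α - i) * (↑(α.choose i) * y)) := by ring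
    rw [this]
    exact Ideal.mul_mem_mul (Ideal.mem_span_singleton_self _) (hmono hmy)
  rw [ratContactFiltration_def]
  exact Submodule.mem_iSup_of_mem i hterm

/-- [OURS · R9 · (G2″)] **`𝔪^N`-stability of rational contact**: `g ≡ g″ (mod 𝔪^N)`, `a ≤ bN` ⇒ `RC(g; a,b; n) = RC(g″; a,b; n)`. [folklore] -/
theorem ratContactFiltration_congr_mod_pow {g g'' : S} {a b N : ℕ} (hb : 0 < b) (hN : a ≤ b * N)
    (h : g'' - g ∈ maximalIdeal S ^ N) (n : ℕ) :
    ratContactFiltration g'' a b n = ratContactFiltration g a b n := by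
  refine le_antisymm (ratContactFiltration_le_of_sub_mem_pow hb hN h n)
    (ratContactFiltration_le_of_sub_mem_pow hb hN ?_ n)
  rw [← neg_sub]
  exact Submodule.neg_mem _ h

end Stability

/-! ## §12 (G2) ELIMINATED — contact below ratio 2 is rigid mod 𝔪²; the (b′) RING SIDE ASSEMBLED

Close-out observation (gen 9).  §11 with `N = 2` needs only `a ≤ 2b`, i.e. ratio `a/b ≤ 2`, and the CURVE° successor has slope budget
`K = 1 + ρ/q < 2`; ratios above `2` reduce to ratio `2` by monotonicity (`ratContactFiltration_mono_ratio`).  So NO implicit-function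
step of any kind is needed for (b′): a competitor `g` of ratio `> 1` is `αt + βz + γY` with `γ` a UNIT and `β ∈ 𝔪` (`competitor_coefficients`,
from the degree-`ν` layer of `f₁` alone: unit `Y^ν`-coefficient, every other layer monomial divisible by `t`), hence completes `(t,z)` to a
frame (`span_triple_eq_of_isUnit`), and may be replaced by ANYTHING congruent to `γ⁻¹g` mod `𝔪²` — a TRANSLATE `Y − c·t` with `c` from any set
`Λ` of residue representatives (`nonmem_of_representatives`; constants at a `k`-rational point).  `successorRatioBound_of_frames` is the abstract
reduction; `successorRatioBound_of_lowWitnesses` (and its `k`-rational form `…_rational`) the assembled statement: `SuccessorRatioBound T f ν q ρ`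
follows from the layer data and, for each `c ∈ Λ` and each ratio `A/B ∈ [K, 2]`, ONE unit expansion of `f` in the frame `(t, z, Y − c·t)` with a
monomial of `(t,z)`-value `< K` — read through §6 + §8; the door produces these expansions from `τ(η) = 0` by the tree's jets lemma (the
`S`-frame change `y ↦ y − c·x^{b+1}` keeps `W((x,y,z);(q,r+1,1);·)`) and `witness_lands_low` (§5).  `no_canceller` is no longer load-bearing. -/

section RatioMonotone

variable {S : Type u} [CommRing S] [IsLocalRing S]

/-- Ceilings are monotone in the ratio: `X'/b' ≤ X/b ⇒ ⌈X'/b'⌉ ≤ ⌈X/b⌉`. [folklore] -/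
theorem ceilDiv_mono_ratio {X X' b b' : ℕ} (hb : 0 < b) (hb' : 0 < b') (h : X' * b ≤ X * b') :
    (X' + b' - 1) / b' ≤ (X + b - 1) / b := by
  set C := (X + b - 1) / b with hC
  have hX : X + b - 1 < C * b + b := Nat.lt_div_mul_add hb
  have h1 : X ≤ C * b := by omega
  have h2 : X' * b ≤ (b' * C) * b := by
    calc X' * b ≤ X * b' := h
      _ ≤ (C * b) * b' := Nat.mul_le_mul_right _ h1
      _ = (b' * C) * b := by ring
  exact ceilDiv_le_of_le_mul hb' (Nat.le_of_mul_le_mul_right h2 hb)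

/-- [OURS · R9] **Rational contact is monotone in the ratio**: `a'/b' ≤ a/b ⇒ RC(g; a,b; aν) ≤ RC(g; a',b'; a'ν)` (reaching a ratio
reaches every smaller one). [folklore] -/
theorem ratContactFiltration_mono_ratio {g : S} {a b a' b' : ℕ} (hb : 0 < b) (hb' : 0 < b') (h : a' * b ≤ a * b')
    (ν : ℕ) : ratContactFiltration g a b (a * ν) ≤ ratContactFiltration g a' b' (a' * ν) := by
  rw [ratContactFiltration_def, ratContactFiltration_def]
  refine iSup_le fun α => le_trans (Ideal.mul_mono_right (Ideal.pow_le_pow_right ?_))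
    (le_iSup (fun α => Ideal.span {g ^ α} * maximalIdeal S ^ ((a' * ν - a' * α + b' - 1) / b')) α)
  rw [← mul_tsub, ← mul_tsub]
  refine ceilDiv_mono_ratio hb hb' ?_
  calc a' * (ν - α) * b = (a' * b) * (ν - α) := by ring
    _ ≤ (a * b') * (ν - α) := Nat.mul_le_mul_right _ h
    _ = a * (ν - α) * b' := by ring

end RatioMonotone

section CompetitorFrame

variable {T : Type u} [CommRing T] [IsRegularLocalRing T]

open MvPolynomial in
/-- [OURS · R9] **Layer identity over the residue field.**  If `f ≡ Σ_{α∈Δ} a_α u^α (mod 𝔪^{ν+1})` with all `|α| = ν` and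
`f ≡ Q(u) (mod 𝔪^{ν+1})` for a `ν`-form `Q`, then `Σ_α ā_α x^α = Q̄(x)` for every point `x` over the residue field (weighted
quasi-regularity `coeff_layer_sub_mem_maximalIdeal` of the tree, weights `1`). [cite: Matsumura1987, Thm. 16.2] -/
theorem layer_identity (hdim : ringKrullDim T = (3 : ℕ)) {u : Fin 3 → T}
    (h𝔪 : Ideal.span (Set.range u) = maximalIdeal T) {ν : ℕ} {Δ : Finset (Fin 3 → ℕ)} {a : (Fin 3 → ℕ) → T}
    (hΔ : ∀ α ∈ Δ, ∑ i, α i = ν) {f : T} (hf : f - ∑ α ∈ Δ, a α * ∏ i, u i ^ α i ∈ maximalIdeal T ^ (ν + 1))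
    (Q : MvPolynomial (Fin 3) T) (hQ : Q.IsWeightedHomogeneous (fun _ : Fin 3 => (1 : ℕ)) ν)
    (hfQ : f - eval u Q ∈ maximalIdeal T ^ (ν + 1)) (x : Fin 3 → IsLocalRing.ResidueField T) :
    ∑ α ∈ Δ, IsLocalRing.residue T (a α) * ∏ i, x i ^ α i =
      eval x (MvPolynomial.map (IsLocalRing.residue T) Q) := by
  classical
  have hw : ∀ i : Fin 3, 0 < (fun _ : Fin 3 => (1 : ℕ)) i := fun _ => one_pos
  have hge : ∀ α ∈ Δ, ν ≤ ∑ i, (fun _ : Fin 3 => (1 : ℕ)) i * α i := by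
    intro α hα
    simp only [one_mul]
    exact (hΔ α hα).ge
  have hfQ' : f - eval u Q ∈ weightedMonomialIdeal u (fun _ : Fin 3 => (1 : ℕ)) (ν + 1) := by
    rwa [Theorems.LocalGameEFTNewton.weightedMonomialIdeal_const_one_eq_pow u h𝔪 (ν + 1)]
  have key := Theorems.LocalGameEFTNewton.coeff_layer_sub_mem_maximalIdeal u h𝔪 hdim (fun _ : Fin 3 => (1 : ℕ)) hw
    hf hge (Nat.lt_succ_self ν) Q hQ hfQ'
  have hfilter : Δ.filter (fun α => ∑ i, (fun _ : Fin 3 => (1 : ℕ)) i * α i = ν) = Δ := by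
    refine Finset.filter_true_of_mem fun α hα => ?_
    simp only [one_mul]
    exact hΔ α hα
  rw [hfilter] at key
  have hP0 : MvPolynomial.map (IsLocalRing.residue T)
      (∑ α ∈ Δ, monomial (Finsupp.equivFunOnFinite.symm α) (a α) - Q) = 0 := by
    ext β
    rw [coeff_map, coeff_zero]
    exact (IsLocalRing.residue_eq_zero_iff _).mpr (key β)
  have h0 := congrArg (MvPolynomial.eval x) hP0
  simp only [map_sub, map_sum, map_monomial, map_zero, sub_eq_zero,
    Theorems.LocalGameEFTNewton.eval_monomial_equivFunOnFinite_symm] at h0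
  exact h0

omit [IsRegularLocalRing T] in
/-- [OURS · R9] **Frames**: `(t, z, αt + βz + γY)` and `(t, z, Y)` generate the same ideal when `γ` is a unit. [folklore] -/
theorem span_triple_eq_of_isUnit {t z Y α β γ : T} (hγ : IsUnit γ) :
    Ideal.span (Set.range ![t, z, α * t + β * z + γ * Y]) = Ideal.span (Set.range ![t, z, Y]) := by
  obtain ⟨w, rfl⟩ := hγ
  set ℓ := α * t + β * z + ↑w * Y with hℓ_def
  have ht : t ∈ Ideal.span (Set.range ![t, z, Y]) := Ideal.subset_span ⟨0, rfl⟩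
  have hz : z ∈ Ideal.span (Set.range ![t, z, Y]) := Ideal.subset_span ⟨1, rfl⟩
  have hY : Y ∈ Ideal.span (Set.range ![t, z, Y]) := Ideal.subset_span ⟨2, rfl⟩
  have ht' : t ∈ Ideal.span (Set.range ![t, z, ℓ]) := Ideal.subset_span ⟨0, rfl⟩
  have hz' : z ∈ Ideal.span (Set.range ![t, z, ℓ]) := Ideal.subset_span ⟨1, rfl⟩
  have hℓ' : ℓ ∈ Ideal.span (Set.range ![t, z, ℓ]) := Ideal.subset_span ⟨2, rfl⟩
  have hℓ : ℓ ∈ Ideal.span (Set.range ![t, z, Y]) :=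
    Ideal.add_mem _ (Ideal.add_mem _ (Ideal.mul_mem_left _ _ ht) (Ideal.mul_mem_left _ _ hz))
      (Ideal.mul_mem_left _ _ hY)
  have hY' : Y ∈ Ideal.span (Set.range ![t, z, ℓ]) := by
    have : Y = ↑w⁻¹ * (ℓ - α * t - β * z) := by
      rw [show ℓ - α * t - β * z = ↑w * Y by rw [hℓ_def]; ring, Units.inv_mul_cancel_left]
    rw [this]
    exact Ideal.mul_mem_left _ _
      (Ideal.sub_mem _ (Ideal.sub_mem _ hℓ' (Ideal.mul_mem_left _ _ ht')) (Ideal.mul_mem_left _ _ hz'))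
  apply le_antisymm
  · rw [Ideal.span_le]
    rintro x ⟨i, rfl⟩
    fin_cases i
    · simpa using ht
    · simpa using hz
    · simpa using hℓ
  · rw [Ideal.span_le]
    rintro x ⟨i, rfl⟩
    fin_cases i
    · simpa using ht'
    · simpa using hz'
    · simpa using hY'

open MvPolynomial in
/-- [OURS · R9] **A competitor of ratio > 1 is `αt + βz + γY` with `γ` a UNIT and `β ∈ 𝔪`.**  Regular local, dim 3, frame `(t,z,Y)`;
the degree-`ν` layer of `f` is `Σ_{α∈Δ} a_α u^α` (`|α| = ν`) with a UNIT coefficient at `Y^ν` and every other layer monomial divisible by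
`t` (`htfree` — at the CURVE° successor every non-`Y^ν` monomial of `f₁` has `t`-exponent `i − b(ν−j) ≥ 1` because `r > qb`); if
`f ≡ c·g^ν (mod 𝔪^{ν+1})` with `g ∈ 𝔪` (what §3 extracts from any competitor of ratio `> 1`), then `g = αt + βz + γY` with `γ` a unit
and `β ∈ 𝔪` (NO `z̄`-component).  Proof: the layer identity at `(0,0,1)` gives `ā_{(0,0,ν)} = c̄·γ̄^ν`, at `(0,1,0)` gives `0 = c̄·β̄^ν`.
[cite: Matsumura1987, Thm. 16.2] -/
theorem competitor_coefficients (hdim : ringKrullDim T = (3 : ℕ)) {t z Y f g : T}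
    (h𝔪 : Ideal.span (Set.range ![t, z, Y]) = maximalIdeal T) {ν : ℕ} (hν : 0 < ν)
    {Δ : Finset (Fin 3 → ℕ)} {a : (Fin 3 → ℕ) → T} (hΔ : ∀ α ∈ Δ, ∑ i, α i = ν)
    (hα₀ : (![0, 0, ν] : Fin 3 → ℕ) ∈ Δ) (ha₀ : IsUnit (a ![0, 0, ν]))
    (htfree : ∀ α ∈ Δ, α 0 = 0 → α = ![0, 0, ν])
    (hf : f - ∑ α ∈ Δ, a α * ∏ i, ![t, z, Y] i ^ α i ∈ maximalIdeal T ^ (ν + 1))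
    (hg : g ∈ maximalIdeal T) {c : T} (h : f - c * g ^ ν ∈ maximalIdeal T ^ (ν + 1)) :
    ∃ α β γ : T, IsUnit γ ∧ β ∈ maximalIdeal T ∧ g = α * t + β * z + γ * Y := by
  classical
  set u : Fin 3 → T := ![t, z, Y] with hu_def
  have hg' : g ∈ Ideal.span (Set.range u) := by rw [h𝔪]; exact hg
  obtain ⟨cf, hcf⟩ := Ideal.mem_span_range_iff_exists_fun.mp hg'
  set L : MvPolynomial (Fin 3) T := ∑ i, C (cf i) * X i with hL_def
  set Q : MvPolynomial (Fin 3) T := C c * L ^ ν with hQ_def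
  have hLeval : eval u L = g := by
    simp only [hL_def, map_sum, map_mul, eval_C, eval_X]; exact hcf
  have hQeval : eval u Q = c * g ^ ν := by
    simp only [hQ_def, map_mul, map_pow, eval_C, hLeval]
  have hLhom : L.IsWeightedHomogeneous (fun _ : Fin 3 => (1 : ℕ)) 1 := by
    refine IsWeightedHomogeneous.sum Finset.univ (fun i => C (cf i) * X i) 1 (fun i _ => ?_)
    simpa using (isWeightedHomogeneous_C (fun _ : Fin 3 => (1 : ℕ)) (cf i)).mul
      (isWeightedHomogeneous_X T (fun _ : Fin 3 => (1 : ℕ)) i)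
  have hQhom : Q.IsWeightedHomogeneous (fun _ : Fin 3 => (1 : ℕ)) ν := by
    simpa using (isWeightedHomogeneous_C (fun _ : Fin 3 => (1 : ℕ)) c).mul (hLhom.pow ν)
  have hfQ : f - eval u Q ∈ maximalIdeal T ^ (ν + 1) := by rw [hQeval]; exact h
  set r := IsLocalRing.residue T with hr_def
  have hev := layer_identity hdim h𝔪 hΔ hf Q hQhom hfQ ![0, 0, 1]
  -- the left-hand side collapses to `r (a (0,0,ν))`
  have hlhs : ∑ α ∈ Δ, r (a α) * ∏ i, (![0, 0, 1] : Fin 3 → IsLocalRing.ResidueField T) i ^ α i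
      = r (a ![0, 0, ν]) := by
    rw [Finset.sum_eq_single_of_mem _ hα₀]
    · simp [Fin.prod_univ_three]
    · intro α hα hne
      have hsum := hΔ α hα
      have hpos : α 0 ≠ 0 ∨ α 1 ≠ 0 := by
        by_contra hcon
        rw [not_or, not_ne_iff, not_ne_iff] at hcon
        apply hne
        funext i
        fin_cases i
        · simp [hcon.1]
        · simp [hcon.2]
        · simp only [Fin.sum_univ_three, hcon.1, hcon.2, zero_add] at hsum
          simp [hsum]
      rcases hpos with h0 | h1
      · simp [Fin.prod_univ_three, zero_pow h0]
      · simp [Fin.prod_univ_three, zero_pow h1]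
  -- the right-hand side is `r c * (r (cf 2))^ν`
  have hrhs : eval (![0, 0, 1] : Fin 3 → IsLocalRing.ResidueField T) (MvPolynomial.map r Q) = r c * r (cf 2) ^ ν := by
    simp [hQ_def, hL_def, map_mul, map_pow, map_C, map_X, eval_C, eval_X, Fin.sum_univ_three]
  rw [hlhs, hrhs] at hev
  have hcf2 : IsUnit (cf 2) := by
    rw [← IsLocalRing.residue_ne_zero_iff_isUnit]
    intro h2
    rw [h2, zero_pow hν.ne', mul_zero] at hev
    exact (ha₀.map r).ne_zero hev
  have hrc : r c ≠ 0 := by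
    intro h0
    rw [h0, zero_mul] at hev
    exact (ha₀.map r).ne_zero hev
  -- evaluate at `(0,1,0)`: every layer monomial vanishes there (`Y^ν` since `ν > 0`, the others contain `t`)
  have hev1 := layer_identity hdim h𝔪 hΔ hf Q hQhom hfQ ![0, 1, 0]
  have hlhs1 : ∑ α ∈ Δ, r (a α) * ∏ i, (![0, 1, 0] : Fin 3 → IsLocalRing.ResidueField T) i ^ α i = 0 := by
    refine Finset.sum_eq_zero fun α hα => ?_
    by_cases h0 : α 0 = 0
    · have hα := htfree α hα h0
      subst hα
      simp [Fin.prod_univ_three, zero_pow hν.ne']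
    · simp [Fin.prod_univ_three, zero_pow h0]
  have hrhs1 : eval (![0, 1, 0] : Fin 3 → IsLocalRing.ResidueField T) (MvPolynomial.map r Q) = r c * r (cf 1) ^ ν := by
    simp [hQ_def, hL_def, map_mul, map_pow, map_C, map_X, eval_C, eval_X, Fin.sum_univ_three]
  rw [hlhs1, hrhs1] at hev1
  have hcf1 : cf 1 ∈ maximalIdeal T := by
    rw [← IsLocalRing.residue_eq_zero_iff]
    rcases mul_eq_zero.mp hev1.symm with h0 | h0
    · exact absurd h0 hrc
    · exact (pow_eq_zero_iff hν.ne').mp h0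
  refine ⟨cf 0, cf 1, cf 2, hcf2, hcf1, ?_⟩
  have := hcf
  simp only [hu_def, Fin.sum_univ_three, Matrix.cons_val_zero, Matrix.cons_val_one, Matrix.cons_val_two,
    Matrix.tail_cons, Matrix.head_cons] at this
  linear_combination (-1 : T) * this

/-- [OURS · R9] Corollary: such a competitor completes `(t, z)` to a frame. [folklore] -/
theorem span_eq_maximalIdeal_of_competitor (hdim : ringKrullDim T = (3 : ℕ)) {t z Y f g : T}
    (h𝔪 : Ideal.span (Set.range ![t, z, Y]) = maximalIdeal T) {ν : ℕ} (hν : 0 < ν)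
    {Δ : Finset (Fin 3 → ℕ)} {a : (Fin 3 → ℕ) → T} (hΔ : ∀ α ∈ Δ, ∑ i, α i = ν)
    (hα₀ : (![0, 0, ν] : Fin 3 → ℕ) ∈ Δ) (ha₀ : IsUnit (a ![0, 0, ν]))
    (htfree : ∀ α ∈ Δ, α 0 = 0 → α = ![0, 0, ν])
    (hf : f - ∑ α ∈ Δ, a α * ∏ i, ![t, z, Y] i ^ α i ∈ maximalIdeal T ^ (ν + 1))
    (hg : g ∈ maximalIdeal T) {c : T} (h : f - c * g ^ ν ∈ maximalIdeal T ^ (ν + 1)) :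
    Ideal.span (Set.range ![t, z, g]) = maximalIdeal T := by
  obtain ⟨α, β, γ, hγ, -, rfl⟩ := competitor_coefficients hdim h𝔪 hν hΔ hα₀ ha₀ htfree hf hg h
  rw [span_triple_eq_of_isUnit hγ, h𝔪]

/-- [OURS · R9] The frame property in the form the reduction consumes: every `g ∈ 𝔪` along which `f` has rational contact of some
ratio `a/b > 1` is `αt + βz + γY` with `γ` a unit and `β ∈ 𝔪` (§3 dichotomy + `competitor_coefficients`). [folklore] -/
theorem frame_of_layer (hdim : ringKrullDim T = (3 : ℕ)) {t z Y f : T}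
    (h𝔪 : Ideal.span (Set.range ![t, z, Y]) = maximalIdeal T) {ν : ℕ} (hν : 0 < ν)
    {Δ : Finset (Fin 3 → ℕ)} {a : (Fin 3 → ℕ) → T} (hΔ : ∀ α ∈ Δ, ∑ i, α i = ν)
    (hα₀ : (![0, 0, ν] : Fin 3 → ℕ) ∈ Δ) (ha₀ : IsUnit (a ![0, 0, ν]))
    (htfree : ∀ α ∈ Δ, α 0 = 0 → α = ![0, 0, ν])
    (hf : f - ∑ α ∈ Δ, a α * ∏ i, ![t, z, Y] i ^ α i ∈ maximalIdeal T ^ (ν + 1)) :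
    ∀ g ∈ maximalIdeal T, ∀ a' b' : ℕ, 0 < b' → b' < a' →
      f ∈ ratContactFiltration g a' b' (a' * ν) →
        ∃ α β γ : T, IsUnit γ ∧ β ∈ maximalIdeal T ∧ g = α * t + β * z + γ * Y := by
  intro g hg a' b' hb' hab hmem
  obtain ⟨c, hc⟩ := exists_sub_mul_pow_mem_of_mem_ratContactFiltration hg hb' hab hmem
  exact competitor_coefficients hdim h𝔪 hν hΔ hα₀ ha₀ htfree hf hg hc

/-- [OURS · R9 · (b′) ABSTRACT REDUCTION] **`SuccessorRatioBound` from frames and weighted non-membership.**  With slope budget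
`K = 1 + ρ/q` (`0 < ρ < q`): if every competitor of ratio `> 1` is `αt + βz + γY` with `γ` a unit, `β ∈ 𝔪` (`hframe`, = `frame_of_layer`) and `f`
lies in NO `RC(αt+βz+γY; a, b; aν)` with `γ` a unit, `β ∈ 𝔪`, `(q+ρ)·b ≤ a·q` (ratio `≥ K`) and `a ≤ 2b` (ratio `≤ 2`), then EVERY two-flag reaches only
ratios `< K`.  Ratios `> 2` are folded onto `(a,b) = (2,1)` by `ratContactFiltration_mono_ratio`; by §11 (`N = 2`, `a ≤ 2b`) the
hypothesis `hW` only ever needs the linear form up to `𝔪²` (`nonmem_of_rational` below). [folklore] -/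
theorem oneFlagRatioBound_of_frames {t z Y f : T} {ν q ρ : ℕ} (hρ : 0 < ρ) (hρq : ρ < q)
    (hframe : ∀ g ∈ maximalIdeal T, ∀ a b : ℕ, 0 < b → b < a →
      f ∈ ratContactFiltration g a b (a * ν) → ∃ α β γ : T, IsUnit γ ∧ β ∈ maximalIdeal T ∧ g = α * t + β * z + γ * Y)
    (hW : ∀ α β γ : T, IsUnit γ → β ∈ maximalIdeal T → ∀ a b : ℕ, 0 < b →
      (q + ρ) * b ≤ a * q → a ≤ 2 * b → f ∉ ratContactFiltration (α * t + β * z + γ * Y) a b (a * ν)) :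
    OneFlagRatioBound T f ν q ρ := by
  intro g hg𝔪 r₁ r₂ hr₂ _ hmem
  refine Nat.lt_of_not_le fun hge => ?_
  -- the claimed ratio exceeds 1
  have hlt : r₂ < r₁ := by
    refine Nat.lt_of_not_le fun hle => ?_
    have h1 : r₁ * q ≤ r₂ * q := Nat.mul_le_mul_right _ hle
    have h2 : (q + ρ) * r₂ = r₂ * q + ρ * r₂ := by ring
    have h3 : 0 < ρ * r₂ := Nat.mul_pos hρ hr₂
    omega
  by_cases h2 : r₁ ≤ 2 * r₂
  · obtain ⟨α, β, γ, hγ, hβ, rfl⟩ := hframe g hg𝔪 r₁ r₂ hr₂ hlt hmem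
    exact hW α β γ hγ hβ r₁ r₂ hr₂ hge h2 hmem
  · have h2' : 2 * r₂ < r₁ := Nat.lt_of_not_le h2
    have hmem2 : f ∈ ratContactFiltration g 2 1 (2 * ν) :=
      ratContactFiltration_mono_ratio hr₂ one_pos (by omega) ν hmem
    obtain ⟨α, β, γ, hγ, hβ, rfl⟩ := hframe g hg𝔪 2 1 one_pos one_lt_two hmem2
    exact hW α β γ hγ hβ 2 1 one_pos (by omega) (by norm_num) hmem2

/-- The two-flag (`σ₁`) form of `oneFlagRatioBound_of_frames` (kept under its name of record). [folklore] -/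
theorem successorRatioBound_of_frames {t z Y f : T} {ν q ρ : ℕ} (hρ : 0 < ρ) (hρq : ρ < q)
    (hframe : ∀ g ∈ maximalIdeal T, ∀ a b : ℕ, 0 < b → b < a →
      f ∈ ratContactFiltration g a b (a * ν) → ∃ α β γ : T, IsUnit γ ∧ β ∈ maximalIdeal T ∧ g = α * t + β * z + γ * Y)
    (hW : ∀ α β γ : T, IsUnit γ → β ∈ maximalIdeal T → ∀ a b : ℕ, 0 < b →
      (q + ρ) * b ≤ a * q → a ≤ 2 * b → f ∉ ratContactFiltration (α * t + β * z + γ * Y) a b (a * ν)) :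
    SuccessorRatioBound T f ν q ρ :=
  (oneFlagRatioBound_of_frames hρ hρq hframe hW).successorRatioBound

/-- `Set.range ![a, b, c] = {a, b, c}`. [folklore] -/
theorem range_vec₃ {R : Type u} (a b c : R) : Set.range ![a, b, c] = {a, b, c} := by
  ext x
  simp only [Set.mem_range, Set.mem_insert_iff, Set.mem_singleton_iff]
  constructor
  · rintro ⟨i, hi⟩
    fin_cases i
    · exact Or.inl hi.symm
    · exact Or.inr (Or.inl hi.symm)
    · exact Or.inr (Or.inr hi.symm)
  · rintro (h | h | h)
    · exact ⟨0, h.symm⟩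
    · exact ⟨1, h.symm⟩
    · exact ⟨2, h.symm⟩

omit [IsRegularLocalRing T] in
/-- Rational contact only sees `g` up to a unit. [folklore] -/
theorem ratContactFiltration_unit_mul [IsLocalRing T] {v g : T} (hv : IsUnit v) (a b n : ℕ) :
    ratContactFiltration (v * g) a b n = ratContactFiltration g a b n := by
  rw [ratContactFiltration_def, ratContactFiltration_def]
  refine iSup_congr fun α => ?_
  rw [mul_pow, Ideal.span_singleton_mul_left_unit (hv.pow α)]

/-- [OURS · R9 · (b′) LINEAR REDUCTION] **Only the TRANSLATES `Y − c·t`, `c` from a set of residue REPRESENTATIVES, matter.**  If every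
element of `T` is congruent mod `𝔪` to a member of `Λ ⊆ T` (`hres`; at a `k`-rational point `Λ = k`, at a closed point of the curve with residue
field `k[z]/(π)` the polynomials in `z` of degree `< deg π`) and `t, z, Y ∈ 𝔪`, the hypothesis `hW` of `successorRatioBound_of_frames` follows from
its restriction to the regular parameters `Y − c·t`, `c ∈ Λ`: a competitor `g = αt + βz + γY` (`γ` unit, `β ∈ 𝔪`) has
`γ⁻¹g ≡ Y − c·t (mod 𝔪²)` for the representative `c` of `−α/γ`, §11 with `N = 2` (`A ≤ 2B`) replaces it by that form, and a unit factor is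
invisible.  No implicit function, no completion, no Weierstrass, no coefficient field — and the old Step (b) (`no_canceller` for pure-`z`
translations of order `≥ 2`) is not needed either: such translations are invisible below ratio `2`. [folklore] -/
theorem nonmem_of_representatives (Λ : Set T)
    (hres : ∀ x : T, ∃ a ∈ Λ, x - a ∈ maximalIdeal T)
    {t z Y f : T} (ht : t ∈ maximalIdeal T) (hz : z ∈ maximalIdeal T) {ν q ρ : ℕ}
    (hWlin : ∀ c ∈ Λ, ∀ A B : ℕ, 0 < B → (q + ρ) * B ≤ A * q → A ≤ 2 * B →
      f ∉ ratContactFiltration (Y - c * t) A B (A * ν)) :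
    ∀ α β γ : T, IsUnit γ → β ∈ maximalIdeal T → ∀ A B : ℕ, 0 < B → (q + ρ) * B ≤ A * q → A ≤ 2 * B →
      f ∉ ratContactFiltration (α * t + β * z + γ * Y) A B (A * ν) := by
  intro α β γ hγ hβ A B hB hK h2 hmem
  obtain ⟨u, rfl⟩ := hγ
  obtain ⟨c, hcΛ, hc⟩ := hres (-(α * ↑u⁻¹))
  have hdiff : (Y - c * t) - (↑u⁻¹ * (α * t + β * z + ↑u * Y)) ∈ maximalIdeal T ^ 2 := by
    have : (Y - c * t) - (↑u⁻¹ * (α * t + β * z + ↑u * Y))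
        = (-(α * ↑u⁻¹) - c) * t - (β * ↑u⁻¹) * z := by
      linear_combination (-Y) * u.inv_mul
    rw [this, pow_two]
    exact Ideal.sub_mem _ (Ideal.mul_mem_mul hc ht) (Ideal.mul_mem_mul (Ideal.mul_mem_right _ _ hβ) hz)
  have heq := ratContactFiltration_congr_mod_pow hB (show A ≤ B * 2 by omega) hdiff (A * ν)
  rw [← ratContactFiltration_unit_mul (Units.isUnit u⁻¹) A B (A * ν), ← heq] at hmem
  exact hWlin c hcΛ A B hB hK h2 hmem

omit [IsRegularLocalRing T] in
/-- [OURS · R9] A monomial `t^{e₀} z^{e₁} Y^{e₂}` of `(t,z)`-value `(e₀+e₁)/(ν−e₂) < K = 1 + ρ/q` has `(B,B,A)`-weight `< Aν` for every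
ratio `A/B ≥ K`. [folklore] -/
theorem low_weight {q ρ ν A B : ℕ} {e : Fin 3 → ℕ} (hq : 0 < q) (hB : 0 < B) (hK : (q + ρ) * B ≤ A * q)
    (he : q * (e 0 + e 1) < (q + ρ) * (ν - e 2)) : ∑ i, ![B, B, A] i * e i < A * ν := by
  simp only [Fin.sum_univ_three, Matrix.cons_val_zero, Matrix.cons_val_one, Matrix.cons_val_two, Matrix.tail_cons,
    Matrix.head_cons]
  obtain ⟨m, hm⟩ : ∃ m, ν = e 2 + m := by
    refine ⟨ν - e 2, ?_⟩
    by_contra hne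
    have h0 : ν - e 2 = 0 := by omega
    rw [h0, mul_zero] at he
    exact Nat.not_lt_zero _ he
  subst hm
  rw [Nat.add_sub_cancel_left] at he
  have h1 : B * (q * (e 0 + e 1)) < B * ((q + ρ) * m) := (Nat.mul_lt_mul_left hB).mpr he
  have h2 : B * ((q + ρ) * m) ≤ q * (A * m) := by
    calc B * ((q + ρ) * m) = ((q + ρ) * B) * m := by ring
      _ ≤ (A * q) * m := Nat.mul_le_mul_right _ hK
      _ = q * (A * m) := by ring
  have h3 : q * (B * (e 0 + e 1)) < q * (A * m) := by
    calc q * (B * (e 0 + e 1)) = B * (q * (e 0 + e 1)) := by ring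
      _ < q * (A * m) := lt_of_lt_of_le h1 h2
  have h4 : B * (e 0 + e 1) < A * m := (Nat.mul_lt_mul_left hq).mp h3
  have h5 : B * (e 0 + e 1) = B * e 0 + B * e 1 := by ring
  have h6 : A * (e 2 + m) = A * e 2 + A * m := by ring
  omega

/-- [OURS · R9 · (b′) RING-SIDE, ASSEMBLED] **`SuccessorRatioBound` from LOW UNIT MONOMIALS IN THE TRANSLATED FRAMES.**  Regular local
ring of dimension `3` whose residue classes have representatives in `Λ ⊆ T` (every closed point: `Λ = k` at a `k`-rational point, polynomials
in `z` of low degree at a non-rational closed point of the curve), frame `(t, z, Y)`, `0 < ρ < q`, `0 < ν`; the degree-`ν` layer of `f` has a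
unit at `Y^ν` and every other layer monomial divisible by `t`; and for every representative `c ∈ Λ` and every ratio `A/B ∈ [K, 2]` some unit
expansion of `f` in the frame `(t, z, Y − c·t)` (for the door: the blow-up of the `S`-frame `(x, y − c·x^{b+1}, z)`, which keeps
`W((x,y,z);(q,r+1,1);·)` by the tree's jets lemma `Theorems.weightedMonomialIdeal_eq_of_forall_sub_mem`, so the `τ(η) = 0` witness transports)
carries a monomial of `(t,z)`-value `< K` (`witness_lands_low`, §5).  THEN every admissible triple reached by `f` has `r₁·q < (q+ρ)·r₂` — the
ring side of (o56)(b′), with NO implicit-function / completion / Weierstrass / coefficient-field step: one-flag collapse (§2), dichotomy (§3),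
layer identity (§12), `𝔪²`-rigidity below ratio 2 (§11), ratio monotonicity, frame identification (§6) and the monomial reading (§8). [folklore] -/
theorem oneFlagRatioBound_of_lowWitnesses (Λ : Set T)
    (hres : ∀ x : T, ∃ a ∈ Λ, x - a ∈ maximalIdeal T)
    (hdim : ringKrullDim T = (3 : ℕ)) {t z Y f : T} (h𝔪 : Ideal.span (Set.range ![t, z, Y]) = maximalIdeal T)
    {ν q ρ : ℕ} (hν : 0 < ν) (hρ : 0 < ρ) (hρq : ρ < q)
    {Δ : Finset (Fin 3 → ℕ)} {a : (Fin 3 → ℕ) → T} (hΔ : ∀ α ∈ Δ, ∑ i, α i = ν)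
    (hα₀ : (![0, 0, ν] : Fin 3 → ℕ) ∈ Δ) (ha₀ : IsUnit (a ![0, 0, ν]))
    (htfree : ∀ α ∈ Δ, α 0 = 0 → α = ![0, 0, ν])
    (hf : f - ∑ α ∈ Δ, a α * ∏ i, ![t, z, Y] i ^ α i ∈ maximalIdeal T ^ (ν + 1))
    (hWit : ∀ c ∈ Λ, ∀ A B : ℕ, 0 < B → (q + ρ) * B ≤ A * q → A ≤ 2 * B →
      ∃ (Δ' : Finset (Fin 3 → ℕ)) (c' : (Fin 3 → ℕ) → T) (N : ℕ), (∀ e ∈ Δ', IsUnit (c' e)) ∧ A * ν ≤ N ∧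
        f - ∑ e ∈ Δ', c' e * ∏ i, ![t, z, Y - c * t] i ^ e i ∈ maximalIdeal T ^ N ∧
        ∃ e ∈ Δ', q * (e 0 + e 1) < (q + ρ) * (ν - e 2)) :
    OneFlagRatioBound T f ν q ρ := by
  have hq : 0 < q := lt_of_le_of_lt (Nat.zero_le _) hρq
  have ht : t ∈ maximalIdeal T := by
    simpa using Theorems.LocalGameEFTNewton.mem_maximalIdeal_of_span_eq ![t, z, Y] h𝔪 0
  have hz : z ∈ maximalIdeal T := by
    simpa using Theorems.LocalGameEFTNewton.mem_maximalIdeal_of_span_eq ![t, z, Y] h𝔪 1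
  refine oneFlagRatioBound_of_frames hρ hρq (frame_of_layer hdim h𝔪 hν hΔ hα₀ ha₀ htfree hf)
    (nonmem_of_representatives Λ hres ht hz fun c hc A B hB hK h2 hmem => ?_)
  obtain ⟨Δ', c', N, hunit, hN, hr, e, he, hlow⟩ := hWit c hc A B hB hK h2
  -- the translated frame `(t, z, Y − c t)`
  have h𝔪' : Ideal.span (Set.range ![t, z, Y - c * t]) = maximalIdeal T := by
    have h1 := span_triple_eq_of_isUnit (t := t) (z := z) (Y := Y) (α := -c) (β := 0) isUnit_one
    rw [show -c * t + 0 * z + 1 * Y = Y - c * t by ring] at h1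
    rw [h1, h𝔪]
  have hBA : B ≤ A := by
    refine Nat.le_of_not_lt fun hlt => ?_
    have h1 : A * q < B * q := Nat.mul_lt_mul_of_pos_right hlt hq
    have h2 : B * q ≤ (q + ρ) * B := by
      calc B * q = q * B := by ring
        _ ≤ (q + ρ) * B := Nat.mul_le_mul_right _ (Nat.le_add_right q ρ)
    omega
  have hA : 0 < A := lt_of_lt_of_le hB hBA
  have h𝔪'' : Ideal.span {t, z, Y - c * t} = maximalIdeal T := by
    rw [← range_vec₃]; exact h𝔪'
  rw [← weightedMonomialIdeal_eq_ratContactFiltration h𝔪'' hB hBA] at hmem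
  have hge := (mem_weightedMonomialIdeal_iff_forall_le_weight hdim h𝔪' hB hA hunit hr hN).mp hmem e he
  exact absurd hge (not_le.mpr (low_weight hq hB hK hlow))

/-- The two-flag (`σ₁`) form of `oneFlagRatioBound_of_lowWitnesses` (kept under its name of record). [folklore] -/
theorem successorRatioBound_of_lowWitnesses (Λ : Set T)
    (hres : ∀ x : T, ∃ a ∈ Λ, x - a ∈ maximalIdeal T)
    (hdim : ringKrullDim T = (3 : ℕ)) {t z Y f : T} (h𝔪 : Ideal.span (Set.range ![t, z, Y]) = maximalIdeal T)
    {ν q ρ : ℕ} (hν : 0 < ν) (hρ : 0 < ρ) (hρq : ρ < q)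
    {Δ : Finset (Fin 3 → ℕ)} {a : (Fin 3 → ℕ) → T} (hΔ : ∀ α ∈ Δ, ∑ i, α i = ν)
    (hα₀ : (![0, 0, ν] : Fin 3 → ℕ) ∈ Δ) (ha₀ : IsUnit (a ![0, 0, ν]))
    (htfree : ∀ α ∈ Δ, α 0 = 0 → α = ![0, 0, ν])
    (hf : f - ∑ α ∈ Δ, a α * ∏ i, ![t, z, Y] i ^ α i ∈ maximalIdeal T ^ (ν + 1))
    (hWit : ∀ c ∈ Λ, ∀ A B : ℕ, 0 < B → (q + ρ) * B ≤ A * q → A ≤ 2 * B →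
      ∃ (Δ' : Finset (Fin 3 → ℕ)) (c' : (Fin 3 → ℕ) → T) (N : ℕ), (∀ e ∈ Δ', IsUnit (c' e)) ∧ A * ν ≤ N ∧
        f - ∑ e ∈ Δ', c' e * ∏ i, ![t, z, Y - c * t] i ^ e i ∈ maximalIdeal T ^ N ∧
        ∃ e ∈ Δ', q * (e 0 + e 1) < (q + ρ) * (ν - e 2)) :
    SuccessorRatioBound T f ν q ρ :=
  (oneFlagRatioBound_of_lowWitnesses Λ hres hdim h𝔪 hν hρ hρq hΔ hα₀ ha₀ htfree hf hWit).successorRatioBound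

/-- [OURS · R9 · (b′) RING-SIDE at a `k`-RATIONAL point] The same with a coefficient field: `T` a `k`-algebra in which every element is a
constant mod `𝔪`, witnesses for the constant translates `Y − c·t`, `c ∈ k`. [folklore] -/
theorem successorRatioBound_of_lowWitnesses_rational {k : Type*} [Field k] [Algebra k T]
    (hres : ∀ x : T, ∃ a : k, x - algebraMap k T a ∈ maximalIdeal T)
    (hdim : ringKrullDim T = (3 : ℕ)) {t z Y f : T} (h𝔪 : Ideal.span (Set.range ![t, z, Y]) = maximalIdeal T)
    {ν q ρ : ℕ} (hν : 0 < ν) (hρ : 0 < ρ) (hρq : ρ < q)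
    {Δ : Finset (Fin 3 → ℕ)} {a : (Fin 3 → ℕ) → T} (hΔ : ∀ α ∈ Δ, ∑ i, α i = ν)
    (hα₀ : (![0, 0, ν] : Fin 3 → ℕ) ∈ Δ) (ha₀ : IsUnit (a ![0, 0, ν]))
    (htfree : ∀ α ∈ Δ, α 0 = 0 → α = ![0, 0, ν])
    (hf : f - ∑ α ∈ Δ, a α * ∏ i, ![t, z, Y] i ^ α i ∈ maximalIdeal T ^ (ν + 1))
    (hWit : ∀ c : k, ∀ A B : ℕ, 0 < B → (q + ρ) * B ≤ A * q → A ≤ 2 * B →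
      ∃ (Δ' : Finset (Fin 3 → ℕ)) (c' : (Fin 3 → ℕ) → T) (N : ℕ), (∀ e ∈ Δ', IsUnit (c' e)) ∧ A * ν ≤ N ∧
        f - ∑ e ∈ Δ', c' e * ∏ i, ![t, z, Y - algebraMap k T c * t] i ^ e i ∈ maximalIdeal T ^ N ∧
        ∃ e ∈ Δ', q * (e 0 + e 1) < (q + ρ) * (ν - e 2)) :
    SuccessorRatioBound T f ν q ρ := by
  refine successorRatioBound_of_lowWitnesses (Set.range (algebraMap k T)) (fun x => ?_) hdim h𝔪 hν hρ hρq hΔ hα₀ ha₀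
    htfree hf ?_
  · obtain ⟨c, hc⟩ := hres x
    exact ⟨_, ⟨c, rfl⟩, hc⟩
  · rintro _ ⟨c, rfl⟩ A B hB hK h2
    exact hWit c A B hB hK h2

end CompetitorFrame

/-! ## §13 (gen 9, R9.12) Two helpers for the door's obligation (D3) and for axis (i) of ORDER (o64)

(a) `weightedMonomialIdeal_update_add_mul_pow_eq`: translating a frame element by a multiple of a POWER of another
frame element, of weight `≥` its own weight, changes no piece of the weighted filtration — the door's S-frame change
`y ↦ y - c·x^(b+1)` with weights `(q, r+1, 1)` and `r + 1 ≤ q·(b+1)`, so the rigid `τ(η) = 0` test transports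
between the `δ_η`-prepared frames at the various closed points of `C` (jets lemma [Wlodarczyk2022, 2.1.12] as
typed in `Theorems.weightedMonomialIdeal_eq_of_forall_sub_mem`; compare the transvection-by-a-parameter form
`Theorems.weightedMonomialIdeal_update_add_mul_eq`).
(b) `order_drops_over_eta_arith`: the exponent arithmetic of the lemma «over the generic point `η` of `C` the order
always drops» (R9.12 (C), case `q ≥ 2`): a `δ`-face monomial, `q·i = r·m` with `m = ν - j > 0`, `r = q·b + ρ`,
`ρ < q`, has `x`-chart exponent `i - b·m < m`, whence `ord_{η₁} f₁ ≤ (i - b·m) + j < ν`. -/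

section DoorHelpers

/-- [OURS · L1 w43 · R9.12 (a)] Weight-`≥` translation by a power preserves the weighted filtration. -/
theorem weightedMonomialIdeal_update_add_mul_pow_eq {A : Type*} [CommRing A] {m : ℕ} (u : Fin m → A)
    (w : Fin m → ℕ) {i j : Fin m} (hij : i ≠ j) (c : A) (e : ℕ) (hw : w i ≤ w j * e) (n : ℕ) :
    weightedMonomialIdeal (Function.update u i (u i + c * u j ^ e)) w n = weightedMonomialIdeal u w n := by
  have hj : Function.update u i (u i + c * u j ^ e) j = u j := Function.update_of_ne hij.symm _ _
  refine Theorems.weightedMonomialIdeal_eq_of_forall_sub_mem u _ w (fun l => ?_) (fun l => ?_) n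
  · by_cases hl : l = i
    · subst hl
      rw [Function.update_self, add_sub_cancel_left]
      exact Ideal.mul_mem_left _ _ (weightedMonomialIdeal_antitone u w hw
        (Theorems.pow_mem_weightedMonomialIdeal u w (Theorems.self_mem_weightedMonomialIdeal u w j) e))
    · rw [Function.update_of_ne hl, sub_self]
      exact Ideal.zero_mem _
  · by_cases hl : l = i
    · subst hl
      rw [Function.update_self, sub_add_cancel_left]
      have h := Theorems.pow_mem_weightedMonomialIdeal _ w
        (Theorems.self_mem_weightedMonomialIdeal (Function.update u l (u l + c * u j ^ e)) w j) e
      rw [hj] at h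
      exact neg_mem (Ideal.mul_mem_left _ _ (weightedMonomialIdeal_antitone _ w hw h))
    · rw [Function.update_of_ne hl, sub_self]
      exact Ideal.zero_mem _

/-- [OURS · L1 w43 · R9.12 (a′)] The door's instance: in an S-frame `(x, y, z)` with weights `(q, r+1, 1)` and
`r + 1 ≤ q·(b+1)`, the translation `y ↦ y + c·x^(b+1)` changes no piece `W((x,y,z); (q,r+1,1); n)`; in particular
the rigid `τ = 0` reading `f ∉ W(…; (r+1)·ν)` is the same in both frames. -/
theorem tauFrame_translate_eq {A : Type*} [CommRing A] (x y z c : A) {q r b : ℕ} (h : r + 1 ≤ q * (b + 1))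
    (n : ℕ) :
    weightedMonomialIdeal ![x, y + c * x ^ (b + 1), z] ![q, r + 1, 1] n =
      weightedMonomialIdeal ![x, y, z] ![q, r + 1, 1] n := by
  have := weightedMonomialIdeal_update_add_mul_pow_eq ![x, y, z] ![q, r + 1, 1] (i := 1) (j := 0)
    (by decide) c (b + 1) (by simpa using h) n
  convert this using 2
  ext l; fin_cases l <;> simp [Function.update]

/-- [OURS · L1 w43 · R9.12 (b)] Exponent arithmetic of «the order drops over `η`» (`q ≥ 2` case). -/
theorem order_drops_over_eta_arith {q r b ρ i m : ℕ} (hr : r = q * b + ρ) (hρq : ρ < q) (hm : 0 < m)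
    (hface : q * i = r * m) : b * m ≤ i ∧ i - b * m < m := by
  subst hr
  have hq : 0 < q := lt_of_le_of_lt (Nat.zero_le ρ) hρq
  have hbm : b * m ≤ i := by
    by_contra hlt
    have hlt' : i < b * m := Nat.lt_of_not_le hlt
    have : q * i < q * (b * m) := Nat.mul_lt_mul_of_pos_left hlt' hq
    nlinarith
  refine ⟨hbm, ?_⟩
  obtain ⟨d, rfl⟩ := Nat.exists_eq_add_of_le hbm
  have hd : q * d = ρ * m := by nlinarith
  have : q * d < q * m := by rw [hd]; exact Nat.mul_lt_mul_of_pos_right hρq hm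
  simpa using Nat.lt_of_mul_lt_mul_left this


/-- [OURS · L1 w43 · R9.12 (c)] Binomial estimate in the weighted filtration: if `X ∈ W_s` and `D ∈ W_{s+1}` then
`(X + D)^n - X^n ∈ W_{s·n+1}` — every cross term carries at least one factor `D`. [folklore] -/
theorem add_pow_sub_pow_mem_weightedMonomialIdeal {A : Type*} [CommRing A] {m : ℕ} (u : Fin m → A)
    (w : Fin m → ℕ) {s : ℕ} {X D : A} (hX : X ∈ weightedMonomialIdeal u w s)
    (hD : D ∈ weightedMonomialIdeal u w (s + 1)) (n : ℕ) :
    (X + D) ^ n - X ^ n ∈ weightedMonomialIdeal u w (s * n + 1) := by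
  induction n with
  | zero => simp
  | succ n ih =>
    have hXD : X + D ∈ weightedMonomialIdeal u w s :=
      add_mem hX (weightedMonomialIdeal_antitone u w (Nat.le_succ s) hD)
    have h1 : (X + D) * ((X + D) ^ n - X ^ n) ∈ weightedMonomialIdeal u w (s + (s * n + 1)) :=
      Theorems.weightedMonomialIdeal_mul_le u w _ _ (Ideal.mul_mem_mul hXD ih)
    have h2 : D * X ^ n ∈ weightedMonomialIdeal u w ((s + 1) + s * n) :=
      Theorems.weightedMonomialIdeal_mul_le u w _ _
        (Ideal.mul_mem_mul hD (Theorems.pow_mem_weightedMonomialIdeal u w hX n))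
    have e : (X + D) ^ (n + 1) - X ^ (n + 1) = (X + D) * ((X + D) ^ n - X ^ n) + D * X ^ n := by ring
    rw [e]
    refine add_mem ?_ ?_
    · simpa [Nat.mul_succ, Nat.add_comm, Nat.add_left_comm, Nat.add_assoc] using h1
    · simpa [Nat.mul_succ, Nat.add_comm, Nat.add_left_comm, Nat.add_assoc] using h2

/-- [OURS · L1 w43 · R9.12 (c′)] **Layer transport under a weight-raising translation** — the door's (D2)/(D3)
support-level transport done ring-side: if `uᵢ` is replaced by `uᵢ + c·uⱼ^e` with `wᵢ + 1 ≤ wⱼ·e` (STRICTLY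
heavier), then a homogeneous layer `Σ_{α ∈ Δ} a_α u^α` of weight `n` differs from the SAME layer written in the new
frame by an element of `W_{n+1}`: the `δ`-face (its exponent set `Δ` and its coefficients) is literally the same in
the translated frame `y ↦ y + c·x^(b+1)` (`q(b+1) ≥ r + 1`). -/
theorem layer_transport {A : Type*} [CommRing A] {m : ℕ} (u : Fin m → A) (w : Fin m → ℕ) {i j : Fin m}
    (c : A) (e : ℕ) (hw : w i + 1 ≤ w j * e) (Δ : Finset (Fin m → ℕ)) (a : (Fin m → ℕ) → A)
    {n : ℕ} (hΔ : ∀ α ∈ Δ, ∑ l, w l * α l = n) :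
    (∑ α ∈ Δ, a α * ∏ l, u l ^ α l) -
        ∑ α ∈ Δ, a α * ∏ l, Function.update u i (u i + c * u j ^ e) l ^ α l ∈
      weightedMonomialIdeal u w (n + 1) := by
  classical
  set u' := Function.update u i (u i + c * u j ^ e) with hu'
  rw [← Finset.sum_sub_distrib]
  refine Ideal.sum_mem _ (fun α hα => ?_)
  rw [← mul_sub]
  refine Ideal.mul_mem_left _ _ ?_
  -- split both monomials at the coordinate `i`
  have hR : ∀ v : Fin m → A, ∏ l, v l ^ α l = v i ^ α i * ∏ l ∈ Finset.univ.erase i, v l ^ α l :=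
    fun v => (Finset.mul_prod_erase Finset.univ (fun l => v l ^ α l) (Finset.mem_univ i)).symm
  have hR' : ∏ l ∈ Finset.univ.erase i, u' l ^ α l = ∏ l ∈ Finset.univ.erase i, u l ^ α l :=
    Finset.prod_congr rfl (fun l hl => by rw [hu', Function.update_of_ne (Finset.ne_of_mem_erase hl)])
  rw [hR u, hR u', hR', ← sub_mul, hu', Function.update_self]
  -- weight of the common factor
  set r := ∑ l ∈ Finset.univ.erase i, w l * α l with hr
  have hn : w i * α i + r = n := by
    rw [← hΔ α hα, hr, ← Finset.add_sum_erase Finset.univ (fun l => w l * α l) (Finset.mem_univ i)]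
  have hRmem : ∏ l ∈ Finset.univ.erase i, u l ^ α l ∈ weightedMonomialIdeal u w r := by
    have h := Theorems.prod_pow_mem_weightedMonomialIdeal u w (Function.update α i 0) (le_refl _)
    have hp : ∏ l, u l ^ Function.update α i 0 l = ∏ l ∈ Finset.univ.erase i, u l ^ α l := by
      rw [← Finset.mul_prod_erase Finset.univ (fun l => u l ^ Function.update α i 0 l) (Finset.mem_univ i),
        Function.update_self, pow_zero, one_mul]
      exact Finset.prod_congr rfl (fun l hl => by rw [Function.update_of_ne (Finset.ne_of_mem_erase hl)])
    have hs : ∑ l, w l * Function.update α i 0 l = r := by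
      rw [← Finset.add_sum_erase Finset.univ (fun l => w l * Function.update α i 0 l) (Finset.mem_univ i),
        Function.update_self, mul_zero, zero_add, hr]
      exact Finset.sum_congr rfl (fun l hl => by rw [Function.update_of_ne (Finset.ne_of_mem_erase hl)])
    rw [hp, hs] at h
    exact h
  -- the binomial estimate at coordinate `i`
  have hX : u i ∈ weightedMonomialIdeal u w (w i) := Theorems.self_mem_weightedMonomialIdeal u w i
  have hD : c * u j ^ e ∈ weightedMonomialIdeal u w (w i + 1) :=
    Ideal.mul_mem_left _ _ (weightedMonomialIdeal_antitone u w hw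
      (Theorems.pow_mem_weightedMonomialIdeal u w (Theorems.self_mem_weightedMonomialIdeal u w j) e))
  have hB := add_pow_sub_pow_mem_weightedMonomialIdeal u w hX hD (α i)
  have hprod := Theorems.weightedMonomialIdeal_mul_le u w _ _ (Ideal.mul_mem_mul (neg_mem hB) hRmem)
  have e1 : -((u i + c * u j ^ e) ^ α i - u i ^ α i) = u i ^ α i - (u i + c * u j ^ e) ^ α i := by ring
  rw [e1] at hprod
  have e2 : w i * α i + 1 + r = n + 1 := by omega
  rw [e2] at hprod
  exact hprod

end DoorHelpers


/-! ## §14 (gen 9) The chart pull-back of a unit expansion — door obligation (D1) → `hWit`, model-independently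

For ANY ring map `φ : S → T` into a regular local ring with `φ x = t`, `φ y = t^b·Y`, `φ(𝔪_S) ⊆ 𝔪_T`, `t ∉ 𝔪_T²`, a unit expansion
`f ≡ Σ_{α∈Δ} a_α x^{α₀} y^{α₁} z^{α₂} (mod 𝔪_S^M)` whose exponents satisfy the cylinder condition `b·ν ≤ α₀ + b·α₁` (implied by
`δ_η`-preparedness `r(ν − j) ≤ q·i`, `qb ≤ r`) pulls back, after dividing `φ f = t^{bν}·f₁` by `t^{bν}` (order is a valuation in a regular
local ring: `Literature…mul_not_mem_pow_of_not_mem_pow`), to the expansion `f₁ ≡ Σ φ(a_α)·t^{α₀+bα₁−bν}·(φ z)^{α₂}·Y^{α₁} (mod 𝔪_T^{M−bν})`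
in the successor frame `(t, φ z, Y)`.  With `Y := Y' − φ(c)·t` read through the S-frame `(x, y − c·x^{b+1}, z)` (§13) and the exponent
arithmetic `witness_lands_low` (§5) this is the `hWit` clause of `successorRatioBound_of_lowWitnesses`, for every model of the chart. -/

section ChartPullback

variable {S T : Type*} [CommRing S] [IsLocalRing S] [CommRing T] [IsRegularLocalRing T]

/-- [folklore; cite: ZariskiSamuel1960, Ch. VIII §1 Thm. 1 via `Literature…mul_not_mem_pow_of_not_mem_pow`] One regular parameter
cancels one power of `𝔪`: `t ∉ 𝔪²`, `t·a ∈ 𝔪^{k+1}` ⇒ `a ∈ 𝔪^k`. -/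
theorem mem_pow_of_mul_mem_pow_succ {t : T} (ht2 : t ∉ maximalIdeal T ^ 2) {a : T} {k : ℕ}
    (h : t * a ∈ maximalIdeal T ^ (k + 1)) : a ∈ maximalIdeal T ^ k := by
  rcases k with _ | k
  · simp
  by_contra ha
  exact Literature.AlgebraicGeometry.Resolution.mul_not_mem_pow_of_not_mem_pow (p := 1) (q := k) ht2 ha
    (by simpa [add_comm, add_assoc] using h)

/-- [folklore] Iterated cancellation: `t^n·g ∈ 𝔪^{m+n}` ⇒ `g ∈ 𝔪^m`. -/
theorem mem_pow_of_pow_mul_mem_pow {t : T} (ht2 : t ∉ maximalIdeal T ^ 2) {g : T} {m : ℕ} :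
    ∀ n : ℕ, t ^ n * g ∈ maximalIdeal T ^ (m + n) → g ∈ maximalIdeal T ^ m
  | 0, h => by simpa using h
  | n + 1, h => by
    have h' : t * (t ^ n * g) ∈ maximalIdeal T ^ ((m + n) + 1) := by
      rw [← mul_assoc, ← pow_succ']
      simpa [Nat.add_assoc] using h
    exact mem_pow_of_pow_mul_mem_pow ht2 n (mem_pow_of_mul_mem_pow_succ ht2 h')

/-- The successor exponent of `x^{α₀} y^{α₁} z^{α₂}` in the frame `(t, z, Y)` of the `x`-chart of the `(1,b)`-cylinder blow-up. -/
def chartExp (b ν : ℕ) (α : Fin 3 → ℕ) : Fin 3 → ℕ := ![α 0 + b * α 1 - b * ν, α 2, α 1]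

@[simp] theorem chartExp_zero (b ν : ℕ) (α : Fin 3 → ℕ) : chartExp b ν α 0 = α 0 + b * α 1 - b * ν := rfl
@[simp] theorem chartExp_one (b ν : ℕ) (α : Fin 3 → ℕ) : chartExp b ν α 1 = α 2 := rfl
@[simp] theorem chartExp_two (b ν : ℕ) (α : Fin 3 → ℕ) : chartExp b ν α 2 = α 1 := rfl

/-- [OURS · L1 w43 · R9 §14] **Chart pull-back of a unit expansion**, any model `φ : S → T` of the `x`-chart. -/
theorem chart_pullback_expansion (φ : S →+* T) {x y z : S} {t Y : T} {b ν M : ℕ} (hx : φ x = t)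
    (hy : φ y = t ^ b * Y) (hφ : Ideal.map φ (maximalIdeal S) ≤ maximalIdeal T) (ht2 : t ∉ maximalIdeal T ^ 2)
    {Δ : Finset (Fin 3 → ℕ)} {a : (Fin 3 → ℕ) → S} {f : S} {f₁ : T}
    (hr : f - ∑ α ∈ Δ, a α * ∏ i, ![x, y, z] i ^ α i ∈ maximalIdeal S ^ M)
    (hcyl : ∀ α ∈ Δ, b * ν ≤ α 0 + b * α 1) (hf₁ : φ f = t ^ (b * ν) * f₁) :
    f₁ - ∑ α ∈ Δ, φ (a α) * ∏ i, ![t, φ z, Y] i ^ chartExp b ν α i ∈ maximalIdeal T ^ (M - b * ν) := by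
  have h1 : φ (f - ∑ α ∈ Δ, a α * ∏ i, ![x, y, z] i ^ α i) ∈ maximalIdeal T ^ M := by
    have h := Ideal.mem_map_of_mem φ hr
    rw [Ideal.map_pow] at h
    exact Ideal.pow_right_mono hφ M h
  have hmono : ∀ α ∈ Δ, φ (a α * ∏ i, ![x, y, z] i ^ α i) =
      t ^ (b * ν) * (φ (a α) * ∏ i, ![t, φ z, Y] i ^ chartExp b ν α i) := by
    intro α hα
    have e : α 0 + b * α 1 = b * ν + (α 0 + b * α 1 - b * ν) := by have := hcyl α hα; omega
    have key : t ^ α 0 * (t ^ b * Y) ^ α 1 = t ^ (b * ν) * t ^ (α 0 + b * α 1 - b * ν) * Y ^ α 1 := by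
      rw [mul_pow, ← pow_mul, ← mul_assoc, ← pow_add]
      conv_lhs => rw [e, pow_add]
    simp only [map_mul, map_pow, Fin.prod_univ_three, Matrix.cons_val_zero, Matrix.cons_val_one,
      Matrix.cons_val_two, Matrix.head_cons, Matrix.tail_cons, hx, hy, chartExp_zero, chartExp_one, chartExp_two]
    rw [key]
    ring
  have h2 : φ (f - ∑ α ∈ Δ, a α * ∏ i, ![x, y, z] i ^ α i) =
      t ^ (b * ν) * (f₁ - ∑ α ∈ Δ, φ (a α) * ∏ i, ![t, φ z, Y] i ^ chartExp b ν α i) := by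
    rw [map_sub, map_sum, Finset.sum_congr rfl hmono, ← Finset.mul_sum, hf₁, ← mul_sub]
  rw [h2] at h1
  by_cases hM : b * ν ≤ M
  · obtain ⟨m, rfl⟩ := Nat.exists_eq_add_of_le hM
    rw [Nat.add_sub_cancel_left]
    exact mem_pow_of_pow_mul_mem_pow ht2 (b * ν) (by rwa [Nat.add_comm] at h1)
  · have h0 : M - b * ν = 0 := by omega
    rw [h0, pow_zero, Ideal.one_eq_top]
    exact Submodule.mem_top

/-- [OURS · L1 w43 · R9 §14] **The `hWit` clause from S-side data.**  Units pull back to units, the remainder order drops by `bν`, and an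
S-side `τ = 0` witness `q·α₀ + α₂ < (r+1)(ν − α₁)` of a `δ_η`-prepared exponent (`r(ν−α₁) ≤ q·α₀`) becomes a LOW successor exponent
`q(e₀ + e₁) < (q+ρ)(ν − e₂)` (`witness_lands_low`, `r = qb + ρ`). -/
theorem lowWitness_of_chart (φ : S →+* T) {x y z : S} {t Y : T} {b ν M q r ρ A : ℕ} (hx : φ x = t)
    (hy : φ y = t ^ b * Y) (hφ : Ideal.map φ (maximalIdeal S) ≤ maximalIdeal T) (ht2 : t ∉ maximalIdeal T ^ 2)
    (hq : 0 < q) (hr : r = q * b + ρ) {Δ : Finset (Fin 3 → ℕ)} {a : (Fin 3 → ℕ) → S} {f : S} {f₁ : T}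
    (hunit : ∀ α ∈ Δ, IsUnit (a α))
    (hrem : f - ∑ α ∈ Δ, a α * ∏ i, ![x, y, z] i ^ α i ∈ maximalIdeal S ^ M) (hM : A * ν + b * ν ≤ M)
    (hcyl : ∀ α ∈ Δ, b * ν ≤ α 0 + b * α 1) (hf₁ : φ f = t ^ (b * ν) * f₁)
    {α₀ : Fin 3 → ℕ} (hα₀ : α₀ ∈ Δ) (hprep₀ : r * (ν - α₀ 1) ≤ q * α₀ 0)
    (hwit₀ : q * α₀ 0 + α₀ 2 < (r + 1) * (ν - α₀ 1)) :
    ∃ (Δ' : Finset (Fin 3 → ℕ)) (c' : (Fin 3 → ℕ) → T) (N : ℕ), (∀ e ∈ Δ', IsUnit (c' e)) ∧ A * ν ≤ N ∧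
      f₁ - ∑ e ∈ Δ', c' e * ∏ i, ![t, φ z, Y] i ^ e i ∈ maximalIdeal T ^ N ∧
      ∃ e ∈ Δ', q * (e 0 + e 1) < (q + ρ) * (ν - e 2) := by
  classical
  -- the inverse re-indexing
  let inv : (Fin 3 → ℕ) → (Fin 3 → ℕ) := fun e => ![e 0 + b * ν - b * e 2, e 2, e 1]
  have hinv : ∀ α ∈ Δ, inv (chartExp b ν α) = α := by
    intro α hα
    have := hcyl α hα
    ext i
    fin_cases i
    · show chartExp b ν α 0 + b * ν - b * chartExp b ν α 2 = α 0
      simp only [chartExp_zero, chartExp_two]; omega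
    · show chartExp b ν α 2 = α 1
      simp
    · show chartExp b ν α 1 = α 2
      simp
  have hinj : Set.InjOn (chartExp b ν) Δ := by
    intro α hα β hβ h
    rw [← hinv α hα, ← hinv β hβ, h]
  refine ⟨Δ.image (chartExp b ν), fun e => φ (a (inv e)), M - b * ν, ?_, ?_, ?_, ?_⟩
  · intro e he
    obtain ⟨α, hα, rfl⟩ := Finset.mem_image.mp he
    show IsUnit (φ (a (inv (chartExp b ν α))))
    rw [hinv α hα]
    exact (hunit α hα).map φ
  · omega
  · have hs : ∑ e ∈ Δ.image (chartExp b ν), φ (a (inv e)) * ∏ i, ![t, φ z, Y] i ^ e i =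
        ∑ α ∈ Δ, φ (a α) * ∏ i, ![t, φ z, Y] i ^ chartExp b ν α i := by
      rw [Finset.sum_image hinj]
      exact Finset.sum_congr rfl (fun α hα => by rw [hinv α hα])
    rw [hs]
    exact chart_pullback_expansion φ hx hy hφ ht2 hrem hcyl hf₁
  · refine ⟨chartExp b ν α₀, Finset.mem_image_of_mem _ hα₀, ?_⟩
    have hν : α₀ 1 ≤ ν := by
      by_contra hlt
      have : ν - α₀ 1 = 0 := by omega
      rw [this] at hwit₀
      simp at hwit₀
    obtain ⟨m, hm⟩ := Nat.exists_eq_add_of_le hν   -- ν = α₀ 1 + m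
    have hqb : q * b ≤ r := by rw [hr]; exact Nat.le_add_right _ _
    have hm' : ν - α₀ 1 = m := by omega
    rw [hm'] at hprep₀ hwit₀
    have hbm : b * m ≤ α₀ 0 := by
      have h1 : q * b * m ≤ r * m := Nat.mul_le_mul_right m hqb
      have h2 : q * (b * m) ≤ q * α₀ 0 := by
        calc q * (b * m) = q * b * m := by ring
          _ ≤ r * m := h1
          _ ≤ q * α₀ 0 := hprep₀
      exact Nat.le_of_mul_le_mul_left h2 hq
    have hw := witness_lands_low (k := α₀ 2) hq hqb hprep₀ hwit₀ hbm
    have hbν : b * ν = b * α₀ 1 + b * m := by rw [hm, mul_add]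
    have e0 : chartExp b ν α₀ 0 = α₀ 0 - b * m := by simp only [chartExp_zero]; omega
    have e2 : ν - chartExp b ν α₀ 2 = m := by simp only [chartExp_two]; omega
    rw [e0, chartExp_one, e2]
    have hρ : r + q - q * b = q + ρ := by rw [hr]; omega
    rw [hρ] at hw
    exact hw



/-! ### §14b The «cylinder-or-deep» form.  A unit expansion of `f` read with SCALED weights `(L, L·b, 1)` at level `L·bν`
(`f ∈ W((x,y,z);(1,b,0);bν) ⊆ W((x,y,z);(L,Lb,1);Lbν)`, `weightedMonomialIdeal_mono_weights` + the tree reading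
`Theorems.LocalGameEFTNewton.le_weight_of_mem_weightedMonomialIdeal`, positive weights) only yields, per exponent, «cylinder condition
OR `z`-degree `≥ L`» (`le_or_le_of_scaled`); the deep terms are swallowed by the remainder (`z ∈ 𝔪_S`), so the chart pull-back goes
through on the cylinder part of `Δ`.  The same scaling reads `δ_η`-preparedness of the (shallow) `τ`-witness. -/

/-- [folklore] Unscaling a scaled weight inequality: `L·n ≤ L·s + k` ⇒ `n ≤ s` or `k ≥ L`. -/
theorem le_or_le_of_scaled {L n s k : ℕ} (h : L * n ≤ L * s + k) : n ≤ s ∨ L ≤ k := by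
  by_cases hk : L ≤ k
  · exact Or.inr hk
  · left
    have hlt : L * n < L * (s + 1) := by
      rw [Nat.mul_succ]
      exact lt_of_le_of_lt h (Nat.add_lt_add_left (Nat.lt_of_not_le hk) _)
    exact Nat.lt_succ_iff.mp (Nat.lt_of_mul_lt_mul_left hlt)

/-- [folklore] Monotonicity of the weighted filtration in the weights: `L·wᵢ ≤ w'ᵢ` for all `i` ⇒ `W(u;w;n) ⊆ W(u;w';L·n)`. -/
theorem weightedMonomialIdeal_mono_weights {A : Type*} [CommRing A] {m : ℕ} (u : Fin m → A) {w w' : Fin m → ℕ}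
    {L : ℕ} (h : ∀ i, L * w i ≤ w' i) (n : ℕ) :
    weightedMonomialIdeal u w n ≤ weightedMonomialIdeal u w' (L * n) := by
  apply Ideal.span_le.mpr
  rintro _ ⟨α, hα, rfl⟩
  refine Theorems.prod_pow_mem_weightedMonomialIdeal u w' α ?_
  calc L * n ≤ L * ∑ i, w i * α i := Nat.mul_le_mul_left L hα
    _ = ∑ i, L * w i * α i := by rw [Finset.mul_sum]; simp [mul_assoc]
    _ ≤ ∑ i, w' i * α i := Finset.sum_le_sum (fun i _ => Nat.mul_le_mul_right _ (h i))

/-- [OURS · L1 w43 · R9 §14b] Chart pull-back, cylinder-or-deep form. -/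
theorem chart_pullback_expansion_of_deep (φ : S →+* T) {x y z : S} {t Y : T} {b ν M : ℕ} (hx : φ x = t)
    (hy : φ y = t ^ b * Y) (hφ : Ideal.map φ (maximalIdeal S) ≤ maximalIdeal T) (ht2 : t ∉ maximalIdeal T ^ 2)
    (hz : z ∈ maximalIdeal S) {Δ : Finset (Fin 3 → ℕ)} {a : (Fin 3 → ℕ) → S} {f : S} {f₁ : T}
    (hr : f - ∑ α ∈ Δ, a α * ∏ i, ![x, y, z] i ^ α i ∈ maximalIdeal S ^ M)
    (hcyl : ∀ α ∈ Δ, b * ν ≤ α 0 + b * α 1 ∨ M ≤ α 2) (hf₁ : φ f = t ^ (b * ν) * f₁) :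
    f₁ - ∑ α ∈ Δ.filter (fun α => b * ν ≤ α 0 + b * α 1), φ (a α) * ∏ i, ![t, φ z, Y] i ^ chartExp b ν α i ∈
      maximalIdeal T ^ (M - b * ν) := by
  classical
  have hbad : ∑ α ∈ Δ.filter (fun α => ¬ b * ν ≤ α 0 + b * α 1), a α * ∏ i, ![x, y, z] i ^ α i ∈
      maximalIdeal S ^ M := by
    refine Ideal.sum_mem _ (fun α hα => ?_)
    obtain ⟨hαΔ, hnot⟩ := Finset.mem_filter.mp hα
    have hdeep : M ≤ α 2 := (hcyl α hαΔ).resolve_left hnot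
    refine Ideal.mul_mem_left _ _ ?_
    rw [Fin.prod_univ_three]
    simp only [Matrix.cons_val_zero, Matrix.cons_val_one, Matrix.cons_val_two, Matrix.head_cons, Matrix.tail_cons]
    exact Ideal.mul_mem_left _ _ (Ideal.pow_le_pow_right hdeep (Ideal.pow_mem_pow hz _))
  have hr' : f - ∑ α ∈ Δ.filter (fun α => b * ν ≤ α 0 + b * α 1), a α * ∏ i, ![x, y, z] i ^ α i ∈
      maximalIdeal S ^ M := by
    have hsplit := Finset.sum_filter_add_sum_filter_not Δ (fun α => b * ν ≤ α 0 + b * α 1)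
      (fun α => a α * ∏ i, ![x, y, z] i ^ α i)
    have h := Ideal.add_mem _ hr hbad
    rw [← hsplit] at h
    convert h using 1
    ring
  exact chart_pullback_expansion φ hx hy hφ ht2 hr' (fun α hα => (Finset.mem_filter.mp hα).2) hf₁

/-- [OURS · L1 w43 · R9 §14b] The `hWit` clause, cylinder-or-deep form (the shallow `τ`-witness is automatically on the cylinder side). -/
theorem lowWitness_of_chart_of_deep (φ : S →+* T) {x y z : S} {t Y : T} {b ν M q r ρ A : ℕ} (hx : φ x = t)
    (hy : φ y = t ^ b * Y) (hφ : Ideal.map φ (maximalIdeal S) ≤ maximalIdeal T) (ht2 : t ∉ maximalIdeal T ^ 2)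
    (hz : z ∈ maximalIdeal S) (hq : 0 < q) (hr : r = q * b + ρ) {Δ : Finset (Fin 3 → ℕ)} {a : (Fin 3 → ℕ) → S}
    {f : S} {f₁ : T} (hunit : ∀ α ∈ Δ, IsUnit (a α))
    (hrem : f - ∑ α ∈ Δ, a α * ∏ i, ![x, y, z] i ^ α i ∈ maximalIdeal S ^ M) (hM : A * ν + b * ν ≤ M)
    (hcyl : ∀ α ∈ Δ, b * ν ≤ α 0 + b * α 1 ∨ M ≤ α 2) (hf₁ : φ f = t ^ (b * ν) * f₁)
    {α₀ : Fin 3 → ℕ} (hα₀ : α₀ ∈ Δ) (hprep₀ : r * (ν - α₀ 1) ≤ q * α₀ 0)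
    (hwit₀ : q * α₀ 0 + α₀ 2 < (r + 1) * (ν - α₀ 1)) :
    ∃ (Δ' : Finset (Fin 3 → ℕ)) (c' : (Fin 3 → ℕ) → T) (N : ℕ), (∀ e ∈ Δ', IsUnit (c' e)) ∧ A * ν ≤ N ∧
      f₁ - ∑ e ∈ Δ', c' e * ∏ i, ![t, φ z, Y] i ^ e i ∈ maximalIdeal T ^ N ∧
      ∃ e ∈ Δ', q * (e 0 + e 1) < (q + ρ) * (ν - e 2) := by
  classical
  -- the S-side remainder absorbs the deep terms
  have hbad : ∑ α ∈ Δ.filter (fun α => ¬ b * ν ≤ α 0 + b * α 1), a α * ∏ i, ![x, y, z] i ^ α i ∈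
      maximalIdeal S ^ M := by
    refine Ideal.sum_mem _ (fun α hα => ?_)
    obtain ⟨hαΔ, hnot⟩ := Finset.mem_filter.mp hα
    have hdeep : M ≤ α 2 := (hcyl α hαΔ).resolve_left hnot
    refine Ideal.mul_mem_left _ _ ?_
    rw [Fin.prod_univ_three]
    simp only [Matrix.cons_val_zero, Matrix.cons_val_one, Matrix.cons_val_two, Matrix.head_cons, Matrix.tail_cons]
    exact Ideal.mul_mem_left _ _ (Ideal.pow_le_pow_right hdeep (Ideal.pow_mem_pow hz _))
  have hr' : f - ∑ α ∈ Δ.filter (fun α => b * ν ≤ α 0 + b * α 1), a α * ∏ i, ![x, y, z] i ^ α i ∈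
      maximalIdeal S ^ M := by
    have hsplit := Finset.sum_filter_add_sum_filter_not Δ (fun α => b * ν ≤ α 0 + b * α 1)
      (fun α => a α * ∏ i, ![x, y, z] i ^ α i)
    have h := Ideal.add_mem _ hrem hbad
    rw [← hsplit] at h
    convert h using 1
    ring
  -- the witness is shallow: preparedness puts it on the cylinder side
  have hcyl₀ : b * ν ≤ α₀ 0 + b * α₀ 1 := by
    have hν : α₀ 1 ≤ ν := by
      by_contra hlt
      have : ν - α₀ 1 = 0 := by omega
      rw [this] at hwit₀
      simp at hwit₀
    obtain ⟨m, hm⟩ := Nat.exists_eq_add_of_le hν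
    have hm' : ν - α₀ 1 = m := by omega
    rw [hm'] at hprep₀
    have hqb : q * b ≤ r := by rw [hr]; exact Nat.le_add_right _ _
    have h2 : q * (b * m) ≤ q * α₀ 0 :=
      calc q * (b * m) = q * b * m := by ring
        _ ≤ r * m := Nat.mul_le_mul_right m hqb
        _ ≤ q * α₀ 0 := hprep₀
    have hbm : b * m ≤ α₀ 0 := Nat.le_of_mul_le_mul_left h2 hq
    have hbν : b * ν = b * α₀ 1 + b * m := by rw [hm, mul_add]
    omega
  exact lowWitness_of_chart φ hx hy hφ ht2 hq hr (fun α hα => hunit α (Finset.mem_filter.mp hα).1) hr' hM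
    (fun α hα => (Finset.mem_filter.mp hα).2) hf₁ (Finset.mem_filter.mpr ⟨hα₀, hcyl₀⟩) hprep₀ hwit₀


/-! ### §14c The LAYER DATA (D2) of `successorRatioBound_of_lowWitnesses` from the same pull-back.  When `ν` persists at the
successor point (`f₁ ∈ 𝔪_T^ν` — otherwise the invariant drops at the first letter and (b′) is not invoked), the degree-`ν` layer of
the pulled-back unit expansion is `{Y^ν} ∪ {monomials divisible by t}` with a unit at `Y^ν`: `Y^ν` is the image of `y^ν`, and a
`t`-free degree-`ν` successor monomial comes from an exponent ON the cylinder boundary `α₀ + bα₁ = bν`, which `δ_η`-preparedness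
(`r(ν−α₁) ≤ qα₀`, `r = qb + ρ`, `ρ ≥ 1`) forces to be `y^ν` itself. -/

/-- [OURS · L1 w43 · R9 §14c] (D2) from the chart: the layer data `hΔ, hα₀, ha₀, htfree, hf` of
`successorRatioBound_of_lowWitnesses`, in the frame `(t, φ z, Y)`, from a unit expansion of `f` in `S` that is cylinder-or-deep and
prepared-or-deep and contains `y^ν`, for any model `φ` of the chart, provided `ν` persists (`f₁ ∈ 𝔪_T^ν`). -/
theorem layerData_of_chart (φ : S →+* T) (hdimT : ringKrullDim T = (3 : ℕ)) {x y z : S} {t Y : T}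
    (h𝔪T : Ideal.span (Set.range ![t, φ z, Y]) = maximalIdeal T) {b ν M q r ρ : ℕ} (hx : φ x = t)
    (hy : φ y = t ^ b * Y) (hφ : Ideal.map φ (maximalIdeal S) ≤ maximalIdeal T) (ht2 : t ∉ maximalIdeal T ^ 2)
    (hz : z ∈ maximalIdeal S) (hρ : 0 < ρ) (hr : r = q * b + ρ) {Δ : Finset (Fin 3 → ℕ)} {a : (Fin 3 → ℕ) → S}
    {f : S} {f₁ : T} (hunit : ∀ α ∈ Δ, IsUnit (a α))
    (hrem : f - ∑ α ∈ Δ, a α * ∏ i, ![x, y, z] i ^ α i ∈ maximalIdeal S ^ M) (hM : ν + 1 + b * ν ≤ M)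
    (hcyl : ∀ α ∈ Δ, b * ν ≤ α 0 + b * α 1 ∨ M ≤ α 2) (hprep : ∀ α ∈ Δ, r * (ν - α 1) ≤ q * α 0 ∨ M ≤ α 2)
    (hyν : (![0, ν, 0] : Fin 3 → ℕ) ∈ Δ) (hf₁ : φ f = t ^ (b * ν) * f₁) (hpers : f₁ ∈ maximalIdeal T ^ ν) :
    ∃ (ΔT : Finset (Fin 3 → ℕ)) (aT : (Fin 3 → ℕ) → T), (∀ e ∈ ΔT, ∑ i, e i = ν) ∧
      (![0, 0, ν] : Fin 3 → ℕ) ∈ ΔT ∧ IsUnit (aT ![0, 0, ν]) ∧ (∀ e ∈ ΔT, e 0 = 0 → e = ![0, 0, ν]) ∧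
      f₁ - ∑ e ∈ ΔT, aT e * ∏ i, ![t, φ z, Y] i ^ e i ∈ maximalIdeal T ^ (ν + 1) := by
  classical
  set Δg := Δ.filter (fun α => b * ν ≤ α 0 + b * α 1) with hΔg
  have hpb := chart_pullback_expansion_of_deep φ hx hy hφ ht2 hz hrem hcyl hf₁
  rw [← hΔg] at hpb
  have hcylg : ∀ α ∈ Δg, b * ν ≤ α 0 + b * α 1 := fun α hα => (Finset.mem_filter.mp hα).2
  -- re-indexing by `chartExp`, injective on the cylinder part
  let inv : (Fin 3 → ℕ) → (Fin 3 → ℕ) := fun e => ![e 0 + b * ν - b * e 2, e 2, e 1]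
  have hinv : ∀ α ∈ Δg, inv (chartExp b ν α) = α := by
    intro α hα
    have := hcylg α hα
    ext i
    fin_cases i
    · show chartExp b ν α 0 + b * ν - b * chartExp b ν α 2 = α 0
      simp only [chartExp_zero, chartExp_two]; omega
    · show chartExp b ν α 2 = α 1
      simp
    · show chartExp b ν α 1 = α 2
      simp
  have hinj : Set.InjOn (chartExp b ν) (Δg : Set (Fin 3 → ℕ)) := by
    intro α hα β hβ h
    rw [← hinv α hα, ← hinv β hβ, h]
  set Δ' := Δg.image (chartExp b ν) with hΔ'
  let c' : (Fin 3 → ℕ) → T := fun e => φ (a (inv e))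
  have hunit' : ∀ e ∈ Δ', IsUnit (c' e) := by
    intro e he
    obtain ⟨α, hα, rfl⟩ := Finset.mem_image.mp he
    show IsUnit (φ (a (inv (chartExp b ν α))))
    rw [hinv α hα]
    exact (hunit α (Finset.mem_filter.mp hα).1).map φ
  have hs : ∑ e ∈ Δ', c' e * ∏ i, ![t, φ z, Y] i ^ e i =
      ∑ α ∈ Δg, φ (a α) * ∏ i, ![t, φ z, Y] i ^ chartExp b ν α i := by
    rw [hΔ', Finset.sum_image hinj]
    exact Finset.sum_congr rfl (fun α hα => by show φ (a (inv (chartExp b ν α))) * _ = _; rw [hinv α hα])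
  have hr' : f₁ - ∑ e ∈ Δ', c' e * ∏ i, ![t, φ z, Y] i ^ e i ∈ maximalIdeal T ^ (ν + 1) := by
    rw [hs]
    exact Ideal.pow_le_pow_right (by omega) hpb
  -- reading in `T`: `ν` persists ⇒ every successor exponent has degree `≥ ν`
  have hdeg : ∀ e ∈ Δ', ν ≤ ∑ i, e i := by
    have hpers' : f₁ ∈ weightedMonomialIdeal ![t, φ z, Y] (fun _ => 1) ν := by
      rw [Theorems.LocalGameEFTNewton.weightedMonomialIdeal_const_one_eq_pow ![t, φ z, Y] h𝔪T]
      exact hpers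
    have h := Theorems.LocalGameEFTNewton.le_weight_of_mem_weightedMonomialIdeal ![t, φ z, Y] h𝔪T hdimT (fun _ => 1)
      (fun _ => one_pos) hunit' hr' hpers' (Nat.le_succ ν)
    intro e he
    simpa using h e he
  -- the layer
  refine ⟨Δ'.filter (fun e => ∑ i, e i = ν), c', fun e he => (Finset.mem_filter.mp he).2, ?_, ?_, ?_, ?_⟩
  · -- `Y^ν = chartExp (y^ν)`
    have hyg : (![0, ν, 0] : Fin 3 → ℕ) ∈ Δg := Finset.mem_filter.mpr ⟨hyν, by simp⟩
    have he : chartExp b ν ![0, ν, 0] = ![0, 0, ν] := by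
      ext i; fin_cases i <;> simp [chartExp]
    refine Finset.mem_filter.mpr ⟨?_, by simp [Fin.sum_univ_three]⟩
    rw [← he]
    exact Finset.mem_image_of_mem _ hyg
  · show IsUnit (φ (a (inv ![0, 0, ν])))
    have : inv ![0, 0, ν] = ![0, ν, 0] := by
      ext i; fin_cases i <;> simp [inv]
    rw [this]
    exact (hunit _ hyν).map φ
  · intro e he he0
    obtain ⟨he', hdeg'⟩ := Finset.mem_filter.mp he
    obtain ⟨α, hα, rfl⟩ := Finset.mem_image.mp he'
    obtain ⟨hαΔ, hcα⟩ := Finset.mem_filter.mp hα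
    simp only [chartExp_zero] at he0
    rw [Fin.sum_univ_three, chartExp_zero, chartExp_one, chartExp_two] at hdeg'
    have hα2 : α 2 < M := by omega
    have hp : r * (ν - α 1) ≤ q * α 0 := (hprep α hαΔ).resolve_right (by omega)
    have hα1 : α 1 ≤ ν := by omega
    obtain ⟨m, hm⟩ := Nat.exists_eq_add_of_le hα1
    have hm' : ν - α 1 = m := by omega
    rw [hm'] at hp
    have hbν : b * ν = b * α 1 + b * m := by rw [hm, mul_add]
    have hα0 : α 0 = b * m := by omega
    rw [hr, hα0, add_mul] at hp
    have hρm : ρ * m = 0 := by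
      have : q * b * m + ρ * m ≤ q * b * m := by
        calc q * b * m + ρ * m ≤ q * (b * m) := hp
          _ = q * b * m := by ring
      omega
    have hm0 : m = 0 := by
      rcases Nat.mul_eq_zero.mp hρm with h | h
      · omega
      · exact h
    ext i
    fin_cases i
    · show chartExp b ν α 0 = 0
      exact he0
    · show chartExp b ν α 1 = 0
      rw [chartExp_one]; omega
    · show chartExp b ν α 2 = ν
      rw [chartExp_two]; omega
  · -- the rest of `Δ'` has degree `≥ ν + 1`
    have hrest : ∑ e ∈ Δ'.filter (fun e => ¬ ∑ i, e i = ν), c' e * ∏ i, ![t, φ z, Y] i ^ e i ∈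
        maximalIdeal T ^ (ν + 1) := by
      refine Ideal.sum_mem _ (fun e he => ?_)
      obtain ⟨he', hne⟩ := Finset.mem_filter.mp he
      have hge : ν + 1 ≤ ∑ i, e i := by have := hdeg e he'; omega
      exact Ideal.mul_mem_left _ _ (Ideal.pow_le_pow_right hge
        (Theorems.LocalGameEFTNewton.prod_pow_mem_pow ![t, φ z, Y] h𝔪T e))
    have hsplit := Finset.sum_filter_add_sum_filter_not Δ' (fun e => ∑ i, e i = ν)
      (fun e => c' e * ∏ i, ![t, φ z, Y] i ^ e i)
    have h := Ideal.add_mem _ hr' hrest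
    rw [← hsplit] at h
    convert h using 1
    ring


/-! ### §14d THE RING SIDE OF (o56)(b′) OVER A CHART MODEL — one theorem.  Input: a model `φ : S → T` of the `x`-chart at the
successor point (four equations), residue representatives `Λ_S ⊆ S`, persistence of `ν`, and an EXPANSION ORACLE on the `S` side:
for every `c ∈ S` and every precision `M`, ONE unit expansion of `f` in the frame `(x, y − c·x^{b+1}, z)` mod `𝔪_S^M` that is
cylinder-or-deep, prepared-or-deep, contains `y'^ν`, and has a prepared `τ = 0` witness — exactly what the three positive-weight
readings of §14b give from the three frame facts of §13.  Output: `SuccessorRatioBound T f₁ ν q ρ`.  No statement about `T` beyond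
regularity, dimension 3 and the frame `(t, φ z, Y)`. -/

/-- [OURS · L1 w43 · R9 §14d · CANDIDATE-FREE] **(b′) over a chart model.** -/
theorem oneFlagRatioBound_of_chart (Λ : Set S) (φ : S →+* T) (hdimT : ringKrullDim T = (3 : ℕ)) {x y z : S} {t Y : T}
    (h𝔪T : Ideal.span (Set.range ![t, φ z, Y]) = maximalIdeal T) (hres : ∀ w : T, ∃ c ∈ Λ, w - φ c ∈ maximalIdeal T)
    {b ν q r ρ : ℕ} (hx : φ x = t) (hy : φ y = t ^ b * Y) (hφ : Ideal.map φ (maximalIdeal S) ≤ maximalIdeal T)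
    (ht2 : t ∉ maximalIdeal T ^ 2) (hz : z ∈ maximalIdeal S) (hν : 0 < ν) (hρ : 0 < ρ) (hρq : ρ < q)
    (hr : r = q * b + ρ) {f : S} {f₁ : T} (hf₁ : φ f = t ^ (b * ν) * f₁) (hpers : f₁ ∈ maximalIdeal T ^ ν)
    (horacle : ∀ c : S, ∀ M : ℕ, ∃ (Δ : Finset (Fin 3 → ℕ)) (a : (Fin 3 → ℕ) → S), (∀ α ∈ Δ, IsUnit (a α)) ∧
      f - ∑ α ∈ Δ, a α * ∏ i, ![x, y - c * x ^ (b + 1), z] i ^ α i ∈ maximalIdeal S ^ M ∧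
      (∀ α ∈ Δ, b * ν ≤ α 0 + b * α 1 ∨ M ≤ α 2) ∧ (∀ α ∈ Δ, r * (ν - α 1) ≤ q * α 0 ∨ M ≤ α 2) ∧
      (![0, ν, 0] : Fin 3 → ℕ) ∈ Δ ∧
      ∃ α₀ ∈ Δ, r * (ν - α₀ 1) ≤ q * α₀ 0 ∧ q * α₀ 0 + α₀ 2 < (r + 1) * (ν - α₀ 1)) :
    OneFlagRatioBound T f₁ ν q ρ := by
  classical
  have hq : 0 < q := lt_of_le_of_lt (Nat.zero_le _) hρq
  -- the translated charts
  have hy' : ∀ c : S, φ (y - c * x ^ (b + 1)) = t ^ b * (Y - φ c * t) := by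
    intro c
    rw [map_sub, map_mul, map_pow, hx, hy]
    ring
  -- (D2) layer data from the oracle at `c = 0`
  obtain ⟨Δ₀, a₀, hunit₀, hrem₀, hcyl₀, hprep₀, hyν₀, -⟩ := horacle 0 (ν + 1 + b * ν)
  have hrem₀' : f - ∑ α ∈ Δ₀, a₀ α * ∏ i, ![x, y, z] i ^ α i ∈ maximalIdeal S ^ (ν + 1 + b * ν) := by
    simpa using hrem₀
  obtain ⟨ΔT, aT, hΔ, hα₀, ha₀, htfree, hf⟩ := layerData_of_chart φ hdimT h𝔪T hx hy hφ ht2 hz hρ hr hunit₀ hrem₀'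
    le_rfl hcyl₀ hprep₀ hyν₀ hf₁ hpers
  refine oneFlagRatioBound_of_lowWitnesses (φ '' Λ) ?_ hdimT h𝔪T hν hρ hρq hΔ hα₀ ha₀ htfree hf ?_
  · intro w
    obtain ⟨c, hc, hw⟩ := hres w
    exact ⟨φ c, ⟨c, hc, rfl⟩, hw⟩
  · rintro _ ⟨c, hc, rfl⟩ A B hB hK h2
    obtain ⟨Δ, a, hunit, hrem, hcyl, hprep, -, α₀, hα₀Δ, hprep₀, hwit₀⟩ := horacle c (A * ν + b * ν)
    exact lowWitness_of_chart_of_deep φ hx (hy' c) hφ ht2 hz hq hr hunit hrem le_rfl hcyl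
      (by simpa [map_mul, map_pow, hx] using hf₁) hα₀Δ hprep₀ hwit₀

/-- The two-flag (`σ₁`) form of `oneFlagRatioBound_of_chart` (kept under its name of record). [folklore] -/
theorem successorRatioBound_of_chart (Λ : Set S) (φ : S →+* T) (hdimT : ringKrullDim T = (3 : ℕ)) {x y z : S} {t Y : T}
    (h𝔪T : Ideal.span (Set.range ![t, φ z, Y]) = maximalIdeal T) (hres : ∀ w : T, ∃ c ∈ Λ, w - φ c ∈ maximalIdeal T)
    {b ν q r ρ : ℕ} (hx : φ x = t) (hy : φ y = t ^ b * Y) (hφ : Ideal.map φ (maximalIdeal S) ≤ maximalIdeal T)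
    (ht2 : t ∉ maximalIdeal T ^ 2) (hz : z ∈ maximalIdeal S) (hν : 0 < ν) (hρ : 0 < ρ) (hρq : ρ < q)
    (hr : r = q * b + ρ) {f : S} {f₁ : T} (hf₁ : φ f = t ^ (b * ν) * f₁) (hpers : f₁ ∈ maximalIdeal T ^ ν)
    (horacle : ∀ c : S, ∀ M : ℕ, ∃ (Δ : Finset (Fin 3 → ℕ)) (a : (Fin 3 → ℕ) → S), (∀ α ∈ Δ, IsUnit (a α)) ∧
      f - ∑ α ∈ Δ, a α * ∏ i, ![x, y - c * x ^ (b + 1), z] i ^ α i ∈ maximalIdeal S ^ M ∧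
      (∀ α ∈ Δ, b * ν ≤ α 0 + b * α 1 ∨ M ≤ α 2) ∧ (∀ α ∈ Δ, r * (ν - α 1) ≤ q * α 0 ∨ M ≤ α 2) ∧
      (![0, ν, 0] : Fin 3 → ℕ) ∈ Δ ∧
      ∃ α₀ ∈ Δ, r * (ν - α₀ 1) ≤ q * α₀ 0 ∧ q * α₀ 0 + α₀ 2 < (r + 1) * (ν - α₀ 1)) :
    SuccessorRatioBound T f₁ ν q ρ :=
  (oneFlagRatioBound_of_chart Λ φ hdimT h𝔪T hres hx hy hφ ht2 hz hν hρ hρq hr hf₁ hpers horacle).successorRatioBound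



end ChartPullback

/-! ### §14e … AND FROM THE THREE FRAME FACTS.  The expansion oracle of §14d is discharged by the tree's unit expansion and
readings, applied ONCE per `(c, M)` in the translated frame `(x, y − c·x^{b+1}, z)`, to which the frame facts transport by §13
(`frame_translate_eq`: weight of `x^{b+1}` dominates that of `y` for all three weight vectors since `ρ < q`).  Net theorem
`successorRatioBound_of_frameFacts`: (b′)'s ring side from (F0) `f ∈ 𝔪_S^ν ∖ 𝔪_S^{ν+1}`, (F1) the cylinder fact
`f ∈ W((x,y,z);(1,b,0);bν)`, (F2) `δ_η`-preparedness `f ∈ W((x,y,z);(q,r,0);rν)`, (F3) `τ = 0`: `f ∉ W((x,y,z);(q,r+1,1);(r+1)ν)`,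
a chart model `φ`, residue representatives, and persistence of `ν`. -/

section FrameFacts

/-- [folklore] `W` is unchanged under `y ↦ y − c·x^{b+1}` whenever `w(y) ≤ w(x)·(b+1)`. -/
theorem frame_translate_eq {A : Type*} [CommRing A] (x y z c : A) (w : Fin 3 → ℕ) {b : ℕ} (h : w 1 ≤ w 0 * (b + 1))
    (n : ℕ) : weightedMonomialIdeal ![x, y - c * x ^ (b + 1), z] w n = weightedMonomialIdeal ![x, y, z] w n := by
  have := weightedMonomialIdeal_update_add_mul_pow_eq ![x, y - c * x ^ (b + 1), z] w (i := 1) (j := 0)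
    (by decide) c (b + 1) (by simpa using h) n
  rw [← this]
  congr 1
  ext l; fin_cases l <;> simp [Function.update]

/-- [folklore] The translated frame generates the same ideal. -/
theorem span_range_frame_translate {A : Type*} [CommRing A] (x y z c : A) (b : ℕ) :
    Ideal.span (Set.range ![x, y - c * x ^ (b + 1), z]) = Ideal.span (Set.range ![x, y, z]) := by
  rw [range_vec₃, range_vec₃]
  apply le_antisymm
  · rw [Ideal.span_le]
    refine Set.insert_subset_iff.mpr ⟨Ideal.subset_span (by simp), Set.insert_subset_iff.mpr ⟨?_, ?_⟩⟩
    · have hx : x ∈ Ideal.span ({x, y, z} : Set A) := Ideal.subset_span (by simp)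
      have hy : y ∈ Ideal.span ({x, y, z} : Set A) := Ideal.subset_span (by simp)
      exact sub_mem hy (Ideal.mul_mem_left _ c (Ideal.pow_mem_of_mem _ hx (b + 1) (Nat.succ_pos b)))
    · exact Set.singleton_subset_iff.mpr (Ideal.subset_span (by simp))
  · rw [Ideal.span_le]
    refine Set.insert_subset_iff.mpr ⟨Ideal.subset_span (by simp), Set.insert_subset_iff.mpr ⟨?_, ?_⟩⟩
    · have hx : x ∈ Ideal.span ({x, y - c * x ^ (b + 1), z} : Set A) := Ideal.subset_span (by simp)
      have hy : y - c * x ^ (b + 1) ∈ Ideal.span ({x, y - c * x ^ (b + 1), z} : Set A) := Ideal.subset_span (by simp)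
      have := add_mem hy (Ideal.mul_mem_left _ c (Ideal.pow_mem_of_mem _ hx (b + 1) (Nat.succ_pos b)))
      simpa using this
    · exact Set.singleton_subset_iff.mpr (Ideal.subset_span (by simp))

/-- Unfolding a three-letter weight. [folklore] -/
theorem weight_three (w₀ w₁ w₂ : ℕ) (α : Fin 3 → ℕ) : ∑ i, ![w₀, w₁, w₂] i * α i = w₀ * α 0 + w₁ * α 1 + w₂ * α 2 := by
  simp [Fin.sum_univ_three]

variable {S T : Type*} [CommRing S] [IsRegularLocalRing S] [CommRing T] [IsRegularLocalRing T]

/-- [OURS · L1 w43 · R9 §14e · CANDIDATE-FREE] **(b′)'s ring side from the frame facts and a chart model.** -/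
theorem oneFlagRatioBound_of_frameFacts (hdimS : ringKrullDim S = (3 : ℕ)) {x y z : S}
    (hu : Ideal.span (Set.range ![x, y, z]) = maximalIdeal S) (Λ : Set S) (φ : S →+* T)
    (hdimT : ringKrullDim T = (3 : ℕ)) {t Y : T} (h𝔪T : Ideal.span (Set.range ![t, φ z, Y]) = maximalIdeal T)
    (hres : ∀ w : T, ∃ c ∈ Λ, w - φ c ∈ maximalIdeal T) {b ν q r ρ : ℕ} (hb : 0 < b) (hx : φ x = t)
    (hy : φ y = t ^ b * Y) (hφ : Ideal.map φ (maximalIdeal S) ≤ maximalIdeal T) (ht2 : t ∉ maximalIdeal T ^ 2)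
    (hν : 0 < ν) (hρ : 0 < ρ) (hρq : ρ < q) (hr : r = q * b + ρ) {f : S} {f₁ : T} (hf₁ : φ f = t ^ (b * ν) * f₁)
    (hpers : f₁ ∈ maximalIdeal T ^ ν) (hF0 : f ∈ maximalIdeal S ^ ν) (hF0' : f ∉ maximalIdeal S ^ (ν + 1))
    (hF1 : f ∈ weightedMonomialIdeal ![x, y, z] ![1, b, 0] (b * ν))
    (hF2 : f ∈ weightedMonomialIdeal ![x, y, z] ![q, r, 0] (r * ν))
    (hF3 : f ∉ weightedMonomialIdeal ![x, y, z] ![q, r + 1, 1] ((r + 1) * ν)) :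
    OneFlagRatioBound T f₁ ν q ρ := by
  classical
  have hq : 0 < q := lt_of_le_of_lt (Nat.zero_le _) hρq
  have hqr : q < r := by
    have : q ≤ q * b := Nat.le_mul_of_pos_right q hb
    omega
  have hr0 : 0 < r := lt_of_le_of_lt (Nat.zero_le _) hqr
  have hr1 : r + 1 ≤ q * (b + 1) := by rw [hr, Nat.mul_succ]; omega
  have hrle : r ≤ q * (b + 1) := by omega
  have hz : z ∈ maximalIdeal S := by
    simpa using Theorems.LocalGameEFTNewton.mem_maximalIdeal_of_span_eq ![x, y, z] hu 2
  refine oneFlagRatioBound_of_chart Λ φ hdimT h𝔪T hres hx hy hφ ht2 hz hν hρ hρq hr hf₁ hpers ?_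
  intro c M
  -- the translated frame and the transported frame facts (§13)
  have huc : Ideal.span (Set.range ![x, y - c * x ^ (b + 1), z]) = maximalIdeal S := by
    rw [span_range_frame_translate, hu]
  have hF1c : f ∈ weightedMonomialIdeal ![x, y - c * x ^ (b + 1), z] ![1, b, 0] (b * ν) := by
    rw [frame_translate_eq x y z c ![1, b, 0] (by simp)]; exact hF1
  have hF2c : f ∈ weightedMonomialIdeal ![x, y - c * x ^ (b + 1), z] ![q, r, 0] (r * ν) := by
    rw [frame_translate_eq x y z c ![q, r, 0] (by simpa using hrle)]; exact hF2
  have hF3c : f ∉ weightedMonomialIdeal ![x, y - c * x ^ (b + 1), z] ![q, r + 1, 1] ((r + 1) * ν) := by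
    rw [frame_translate_eq x y z c ![q, r + 1, 1] (by simpa using hr1)]; exact hF3
  -- one unit expansion, precision `N`
  set M' := M + (r + 1) * ν + ν + 1 with hM'
  have hM'pos : 0 < M' := by omega
  set N := M' * (r * ν) + M' * (b * ν) + M' + 1 with hN
  obtain ⟨Δ, a, hunit, -, hrem⟩ :=
    Theorems.LocalGameEFTNewton.exists_unitExpansion ![x, y - c * x ^ (b + 1), z] huc f N
  -- reading (a): cylinder-or-deep
  have hwa : ∀ i, 0 < (![M', M' * b, 1] : Fin 3 → ℕ) i := by
    intro i; fin_cases i <;> simp [hM'pos, hb]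
  have hF1c' : f ∈ weightedMonomialIdeal ![x, y - c * x ^ (b + 1), z] ![M', M' * b, 1] (M' * (b * ν)) :=
    weightedMonomialIdeal_mono_weights _ (w := ![1, b, 0]) (w' := ![M', M' * b, 1]) (L := M')
      (by intro i; fin_cases i <;> simp) _ hF1c
  have hreadA := Theorems.LocalGameEFTNewton.le_weight_of_mem_weightedMonomialIdeal ![x, y - c * x ^ (b + 1), z] huc
    hdimS ![M', M' * b, 1] hwa hunit hrem hF1c' (by rw [hN]; omega)
  have hcylM : ∀ α ∈ Δ, b * ν ≤ α 0 + b * α 1 ∨ M ≤ α 2 := by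
    intro α hα
    have h := hreadA α hα
    rw [weight_three] at h
    have h' : M' * (b * ν) ≤ M' * (α 0 + b * α 1) + α 2 := by
      calc M' * (b * ν) ≤ M' * α 0 + M' * b * α 1 + 1 * α 2 := h
        _ = M' * (α 0 + b * α 1) + α 2 := by ring
    rcases le_or_le_of_scaled h' with h1 | h1
    · exact Or.inl h1
    · exact Or.inr (by omega)
  -- reading (c): prepared-or-deep
  have hwc : ∀ i, 0 < (![M' * q, M' * r, 1] : Fin 3 → ℕ) i := by
    intro i; fin_cases i <;> simp [hM'pos, hq, hr0]
  have hF2c' : f ∈ weightedMonomialIdeal ![x, y - c * x ^ (b + 1), z] ![M' * q, M' * r, 1] (M' * (r * ν)) :=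
    weightedMonomialIdeal_mono_weights _ (w := ![q, r, 0]) (w' := ![M' * q, M' * r, 1]) (L := M')
      (by intro i; fin_cases i <;> simp) _ hF2c
  have hreadC := Theorems.LocalGameEFTNewton.le_weight_of_mem_weightedMonomialIdeal ![x, y - c * x ^ (b + 1), z] huc
    hdimS ![M' * q, M' * r, 1] hwc hunit hrem hF2c' (by rw [hN]; omega)
  have hprepM' : ∀ α ∈ Δ, r * ν ≤ q * α 0 + r * α 1 ∨ M' ≤ α 2 := by
    intro α hα
    have h := hreadC α hα
    rw [weight_three] at h
    have h' : M' * (r * ν) ≤ M' * (q * α 0 + r * α 1) + α 2 := by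
      calc M' * (r * ν) ≤ M' * q * α 0 + M' * r * α 1 + 1 * α 2 := h
        _ = M' * (q * α 0 + r * α 1) + α 2 := by ring
    exact le_or_le_of_scaled h'
  have hprep_of : ∀ α : Fin 3 → ℕ, r * ν ≤ q * α 0 + r * α 1 → r * (ν - α 1) ≤ q * α 0 := by
    intro α h
    rw [mul_tsub]
    exact tsub_le_iff_right.mpr h
  have hprepM : ∀ α ∈ Δ, r * (ν - α 1) ≤ q * α 0 ∨ M ≤ α 2 := by
    intro α hα
    rcases hprepM' α hα with h | h
    · exact Or.inl (hprep_of α h)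
    · exact Or.inr (by omega)
  -- reading (b): the `τ = 0` witness (shallow, hence prepared)
  have hwb : ∀ i, 0 < (![q, r + 1, 1] : Fin 3 → ℕ) i := by
    intro i; fin_cases i <;> simp [hq]
  obtain ⟨α₀, hα₀Δ, hlt⟩ := Theorems.LocalGameEFTNewton.exists_weight_lt_of_not_mem ![x, y - c * x ^ (b + 1), z] huc
    ![q, r + 1, 1] hwb hrem (by rw [hN]; omega) hF3c
  rw [weight_three, one_mul] at hlt
  have hα₀1 : α₀ 1 ≤ ν := by
    by_contra hgt
    have : (r + 1) * ν < (r + 1) * α₀ 1 := Nat.mul_lt_mul_of_pos_left (Nat.lt_of_not_le hgt) (Nat.succ_pos r)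
    omega
  obtain ⟨m, hm⟩ := Nat.exists_eq_add_of_le hα₀1
  have hm' : ν - α₀ 1 = m := by omega
  have hwit₀ : q * α₀ 0 + α₀ 2 < (r + 1) * (ν - α₀ 1) := by
    rw [hm']
    have : (r + 1) * ν = (r + 1) * α₀ 1 + (r + 1) * m := by rw [hm, mul_add]
    omega
  have hprep₀ : r * (ν - α₀ 1) ≤ q * α₀ 0 := by
    rcases hprepM' α₀ hα₀Δ with h | h
    · exact hprep_of α₀ h
    · exfalso; omega
  -- reading (d): `y^ν` is the unique exponent of degree `ν`
  obtain ⟨-, α₁, hα₁Δ, hdeg⟩ := Theorems.LocalGameEFTNewton.exists_degree_eq_of_not_mem_pow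
    ![x, y - c * x ^ (b + 1), z] huc hdimS hunit hrem hF0 hF0' (by rw [hN]; omega)
  rw [Fin.sum_univ_three] at hdeg
  have hyν : (![0, ν, 0] : Fin 3 → ℕ) ∈ Δ := by
    have hp : r * ν ≤ q * α₁ 0 + r * α₁ 1 := by
      rcases hprepM' α₁ hα₁Δ with h | h
      · exact h
      · exfalso; omega
    have hrν : r * ν = r * α₁ 0 + r * α₁ 1 + r * α₁ 2 := by rw [← hdeg]; ring
    have hα₁0 : α₁ 0 = 0 := by
      by_contra hne
      have hpos : 0 < α₁ 0 := Nat.pos_of_ne_zero hne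
      have : q * α₁ 0 < r * α₁ 0 := Nat.mul_lt_mul_of_pos_right hqr hpos
      omega
    have hα₁2 : α₁ 2 = 0 := by
      have h0 : r * α₁ 2 = 0 := by rw [hα₁0] at hp hrν; simp at hp hrν; omega
      rcases Nat.mul_eq_zero.mp h0 with h | h
      · omega
      · exact h
    have heq : α₁ = ![0, ν, 0] := by
      ext i; fin_cases i
      · simpa using hα₁0
      · show α₁ 1 = ν; omega
      · simpa using hα₁2
    rw [← heq]; exact hα₁Δ
  exact ⟨Δ, a, hunit, Ideal.pow_le_pow_right (by rw [hN]; omega) hrem, hcylM, hprepM, hyν, α₀, hα₀Δ, hprep₀, hwit₀⟩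

/-- The two-flag (`σ₁`) form of `oneFlagRatioBound_of_frameFacts` (kept under its name of record). [folklore] -/
theorem successorRatioBound_of_frameFacts (hdimS : ringKrullDim S = (3 : ℕ)) {x y z : S}
    (hu : Ideal.span (Set.range ![x, y, z]) = maximalIdeal S) (Λ : Set S) (φ : S →+* T)
    (hdimT : ringKrullDim T = (3 : ℕ)) {t Y : T} (h𝔪T : Ideal.span (Set.range ![t, φ z, Y]) = maximalIdeal T)
    (hres : ∀ w : T, ∃ c ∈ Λ, w - φ c ∈ maximalIdeal T) {b ν q r ρ : ℕ} (hb : 0 < b) (hx : φ x = t)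
    (hy : φ y = t ^ b * Y) (hφ : Ideal.map φ (maximalIdeal S) ≤ maximalIdeal T) (ht2 : t ∉ maximalIdeal T ^ 2)
    (hν : 0 < ν) (hρ : 0 < ρ) (hρq : ρ < q) (hr : r = q * b + ρ) {f : S} {f₁ : T} (hf₁ : φ f = t ^ (b * ν) * f₁)
    (hpers : f₁ ∈ maximalIdeal T ^ ν) (hF0 : f ∈ maximalIdeal S ^ ν) (hF0' : f ∉ maximalIdeal S ^ (ν + 1))
    (hF1 : f ∈ weightedMonomialIdeal ![x, y, z] ![1, b, 0] (b * ν))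
    (hF2 : f ∈ weightedMonomialIdeal ![x, y, z] ![q, r, 0] (r * ν))
    (hF3 : f ∉ weightedMonomialIdeal ![x, y, z] ![q, r + 1, 1] ((r + 1) * ν)) :
    SuccessorRatioBound T f₁ ν q ρ :=
  (oneFlagRatioBound_of_frameFacts hdimS hu Λ φ hdimT h𝔪T hres hb hx hy hφ ht2 hν hρ hρq hr hf₁ hpers hF0 hF0' hF1 hF2 hF3).successorRatioBound

end FrameFacts

/-! ## §15 (gen 9, R9.15) TORUS TRANSFER — the one-flag bound descends along ring maps
The door's successor germs are NOT the chart local ring `T₃` of §14e but the local rings `B_𝔫` of the cobordant algebra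
`B = S[t⁻¹, x·t, y·t^b]` (`cobordantAlgebra'`; binder shape of `ContactCylinder.curve_drop_of_typeA_typeB`) at primes `𝔫 ∋ t⁻¹` off the
vertex: on the `x`-chart `B[(xt)⁻¹] = A_x[X, X⁻¹]` (`X = x·t`, `A_x = S[y/x^b]`), so `B_𝔫` is a localization of `T₃[X]` — of dimension `4`
at a closed orbit point (`𝔫 ⊇ (𝔪_{T₃}, X − a)`), of dimension `3` with residue field `k(X)` at the generic orbit point.  Contact only GROWS
under a ring map `π : T' → T` with `π(𝔪_{T'}) ⊆ 𝔪_T` (`ratContactFiltration_map_le`), so the ONE-FLAG bound for `π f'` in `T` gives the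
one-flag bound — hence `SuccessorRatioBound` — for `f'` in `T'` (`OneFlagRatioBound.of_map`, `successorRatioBound_of_map`).  Door recipe at a
(rational) closed orbit point: `π : B_𝔫 → B_𝔫 ⧸ (v)` (`v = X − a`, or any regular parameter of `B_𝔫` transverse to the chart), a regular local
ring of dimension `3` with frame `(t, z, Y)` receiving `S` by `π ∘ algebraMap`; apply `oneFlagRatioBound_of_frameFacts` THERE and pull the bound
back to `B_𝔫` by `successorRatioBound_of_map`.  The generic orbit point (`k(X)`) and non-rational orbit points need the residue-field base
change already listed under (D1)/`hres` — the same lemma then pulls back from `B_𝔫 ⧸ (p(X))`. -/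

section TorusTransfer

variable {T T' : Type*} [CommRing T] [IsLocalRing T] [CommRing T'] [IsLocalRing T']

/-- Contact grows under a ring map respecting the maximal ideals: `π(RC(g; a, b; n)) ⊆ RC(π g; a, b; n)`. [folklore] -/
theorem ratContactFiltration_map_le (π : T' →+* T) (hπ : (maximalIdeal T').map π ≤ maximalIdeal T) (g : T') (a b n : ℕ) :
    (ratContactFiltration g a b n).map π ≤ ratContactFiltration (π g) a b n := by
  rw [ratContactFiltration_def, ratContactFiltration_def, Ideal.map_iSup]
  refine iSup_mono fun α => ?_
  rw [Ideal.map_mul, Ideal.map_span, Set.image_singleton, map_pow, Ideal.map_pow]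
  exact Ideal.mul_mono_right (Ideal.pow_right_mono hπ _)

/-- [OURS · R9 · §15] **The one-flag ratio bound descends**: if `π f'` obeys it in `T` then `f'` obeys it in `T'`, for any ring map
`π : T' → T` with `π(𝔪_{T'}) ⊆ 𝔪_T`. [folklore] -/
theorem OneFlagRatioBound.of_map {f' : T'} {ν q ρ : ℕ} (π : T' →+* T) (hπ : (maximalIdeal T').map π ≤ maximalIdeal T)
    (h : OneFlagRatioBound T (π f') ν q ρ) : OneFlagRatioBound T' f' ν q ρ := by
  intro g hg a b hb hba hmem
  exact h (π g) (hπ (Ideal.mem_map_of_mem π hg)) a b hb hba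
    (ratContactFiltration_map_le π hπ g a b _ (Ideal.mem_map_of_mem π hmem))

/-- [OURS · R9 · §15] **`SuccessorRatioBound` in the bigger germ from the one-flag bound in a quotient / retract.** [folklore] -/
theorem successorRatioBound_of_map {f' : T'} {ν q ρ : ℕ} (π : T' →+* T) (hπ : (maximalIdeal T').map π ≤ maximalIdeal T)
    (h : OneFlagRatioBound T (π f') ν q ρ) : SuccessorRatioBound T' f' ν q ρ :=
  (h.of_map π hπ).successorRatioBound

/-- The hypothesis `π(𝔪_{T'}) ⊆ 𝔪_T` for a local homomorphism. [folklore] -/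
theorem map_maximalIdeal_le_of_isLocalHom (π : T' →+* T) [IsLocalHom π] : (maximalIdeal T').map π ≤ maximalIdeal T :=
  Ideal.map_le_iff_le_comap.mpr fun x hx => map_nonunit π x hx

/-- The hypothesis `π(𝔪_{T'}) ⊆ 𝔪_T` for a surjection of local rings (e.g. `B_𝔫 → B_𝔫 ⧸ (v)`). [folklore] -/
theorem map_maximalIdeal_le_of_surjective (π : T' →+* T) (hπ : Function.Surjective π) :
    (maximalIdeal T').map π ≤ maximalIdeal T := by
  refine IsLocalRing.le_maximalIdeal fun htop => ?_
  obtain ⟨x, hx, hx1⟩ := (Ideal.mem_map_iff_of_surjective π hπ).mp (htop ▸ Submodule.mem_top : (1 : T) ∈ _)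
  have hu : IsUnit (1 - x) := IsLocalRing.isUnit_one_sub_self_of_mem_nonunits x hx
  have h0 : π (1 - x) = 0 := by rw [map_sub, map_one, hx1, sub_self]
  have := (hu.map π)
  rw [h0, isUnit_zero_iff] at this
  exact zero_ne_one this

/-- [OURS · R9 · §15] A unit factor does not change the bound (the door's `g = X^{bν}·f₁` on the `x`-chart, `X = x·t` a unit). [folklore] -/
theorem SuccessorRatioBound.mul_of_isUnit {f u : T'} {ν q ρ : ℕ} (hu : IsUnit u) (h : SuccessorRatioBound T' f ν q ρ) :
    SuccessorRatioBound T' (u * f) ν q ρ := by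
  intro q' r₁ r₂ hadm hfl
  obtain ⟨g₁, g₂, hfl', hmem⟩ := hfl
  refine h q' r₁ r₂ hadm ⟨g₁, g₂, hfl', ?_⟩
  obtain ⟨v, rfl⟩ := hu
  have hf : f = ↑v⁻¹ * (↑v * f) := by rw [← mul_assoc, Units.inv_mul, one_mul]
  rw [hf]
  exact Ideal.mul_mem_left _ _ hmem

/-- Usage: the bound at the door's successor germ `B_𝔫` from the bound in a quotient `B_𝔫 → T` by a local (e.g. surjective) map. -/
example (π : T' →+* T) [IsLocalHom π] {f' : T'} {ν q ρ : ℕ} (h : OneFlagRatioBound T (π f') ν q ρ) :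
    SuccessorRatioBound T' f' ν q ρ :=
  successorRatioBound_of_map π (map_maximalIdeal_le_of_isLocalHom π) h

example (π : T' →+* T) (hπ : Function.Surjective π) {f' : T'} {ν q ρ : ℕ} (h : OneFlagRatioBound T (π f') ν q ρ) :
    SuccessorRatioBound T' f' ν q ρ :=
  successorRatioBound_of_map π (map_maximalIdeal_le_of_surjective π hπ) h

end TorusTransfer


end R9

end Iota3

end Summit.ResolutionOfSingularities.ResolutionOfSingularities.Cruxes.HypersurfaceCentreConstruction.LocalEngine
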